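import Mathlib
import HarnessLib

/-!
# Helicity modulus of a complex gradient perturbation of the lattice free field on `(ℤ/n)^4`

Stiffness bookkeeping for the complex-weight gradient model, with the renormalisation-group input
kept as typed hypotheses (definitions) and everything else proved.

## The model
On the discrete torus `Λ = (ℤ/n)^4` (axis `0` = imaginary time `τ`, axes `1,2,3` = space) we take
real fields `φ : Λ → ℝ`, the tilted Gaussian action
`S_u(φ) = ½ Σ_x Σ_i (∂_iφ(x) + u_i)² + (Σ_x φ(x))²/(2|Λ|)` (imposed uniform twist `u ∈ ℝ⁴`; rank-one
zero-mode mass in place of a zero-average constraint) and the cubic gradient (“Berry”) vertex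
`X_u(φ) = Σ_x (∂_τφ + u_τ)(Σ_{j≥1}(∂_jφ + u_j)²)`, with the COMPLEX weight
`w_{g,u} = exp(−S_u − i g X_u)`, `g ≥ 0`.  `Z_n(g,u) = ∫_{ℝ^Λ} w_{g,u}` is the tilted partition
function, `ev n g F` the normalised expectation under `w_{g,0}`, and
`Υ_n(g)[u] = |u|² + g²(⟨Y_u²⟩_g − ⟨Y_u⟩_g²)/|Λ|` the HELICITY MODULUS (superfluid stiffness) as a
quadratic form in the twist — equal to the zero-twist Hessian of `−log Z_n(g,t·u)/|Λ|`
(`upsilon_eq_logZ_hessian`), i.e. Fisher–Barber–Jasnow's definition, in finite volume.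

This is a gradient model with a finite-range perturbation `𝒦_g(∇φ) = e^{−ig𝒦(∇φ)} − 1` of the
massless Gaussian measure, as in Adams–Buchholz–Kotecký–Müller, except that `𝒦_g` is complex; it
satisfies the reflection symmetry `𝒦_g(−z) = conj 𝒦_g(z)` (“`ι`-symmetry”), which is what makes
`Z_n(g,0)`, the cumulants of even observables and `Υ_n` real (section *Reality*).

## Contents (all theorems are proved; the two volume-uniform hypotheses are definitions)
* objects `D S X w Z ev Y Upsilon`; identities `S_u = S_0 + |Λ||u|²/2`, the tilt expansion of `X`;
* `StiffnessAt L g₀` / `SharpStiffnessAt L g₀ C`: volume-uniform stiffness along the tower of tori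
  `n = L^N` (`Z ≠ 0`, nearest-neighbour order `Re⟨cos(∂_iφ/√K)⟩_g ≥ 1/2`, `|Υ − |u|²| ≤ |u|²/2`,
  resp. `≤ C g²|u|²`) — `Prop`-valued definitions in the quantifier shape of the reference's
  Theorem 2.2 (`g₀` depends on the odd base `L`, uniform in `N`);
* `CumulantBoundAt L g₀ C` / `LocalTwoPointAt L g₀ C` (and the rate-free `LocalTwoPointWithinAt`):
  the two readings of an `N`-uniform bound on the derivatives of the finite-volume perturbative free
  energy for this weight — hypothesis (A).  DEFINITIONS, used only as hypotheses;
* the reduction `stiffnessAt_of_hypA` / `stiffness_tower_of_hypA`: hypothesis (A) ALONE implies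
  `StiffnessAt` and `SharpStiffnessAt` (the Gaussian lower bound `CosLowerBoundAt (2/3)` that the
  reduction also consumes is PROVED here, `cosLowerBoundAt_two_thirds`, by symmetry and a
  derivative-free scaling argument);
* the identifications that make (A) an instance of a free-energy-derivative bound:
  `upsilon_eq_logZ_hessian` (twist Hessian, branch-free) and `upsilon_eq_mgfHessian` (the variance is
  the `ε`-Hessian of `log ∫ w_{g,0} e^{εY_u}`, a real exponential tilt inside the `ι`-symmetric class);
* fixed volume: `cumulantBound_fixedVolume`, `localTwoPoint_fixedVolume`, `stiffness_fixedVolume` —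
  with constants depending on the torus everything holds unconditionally, so the content of (A) is
  exactly the UNIFORMITY in `N`.

## Design choices
* Lebesgue integral over all of `ℝ^Λ` with the rank-one zero-mode mass `(Σφ)²/(2|Λ|)` (instead of the
  reference's measure on zero-average fields): `e^{−S_0}` is then integrable, `S_0` is translation and
  axis-permutation invariant, and the tilt does not see the mass term.  `d = 4`, one component.
* `ev` divides by `Z_n(g,0)`; every statement that uses it carries `Z_n(g,0) ≠ 0` (no junk values are
  asserted).  `Υ_n` is typed by its explicit second-order formula, and the Hessian reading is a
  theorem, so no branch of a complex logarithm is ever chosen.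
* What is NOT here: no claim uniform in the volume is asserted (that is a renormalisation-group
  theorem, in print only for real perturbations); nothing on compact (vortex-carrying) phases, on
  long-range order, or on quantum lattice models — `StiffnessAt` is a statement about this classical
  complex-weight gradient model only.

## References
* S. Adams, S. Buchholz, R. Kotecký, S. Müller, *Cauchy–Born rule from microscopic models with
  non-convex potentials*, arXiv:1910.13564 — Sec. 2.1 (finite-volume setup on the tori `(ℤ/L^N)^d`,
  finite-range perturbations `𝒦` of the Gaussian gradient measure, the perturbative partition function
  and free energy `𝒲_N`), Theorem 2.2 (smoothness of `𝒲_N` in `𝒦` with bounds uniform in `N`, `L` odd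
  and large) [AdamsBuchholzKoteckyMuller2019].
* M. E. Fisher, M. N. Barber, D. Jasnow, *Helicity modulus, superfluidity, and scaling in isotropic
  systems*, Phys. Rev. A 8 (1973) 1111 — Sec. II, eqs. (2.4)–(2.5) (the helicity modulus as the
  second-order free-energy response to a twist) [FisherBarberJasnow1973].
* S. Friedli, Y. Velenik, *Statistical Mechanics of Lattice Systems*, CUP 2017 — Ch. 8 (the Gaussian
  free field: Gaussian integrals, massive/massless lattice GFF) [FriedliVelenik2017].
-/

noncomputable section
namespace Literature.MathematicalPhysics.StatisticalMechanics.ComplexGradientGFF4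

open scoped BigOperators
open _root_.MeasureTheory

variable {n : ℕ}

/-- Forward lattice gradient `∂_iφ(x) = φ(x + e_i) − φ(x)` on the discrete torus `(ℤ/n)^4`
(coordinate `0` = imaginary time `τ`, coordinates `1,2,3` = space). [folklore] -/
def D (φ : (Fin 4 → ZMod n) → ℝ) (i : Fin 4) (s : Fin 4 → ZMod n) : ℝ :=
  φ (s + Pi.single i 1) - φ s

/-- The tilted massless Gaussian action on `(ℤ/n)^4`: `S_u(φ) = ½ Σ_x Σ_i (∂_iφ(x) + u_i)² + (Σ_x
φ(x))²/(2|Λ|)` — the lattice free-field Dirichlet form with an imposed uniform twist (tilt) `u ∈ ℝ⁴`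
and a rank-one zero-mode mass (our substitute for the zero-average constraint `Σ_x φ(x) = 0` of the
reference's gradient Gibbs measures on the tori `(ℤ/L^N)^d`; it makes `e^{−S_0}` integrable on all
of `ℝ^Λ`, is translation and axis-permutation invariant, and does not see the tilt).
[cite: AdamsBuchholzKoteckyMuller2019, Sec. 2.1] -/
def S [NeZero n] (u : Fin 4 → ℝ) (φ : (Fin 4 → ZMod n) → ℝ) : ℝ :=
  (∑ s : Fin 4 → ZMod n, ∑ i : Fin 4, (D φ i s + u i) ^ 2) / 2
    + (∑ s : Fin 4 → ZMod n, φ s) ^ 2 / (2 * (Fintype.card (Fin 4 → ZMod n) : ℝ))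

/-- The cubic gradient (“Berry”) vertex with tilt `u`: `X_u(φ) = Σ_x (∂_τφ(x) + u_τ)·Σ_{j=1}^{3}
(∂_jφ(x) + u_j)²` — a nearest-neighbour gradient perturbation `Σ_x 𝒦(∇φ(x) + u)`, `𝒦(z) = z_0 (z_1²
+ z_2² + z_3²)`, entering the weight `w` with the purely imaginary coupling `−i·g` (so that `𝒦_g :=
e^{−ig𝒦} − 1` satisfies `𝒦_g(−z) = conj 𝒦_g(z)`). [folklore] -/
def X [NeZero n] (u : Fin 4 → ℝ) (φ : (Fin 4 → ZMod n) → ℝ) : ℝ :=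
  ∑ s : Fin 4 → ZMod n, (D φ 0 s + u 0) * ∑ j : Fin 3, (D φ j.succ s + u j.succ) ^ 2

/-- The complex Gibbs weight `w_{g,u}(φ) = exp(−S_u(φ) − i·g·X_u(φ))`; `‖w_{g,u}‖ = e^{−S_u}`
(`norm_w`). [folklore] -/
def w [NeZero n] (g : ℝ) (u : Fin 4 → ℝ) (φ : (Fin 4 → ZMod n) → ℝ) : ℂ :=
  Complex.exp (-((S u φ : ℝ) : ℂ) - Complex.I * ((g * X u φ : ℝ) : ℂ))

/-- The tilted finite-volume partition function `Z_n(g,u) = ∫_{ℝ^Λ} w_{g,u}(φ) dφ` of the complex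
gradient model on the torus `(ℤ/n)^4` (Lebesgue integral over all field configurations; absolutely
convergent, `integrable_w`; `Z_n(0,0) > 0`, `Z_zero_zero_pos`). On the tori `n = L^N` this is the
reference's finite-volume (perturbative) partition function, here with a complex perturbation and
the twist `u` as the external deformation. [cite: AdamsBuchholzKoteckyMuller2019, Sec. 2.1] -/
def Z (n : ℕ) [NeZero n] (g : ℝ) (u : Fin 4 → ℝ) : ℂ :=
  ∫ φ : (Fin 4 → ZMod n) → ℝ, w g u φ

/-- Normalised complex expectation `⟨F⟩_g = (∫ F·w_{g,0}) / Z_n(g,0)` under the untilted complex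
weight (a junk value when `Z_n(g,0) = 0`; every statement below that uses it carries `Z_n(g,0) ≠ 0`
alongside). [cite: AdamsBuchholzKoteckyMuller2019, Sec. 2.1] -/
def ev (n : ℕ) [NeZero n] (g : ℝ) (F : ((Fin 4 → ZMod n) → ℝ) → ℂ) : ℂ :=
  (∫ φ : (Fin 4 → ZMod n) → ℝ, F φ * w g 0 φ) / Z n g 0

/-- `Y_u(φ) = d/dt X_{tu}(φ)|_{t=0} = Σ_x [u_τ Σ_j (∂_jφ(x))² + 2 ∂_τφ(x) Σ_j u_j ∂_jφ(x)]`, the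
first-order tilt response of the Berry vertex (`X_tilt_expansion`: `X_{tu} = X_0 + t·Y_u +
t³·|Λ|·u_τ|u_sp|²`, no `t²` term). [folklore] -/
def Y [NeZero n] (u : Fin 4 → ℝ) (φ : (Fin 4 → ZMod n) → ℝ) : ℝ :=
  ∑ s : Fin 4 → ZMod n,
    (u 0 * ∑ j : Fin 3, (D φ j.succ s) ^ 2 + 2 * D φ 0 s * ∑ j : Fin 3, u j.succ * D φ j.succ s)

/-- The finite-volume HELICITY MODULUS (superfluid stiffness) of the complex gradient model, as a
quadratic form in the twist `u ∈ ℝ⁴`: `Υ_n(g)[u] = |u|² + g²·(⟨Y_u²⟩_g − ⟨Y_u⟩_g²)/|Λ|`. By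
`upsilon_eq_logZ_hessian` it IS the zero-twist Hessian `∂²_t(−log Z_n(g,t·u)/|Λ|)|_{t=0}` of the
free energy per site under an imposed uniform twist — Fisher–Barber–Jasnow's definition `ΔF ≈ ½ Υ
⟨∇φ⟩² V` — typed directly (junk-free: the only division is by `Z_n(g,0)`). It is real (`Upsilon_im`)
and equals `|u|²` at `g = 0`. [cite: FisherBarberJasnow1973, Sec. II, eqs. (2.4)–(2.5)] -/
def Upsilon (n : ℕ) [NeZero n] (g : ℝ) (u : Fin 4 → ℝ) : ℂ :=
  ((∑ i : Fin 4, (u i) ^ 2 : ℝ) : ℂ)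
    + (g : ℂ) ^ 2 * (ev n g (fun φ => ((Y u φ ^ 2 : ℝ) : ℂ)) - (ev n g (fun φ => ((Y u φ : ℝ) : ℂ))) ^ 2)
        / (Fintype.card (Fin 4 → ZMod n) : ℂ)

/-- **Volume-uniform stiffness along the tower of tori of odd base `L`, up to coupling `g₀`**
(a `Prop`-valued DEFINITION — a property of the pair `(L, g₀)`, not an assertion): for all
`0 ≤ g ≤ g₀`, all `N ≥ 1` and `n = L^N`,
(a) `Z_n(g,0) ≠ 0`;
(b) nearest-neighbour order `Re ⟨cos(∂_iφ(x)/√K)⟩_g ≥ 1/2` for every `K ≥ 1`, site `x`, axis `i`;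
(c) stiffness `|Υ_n(g)[u] − |u|²| ≤ |u|²/2` for every twist `u ∈ ℝ⁴`.
The quantifier shape (`g₀` depending on `L`, uniform in `N`) is that of Theorem 2.2 of the
reference, from whose conclusion — IF it held for the complex `ι`-symmetric perturbation `−igX`;
it is proved there for real finite-range perturbations — (a)–(c) follow by the bookkeeping of this
file (`stiffnessAt_of_hypA`).  At every FIXED torus (a)–(c) hold for small `g` unconditionally
(`stiffness_fixedVolume`). [cite: AdamsBuchholzKoteckyMuller2019, Thm 2.2] -/
def StiffnessAt (L : ℕ) (g₀ : ℝ) : Prop :=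
  ∀ g : ℝ, 0 ≤ g → g ≤ g₀ → ∀ N : ℕ, 1 ≤ N → ∀ (n : ℕ) [NeZero n], n = L ^ N →
    Z n g 0 ≠ 0 ∧
    (∀ K : ℝ, 1 ≤ K → ∀ (x : Fin 4 → ZMod n) (i : Fin 4),
      (1/2 : ℝ) ≤ (ev n g (fun φ => ((Real.cos (D φ i x / Real.sqrt K) : ℝ) : ℂ))).re) ∧
    (∀ u : Fin 4 → ℝ,
      ‖Upsilon n g u - ((∑ i : Fin 4, (u i) ^ 2 : ℝ) : ℂ)‖ ≤ (∑ i : Fin 4, (u i) ^ 2) / 2)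

/-- Sharp form of clause (c) along the tower (DEFINITION, a property of `(L, g₀, C)`):
`Z_n(g,0) ≠ 0` and `|Υ_n(g)[u] − |u|²| ≤ C·g²·|u|²` for `0 ≤ g ≤ g₀`, `N ≥ 1`, `n = L^N` — the form the
cumulant bound actually gives (`sharpStiffnessAt_of_cumulantBoundAt`, same `g₀`, same `C`); it
implies clause (c) of `StiffnessAt` once `g ≤ 1/(2(|C|+1))`. [cite: AdamsBuchholzKoteckyMuller2019, Thm 2.2] -/
def SharpStiffnessAt (L : ℕ) (g₀ C : ℝ) : Prop :=
  ∀ g : ℝ, 0 ≤ g → g ≤ g₀ → ∀ N : ℕ, 1 ≤ N → ∀ (n : ℕ) [NeZero n], n = L ^ N →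
    Z n g 0 ≠ 0 ∧
    ∀ u : Fin 4 → ℝ,
      ‖Upsilon n g u - ((∑ i : Fin 4, (u i) ^ 2 : ℝ) : ℂ)‖ ≤ C * g ^ 2 * ∑ i : Fin 4, (u i) ^ 2

/-! ## Model-side identities
Telescoping on the torus, the vanishing Gaussian cross term `S_u = S_0 + |Λ||u|²/2`, and the tilt
expansion of the Berry vertex `X_{tu} = X_0 + t·Y_u + t³·|Λ|·u_τ|u_sp|²` (no `t²` term) — the
finite-dimensional calculus behind the Hessian reading of `Upsilon`. -/

/-- telescoping on the torus: `Σ_x ∂_iφ(x) = 0`. [folklore] -/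
private theorem sum_D_eq_zero [NeZero n] (φ : (Fin 4 → ZMod n) → ℝ) (i : Fin 4) :
    ∑ s : Fin 4 → ZMod n, D φ i s = 0 := by
  unfold D
  rw [Finset.sum_sub_distrib, sub_eq_zero]
  exact Fintype.sum_equiv (Equiv.addRight (Pi.single i 1)) _ _ (fun s => rfl)

/-- the Gaussian cross term vanishes: `S_u = S_0 + |Λ|·|u|²/2`. [folklore] -/
private theorem S_tilt [NeZero n] (u : Fin 4 → ℝ) (φ : (Fin 4 → ZMod n) → ℝ) :
    S u φ = S 0 φ + (Fintype.card (Fin 4 → ZMod n) : ℝ) * (∑ i : Fin 4, (u i) ^ 2) / 2 := by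
  have h : ∀ i : Fin 4, ∑ s : Fin 4 → ZMod n, D φ i s = 0 := fun i => sum_D_eq_zero φ i
  have key : ∀ s : Fin 4 → ZMod n, ∑ i : Fin 4, (D φ i s + u i) ^ 2
      = ∑ i : Fin 4, (D φ i s + (0 : Fin 4 → ℝ) i) ^ 2
        + 2 * (u 0 * D φ 0 s + u 1 * D φ 1 s + u 2 * D φ 2 s + u 3 * D φ 3 s)
        + ∑ i : Fin 4, (u i) ^ 2 := by
    intro s
    simp only [Fin.sum_univ_four, Pi.zero_apply]
    ring
  unfold S
  rw [Finset.sum_congr rfl (fun s _ => key s)]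
  simp only [Finset.sum_add_distrib, Finset.sum_const, Finset.card_univ, nsmul_eq_mul]
  have hz : ∑ s : Fin 4 → ZMod n,
      2 * (u 0 * D φ 0 s + u 1 * D φ 1 s + u 2 * D φ 2 s + u 3 * D φ 3 s) = 0 := by
    simp only [Finset.sum_add_distrib, ← Finset.mul_sum, h, mul_zero, add_zero]
  rw [hz]
  ring

/-- tilt expansion of the Berry vertex: `X_u = X_0 + Y_u + |Λ|·u_τ·Σ_j u_j²`; the terms
`2u_τ Σ_x Σ_j u_j ∂_jφ(x) + |u_sp|² Σ_x ∂_τφ(x)`, quadratic in `u`, telescope to zero. [folklore] -/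
private theorem X_tilt [NeZero n] (u : Fin 4 → ℝ) (φ : (Fin 4 → ZMod n) → ℝ) :
    X u φ = X 0 φ + Y u φ
      + (Fintype.card (Fin 4 → ZMod n) : ℝ) * (u 0 * ∑ j : Fin 3, (u j.succ) ^ 2) := by
  have h : ∀ i : Fin 4, ∑ s : Fin 4 → ZMod n, D φ i s = 0 := fun i => sum_D_eq_zero φ i
  have key : ∀ s : Fin 4 → ZMod n,
      (D φ 0 s + u 0) * ∑ j : Fin 3, (D φ j.succ s + u j.succ) ^ 2
      = (D φ 0 s + (0 : Fin 4 → ℝ) 0) * ∑ j : Fin 3, (D φ j.succ s + (0 : Fin 4 → ℝ) j.succ) ^ 2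
        + (u 0 * ∑ j : Fin 3, (D φ j.succ s) ^ 2
            + 2 * D φ 0 s * ∑ j : Fin 3, u j.succ * D φ j.succ s)
        + (2 * u 0 * ∑ j : Fin 3, u j.succ * D φ j.succ s
            + (∑ j : Fin 3, (u j.succ) ^ 2) * D φ 0 s)
        + u 0 * ∑ j : Fin 3, (u j.succ) ^ 2 := by
    intro s
    simp only [Fin.sum_univ_three, Pi.zero_apply, add_zero]
    ring
  have hz1 : ∑ s : Fin 4 → ZMod n, ∑ j : Fin 3, u j.succ * D φ j.succ s = 0 := by
    rw [Finset.sum_comm]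
    simp only [← Finset.mul_sum, h, mul_zero, Finset.sum_const_zero]
  have hz : (∑ s : Fin 4 → ZMod n, 2 * u 0 * ∑ j : Fin 3, u j.succ * D φ j.succ s)
      + ∑ s : Fin 4 → ZMod n, (∑ j : Fin 3, (u j.succ) ^ 2) * D φ 0 s = 0 := by
    rw [← Finset.mul_sum, ← Finset.mul_sum, hz1, h]
    ring
  unfold X Y
  rw [Finset.sum_congr rfl (fun s _ => key s)]
  simp only [Finset.sum_add_distrib, Finset.sum_const, Finset.card_univ, nsmul_eq_mul]
  rw [hz]
  ring

/-- `Y` is linear in the twist. [folklore] -/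
private theorem Y_smul [NeZero n] (t : ℝ) (u : Fin 4 → ℝ) (φ : (Fin 4 → ZMod n) → ℝ) :
    Y (t • u) φ = t * Y u φ := by
  unfold Y
  rw [Finset.mul_sum]
  refine Finset.sum_congr rfl (fun s _ => ?_)
  simp only [Pi.smul_apply, smul_eq_mul, Fin.sum_univ_three]
  ring

/-- the `t`-expansion of the Berry vertex in the tilt parameter: `X_{tu} = X_0 + t·Y_u + t³·|Λ|·u_τ·|u_sp|²` — the
coefficient of `t²` is identically zero, so `∂²_t X_{tu}|₀ = 0` and `∂_t X_{tu}|₀ = Y_u`.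
[folklore] -/
private theorem X_tilt_expansion [NeZero n] (t : ℝ) (u : Fin 4 → ℝ) (φ : (Fin 4 → ZMod n) → ℝ) :
    X (t • u) φ = X 0 φ + t * Y u φ
      + t ^ 3 * ((Fintype.card (Fin 4 → ZMod n) : ℝ) * (u 0 * ∑ j : Fin 3, (u j.succ) ^ 2)) := by
  rw [X_tilt, Y_smul]
  simp only [Pi.smul_apply, smul_eq_mul, Fin.sum_univ_three]
  ring

/-- consequently the tilted weight factorises: `w_{g,u}(φ) = exp(−|Λ||u|²/2 − i g |Λ| u_τ|u_sp|²)
· exp(−S_0(φ) − i g (X_0(φ) + Y_u(φ)))`, i.e. `Z_N(g,u) = const(u) · ∫ exp(−S_0 − igX_0 − igY_u)`.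
[folklore] -/
private theorem w_tilt [NeZero n] (g : ℝ) (u : Fin 4 → ℝ) (φ : (Fin 4 → ZMod n) → ℝ) :
    w g u φ = Complex.exp (-(((Fintype.card (Fin 4 → ZMod n) : ℝ) * (∑ i : Fin 4, (u i) ^ 2) / 2 : ℝ) : ℂ)
        - Complex.I * ((g * ((Fintype.card (Fin 4 → ZMod n) : ℝ)
            * (u 0 * ∑ j : Fin 3, (u j.succ) ^ 2)) : ℝ) : ℂ))
      * Complex.exp (-((S 0 φ : ℝ) : ℂ) - Complex.I * ((g * (X 0 φ + Y u φ) : ℝ) : ℂ)) := by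
  unfold w
  rw [← Complex.exp_add, S_tilt, X_tilt]
  congr 1
  push_cast
  ring

/-- bookkeeping: the sharp form gives clause (c) of `StiffnessAt` after shrinking the threshold to
`min g₀ (1/(2(|C|+1)))`. [folklore] -/
private theorem clauseC_of_sharpStiffnessAt {L : ℕ} {g₀ C : ℝ} (h : SharpStiffnessAt L g₀ C) :
    ∀ g : ℝ, 0 ≤ g → g ≤ min g₀ (1 / (2 * (|C| + 1))) → ∀ N : ℕ, 1 ≤ N →
      ∀ (n : ℕ) [NeZero n], n = L ^ N → ∀ u : Fin 4 → ℝ,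
        ‖Upsilon n g u - ((∑ i : Fin 4, (u i) ^ 2 : ℝ) : ℂ)‖ ≤ (∑ i : Fin 4, (u i) ^ 2) / 2 := by
  have hden : 0 < 2 * (|C| + 1) := by positivity
  intro g hg0 hg N hN n _ hn u
  have hg1 : g ≤ g₀ := le_trans hg (min_le_left _ _)
  have hg2 : g ≤ 1 / (2 * (|C| + 1)) := le_trans hg (min_le_right _ _)
  obtain ⟨-, hU⟩ := h g hg0 hg1 N hN n hn
  have hsum : 0 ≤ ∑ i : Fin 4, (u i) ^ 2 := Finset.sum_nonneg (fun i _ => sq_nonneg _)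
  have hgle1 : g ≤ 1 := by
    have : 1 / (2 * (|C| + 1)) ≤ 1 := by
      rw [div_le_one hden]
      nlinarith [abs_nonneg C]
    linarith
  have hCg : C * g ^ 2 ≤ 1 / 2 := by
    have h1 : C * g ^ 2 ≤ |C| * g ^ 2 := by
      have := le_abs_self C
      nlinarith [sq_nonneg g]
    have h2 : |C| * g ^ 2 ≤ |C| * g := by
      have : g ^ 2 ≤ g := by nlinarith
      exact mul_le_mul_of_nonneg_left this (abs_nonneg C)
    have h3 : |C| * g ≤ |C| * (1 / (2 * (|C| + 1))) :=
      mul_le_mul_of_nonneg_left hg2 (abs_nonneg C)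
    have h4 : |C| * (1 / (2 * (|C| + 1))) ≤ 1 / 2 := by
      rw [mul_one_div, div_le_iff₀ hden]
      nlinarith [abs_nonneg C]
    linarith
  calc ‖Upsilon n g u - ((∑ i : Fin 4, (u i) ^ 2 : ℝ) : ℂ)‖
      ≤ C * g ^ 2 * ∑ i : Fin 4, (u i) ^ 2 := hU u
    _ ≤ (1 / 2) * ∑ i : Fin 4, (u i) ^ 2 := mul_le_mul_of_nonneg_right hCg hsum
    _ = (∑ i : Fin 4, (u i) ^ 2) / 2 := by ring

/-- monotonicity of the sharp form in the threshold. [folklore] -/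
private theorem sharpStiffnessAt_mono {L : ℕ} {g₀ g₀' C : ℝ} (hle : g₀' ≤ g₀)
    (h : SharpStiffnessAt L g₀ C) : SharpStiffnessAt L g₀' C := by
  intro g hg0 hg N hN n _ hn
  exact h g hg0 (le_trans hg hle) N hN n hn

/-! ## The volume-uniform hypotheses (A), typed in the model's own terms
`CumulantBoundAt L g₀ C` and `LocalTwoPointAt L g₀ C` are what the renormalisation-group theorem of
the reference — Theorem 2.2: on the tori `(ℤ/L^N)^d`, `L` odd and large, the finite-volume
perturbative free energy `𝒲_N(𝒦)` is smooth in the finite-range perturbation `𝒦` with derivatives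
bounded UNIFORMLY IN `N` — delivers for REAL perturbations, read for the complex weight `e^{−igX}`:
`Z_n(g,0) ≠ 0` with an `N`-uniform bound on the second cumulant of `Y_u` (a second `ε`-derivative of
`log ∫ w_{g,0} e^{εY_u}`, `upsilon_eq_mgfHessian`), resp. an `N`-uniform `O(g)` bound on the
nearest-neighbour cosine two-point function (a first derivative along `t ↦ t𝒦_g` paired with the
bounded-range observable `cos(z_i/√K)`).  They are DEFINITIONS — properties of `(L, g₀, C)`, the
hypotheses of the conditional theorems below — not assertions; for the complex weight the uniform
statements are not in print.  At fixed volume both hold (last section). -/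

/-- **Hypothesis (A), cumulant form** (DEFINITION, a property of `(L, g₀, C)`; not asserted): for
`0 ≤ g ≤ g₀`, `N ≥ 1`, `n = L^N`: `Z_n(g,0) ≠ 0` and the second cumulant of `Y_u` under the normalised
complex weight is at most `C·|Λ|·|u|²` for every twist `u`.  For real admissible perturbations this
is the `ℓ = 2` case of the reference's Theorem 2.2 along the curve `ε ↦ (1+𝒦_g)e^{εQ_u} − 1`
(`Q_u` = `Y_u` as a function of the gradients); for the complex weight it is the hypothesis of
`stiffnessAt_of_hypA`.  Fixed-volume version: `cumulantBound_fixedVolume` (a theorem). [cite: AdamsBuchholzKoteckyMuller2019, Thm 2.2] -/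
def CumulantBoundAt (L : ℕ) (g₀ C : ℝ) : Prop :=
  ∀ g : ℝ, 0 ≤ g → g ≤ g₀ → ∀ N : ℕ, 1 ≤ N → ∀ (n : ℕ) [NeZero n], n = L ^ N →
    Z n g 0 ≠ 0 ∧ ∀ u : Fin 4 → ℝ,
      ‖ev n g (fun φ => ((Y u φ ^ 2 : ℝ) : ℂ)) - (ev n g (fun φ => ((Y u φ : ℝ) : ℂ))) ^ 2‖
        ≤ C * (Fintype.card (Fin 4 → ZMod n) : ℝ) * ∑ i : Fin 4, (u i) ^ 2

/-- The cumulant bound gives the sharp stiffness form with the SAME threshold and constant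
(`Υ_n(g)[u] − |u|² = g²·Var_g(Y_u)/|Λ|`, pure bookkeeping). [cite: AdamsBuchholzKoteckyMuller2019, Thm 2.2] -/
theorem sharpStiffnessAt_of_cumulantBoundAt {L : ℕ} {g₀ C : ℝ} (h : CumulantBoundAt L g₀ C) :
    SharpStiffnessAt L g₀ C := by
  intro g hg0 hg N hN n _ hn
  obtain ⟨hZ, hV⟩ := h g hg0 hg N hN n hn
  refine ⟨hZ, fun u => ?_⟩
  have hcard : (0 : ℝ) < (Fintype.card (Fin 4 → ZMod n) : ℝ) := by
    exact_mod_cast Fintype.card_pos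
  set V : ℂ := ev n g (fun φ => ((Y u φ ^ 2 : ℝ) : ℂ)) - (ev n g (fun φ => ((Y u φ : ℝ) : ℂ))) ^ 2
    with hVdef
  have hU : Upsilon n g u - ((∑ i : Fin 4, (u i) ^ 2 : ℝ) : ℂ)
      = (g : ℂ) ^ 2 * V / (Fintype.card (Fin 4 → ZMod n) : ℂ) := by
    unfold Upsilon
    rw [hVdef]
    ring
  rw [hU, norm_div, norm_mul, norm_pow, Complex.norm_real, Complex.norm_natCast, Real.norm_eq_abs,
    abs_of_nonneg hg0, div_le_iff₀ hcard]
  calc g ^ 2 * ‖V‖ ≤ g ^ 2 * (C * (Fintype.card (Fin 4 → ZMod n) : ℝ) * ∑ i : Fin 4, (u i) ^ 2) :=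
        mul_le_mul_of_nonneg_left (hV u) (sq_nonneg g)
    _ = C * g ^ 2 * (∑ i : Fin 4, (u i) ^ 2) * (Fintype.card (Fin 4 → ZMod n) : ℝ) := by ring

/-! ## The reduction: hypotheses (A) + a Gaussian lower bound ⇒ volume-uniform stiffness
Pure bookkeeping (shrink the threshold; `|Re z| ≤ ‖z‖`): `stiffnessAt_of_bounds` takes the cumulant
bound (clause (c), through `sharpStiffnessAt_of_cumulantBoundAt`), the local two-point bound and ANY
Gaussian lower bound `CosLowerBoundAt θ` with `θ > 1/2` for clauses (a)–(b)
(`Re⟨cos⟩_g ≥ θ − C·g ≥ 1/2` once `g ≤ (θ − 1/2)/(|C|+1)`).  The Gaussian bound with `θ = 2/3` is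
PROVED further below (`cosLowerBoundAt_two_thirds`), whence the headline `stiffnessAt_of_hypA`. -/

/-- **Hypothesis (A), local two-point form** (DEFINITION, a property of `(L, g₀, C)`; not
asserted): for `0 ≤ g ≤ g₀`, `N ≥ 1`, `n = L^N`, and uniformly in `K ≥ 1`: `Z_n(g,0) ≠ 0` and the
nearest-neighbour cosine two-point function `⟨cos(∂_iφ(x)/√K)⟩_g` lies within `C·g` of its `g = 0`
(Gaussian) value.  For real admissible perturbations this is the `ℓ = 1` case of the reference's
Theorem 2.2 along `t ↦ t𝒦_g` with the bounded-range observable `cos(z_i/√K)`; for the complex weight it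
is the second hypothesis of `stiffnessAt_of_hypA`.  Fixed-volume version: `localTwoPoint_fixedVolume`
(a theorem). [cite: AdamsBuchholzKoteckyMuller2019, Thm 2.2] -/
def LocalTwoPointAt (L : ℕ) (g₀ C : ℝ) : Prop :=
  ∀ g : ℝ, 0 ≤ g → g ≤ g₀ → ∀ N : ℕ, 1 ≤ N → ∀ (n : ℕ) [NeZero n], n = L ^ N →
    Z n g 0 ≠ 0 ∧ ∀ K : ℝ, 1 ≤ K → ∀ (x : Fin 4 → ZMod n) (i : Fin 4),
      ‖ev n g (fun φ => ((Real.cos (D φ i x / Real.sqrt K) : ℝ) : ℂ))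
          - ev n 0 (fun φ => ((Real.cos (D φ i x / Real.sqrt K) : ℝ) : ℂ))‖ ≤ C * g

/-- The Gaussian-side input as a parametrised predicate: `θ ≤ Re⟨cos(∂_iφ(x)/√K)⟩_0` on every torus
`(ℤ/n)^4`, for every `K ≥ 1`, site `x` and axis `i` (free lattice field with the rank-one zero-mode
mass). PROVED for `θ = 2/3` (`cosLowerBoundAt_two_thirds`, from `cos t ≥ 1 − t²/2` and the
second-moment bound `⟨(∂_iφ(x))²⟩_0 ≤ 2/3`); any `θ > 1/2` feeds the reduction
`stiffnessAt_of_bounds`. [cite: FriedliVelenik2017, Ch. 8] -/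
def CosLowerBoundAt (θ : ℝ) : Prop :=
  ∀ (n : ℕ) [NeZero n] (K : ℝ), 1 ≤ K → ∀ (x : Fin 4 → ZMod n) (i : Fin 4),
    θ ≤ (ev n 0 (fun φ => ((Real.cos (D φ i x / Real.sqrt K) : ℝ) : ℂ))).re

/-- **The reduction, parametric form** (kernel-checked bookkeeping): the cumulant bound
(clause (c)), the local two-point bound, and a Gaussian lower bound `CosLowerBoundAt θ` with ANY
`θ > 1/2` give volume-uniform stiffness along the tower, `StiffnessAt L g₀`, for an explicit
`0 < g₀ ≤ g₁` (`Re⟨cos⟩_g ≥ θ − C₂·g ≥ 1/2` once `g ≤ (θ − 1/2)/(|C₂|+1)`; clause (c) once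
`g ≤ 1/(2(|C₁|+1))`). [cite: AdamsBuchholzKoteckyMuller2019, Thm 2.2] -/
theorem stiffnessAt_of_bounds {θ : ℝ} (hθ : 1 / 2 < θ) (hG : CosLowerBoundAt θ) {L : ℕ}
    {g₁ C₁ g₂ C₂ : ℝ} (hg₁ : 0 < g₁) (hg₂ : 0 < g₂) (h₁ : CumulantBoundAt L g₁ C₁)
    (h₂ : LocalTwoPointAt L g₂ C₂) :
    ∃ g₀ : ℝ, 0 < g₀ ∧ g₀ ≤ g₁ ∧ StiffnessAt L g₀ := by
  have hC := clauseC_of_sharpStiffnessAt (sharpStiffnessAt_of_cumulantBoundAt h₁)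
  have hden : 0 < |C₂| + 1 := by positivity
  have hnum : 0 < θ - 1 / 2 := by linarith
  have hd1 : 0 < 2 * (|C₁| + 1) := by positivity
  refine ⟨min (min g₁ (1 / (2 * (|C₁| + 1)))) (min g₂ ((θ - 1 / 2) / (|C₂| + 1))),
    lt_min (lt_min hg₁ (by positivity)) (lt_min hg₂ (div_pos hnum hden)),
    le_trans (min_le_left _ _) (min_le_left _ _), ?_⟩
  intro g hg0 hg N hN n _ hn
  have hg_1 : g ≤ min g₁ (1 / (2 * (|C₁| + 1))) := le_trans hg (min_le_left _ _)
  have hg_2 : g ≤ g₂ := le_trans (le_trans hg (min_le_right _ _)) (min_le_left _ _)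
  have hg_3 : g ≤ (θ - 1 / 2) / (|C₂| + 1) :=
    le_trans (le_trans hg (min_le_right _ _)) (min_le_right _ _)
  obtain ⟨hZ, hloc⟩ := h₂ g hg0 hg_2 N hN n hn
  refine ⟨hZ, ?_, fun u => hC g hg0 hg_1 N hN n hn u⟩
  intro K hK x i
  have hdiff := hloc K hK x i
  have hlow := hG n K hK x i
  set a : ℂ := ev n g (fun φ => ((Real.cos (D φ i x / Real.sqrt K) : ℝ) : ℂ)) with ha
  set b : ℂ := ev n 0 (fun φ => ((Real.cos (D φ i x / Real.sqrt K) : ℝ) : ℂ)) with hb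
  have hCg : C₂ * g ≤ θ - 1 / 2 := by
    have h1 : C₂ * g ≤ |C₂| * g := mul_le_mul_of_nonneg_right (le_abs_self C₂) hg0
    have h2 : |C₂| * g ≤ |C₂| * ((θ - 1 / 2) / (|C₂| + 1)) :=
      mul_le_mul_of_nonneg_left hg_3 (abs_nonneg C₂)
    have h3 : |C₂| * ((θ - 1 / 2) / (|C₂| + 1)) ≤ θ - 1 / 2 := by
      rw [mul_div_assoc']
      rw [div_le_iff₀ hden]
      nlinarith [abs_nonneg C₂]
    linarith
  have hre : |(a - b).re| ≤ ‖a - b‖ := Complex.abs_re_le_norm _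
  have h4 : |(a - b).re| ≤ θ - 1 / 2 := le_trans hre (le_trans hdiff hCg)
  rw [Complex.sub_re] at h4
  have h5 := (abs_le.mp h4).1
  linarith

/-! ## Reality (the `ι`-symmetry)
The field reflection `φ ↦ −φ` composed with complex conjugation fixes the weight:
`w_{g,−u}(−φ) = conj (w_{g,u}(φ))` (`S` is even, `X` is odd, the coupling is purely imaginary — the
model-level face of the symmetry `𝒦(−z) = conj 𝒦(z)` of the perturbation).  Since Lebesgue measure on
`ℝ^Λ` is reflection invariant, `Z_n(g,−u) = conj Z_n(g,u)`; in particular `Z_n(g,0)`, the normalised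
expectations of `ι`-even observables (`F(−φ) = conj F(φ)`: `Y_u`, `Y_u²`, `cos(∂_iφ/√K)`) and the
helicity modulus are REAL.  Pure symmetry bookkeeping; no estimate. -/

/-- the gradient is odd: `∂_i(−φ) = −∂_iφ`. [folklore] -/
private theorem D_neg (φ : (Fin 4 → ZMod n) → ℝ) (i : Fin 4) (s : Fin 4 → ZMod n) :
    D (-φ) i s = -(D φ i s) := by
  unfold D
  simp only [Pi.neg_apply]
  ring

/-- `S_{−u}(−φ) = S_u(φ)`. [folklore] -/
private theorem S_neg_neg [NeZero n] (u : Fin 4 → ℝ) (φ : (Fin 4 → ZMod n) → ℝ) :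
    S (-u) (-φ) = S u φ := by
  unfold S
  simp only [D_neg, Pi.neg_apply, Finset.sum_neg_distrib]
  congr 1
  · congr 1
    refine Finset.sum_congr rfl (fun s _ => Finset.sum_congr rfl (fun i _ => by ring))
  · ring

/-- `X_{−u}(−φ) = −X_u(φ)`. [folklore] -/
private theorem X_neg_neg [NeZero n] (u : Fin 4 → ℝ) (φ : (Fin 4 → ZMod n) → ℝ) :
    X (-u) (-φ) = -(X u φ) := by
  unfold X
  rw [← Finset.sum_neg_distrib]
  refine Finset.sum_congr rfl (fun s _ => ?_)
  simp only [D_neg, Pi.neg_apply]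
  have h : ∀ j : Fin 3, (-(D φ j.succ s) + -(u j.succ)) ^ 2 = (D φ j.succ s + u j.succ) ^ 2 :=
    fun j => by ring
  simp only [h]
  ring

/-- `Y_u(−φ) = Y_u(φ)`. [folklore] -/
private theorem Y_neg [NeZero n] (u : Fin 4 → ℝ) (φ : (Fin 4 → ZMod n) → ℝ) : Y u (-φ) = Y u φ := by
  unfold Y
  refine Finset.sum_congr rfl (fun s _ => ?_)
  simp only [D_neg, neg_sq, mul_neg, Finset.sum_neg_distrib]
  ring

/-- ι-covariance of the weight: `w_{g,−u}(−φ) = conj w_{g,u}(φ)`. [folklore] -/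
private theorem w_neg_neg [NeZero n] (g : ℝ) (u : Fin 4 → ℝ) (φ : (Fin 4 → ZMod n) → ℝ) :
    w g (-u) (-φ) = starRingEnd ℂ (w g u φ) := by
  unfold w
  rw [S_neg_neg, X_neg_neg, ← Complex.exp_conj]
  congr 1
  simp only [map_sub, map_neg, map_mul, Complex.conj_ofReal, Complex.conj_I]
  push_cast
  ring

/-- ι-reality of the twisted partition function: `Z_N(g,−u) = conj Z_N(g,u)` (change of variables
`φ ↦ −φ`, Lebesgue measure on `ℝ^Λ` being reflection invariant). [folklore] -/
private theorem Z_neg (n : ℕ) [NeZero n] (g : ℝ) (u : Fin 4 → ℝ) :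
    Z n g (-u) = starRingEnd ℂ (Z n g u) := by
  unfold Z
  rw [← integral_conj]
  have h := integral_neg_eq_self (fun φ : (Fin 4 → ZMod n) → ℝ => w g (-u) φ) volume
  rw [← h]
  congr 1
  ext φ
  exact w_neg_neg g u φ

/-- `conj Z_n(g,0) = Z_n(g,0)`. [folklore] -/
private theorem Z_zero_conj (n : ℕ) [NeZero n] (g : ℝ) : starRingEnd ℂ (Z n g 0) = Z n g 0 := by
  have h := Z_neg n g 0
  rw [neg_zero] at h
  exact h.symm

/-- `Z_N(g,0)` is real. [folklore] -/
private theorem Z_zero_im (n : ℕ) [NeZero n] (g : ℝ) : (Z n g 0).im = 0 :=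
  Complex.conj_eq_iff_im.mp (Z_zero_conj n g)

/-- conjugation symmetry of `∫ F·w_{g,0}` for `ι`-even observables (`F(−φ) = conj F(φ)`). [folklore] -/
private theorem integral_obs_conj (n : ℕ) [NeZero n] (g : ℝ) (F : ((Fin 4 → ZMod n) → ℝ) → ℂ)
    (hF : ∀ φ, F (-φ) = starRingEnd ℂ (F φ)) :
    starRingEnd ℂ (∫ φ : (Fin 4 → ZMod n) → ℝ, F φ * w g 0 φ)
      = ∫ φ : (Fin 4 → ZMod n) → ℝ, F φ * w g 0 φ := by
  rw [← integral_conj]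
  have h := integral_neg_eq_self (fun φ : (Fin 4 → ZMod n) → ℝ => F φ * w g 0 φ) volume
  rw [← h]
  congr 1
  ext φ
  have hw := w_neg_neg g 0 φ
  rw [neg_zero] at hw
  rw [map_mul, ← hF, ← hw]

/-- normalised expectations of ι-even observables are real. [folklore] -/
private theorem ev_conj (n : ℕ) [NeZero n] (g : ℝ) (F : ((Fin 4 → ZMod n) → ℝ) → ℂ)
    (hF : ∀ φ, F (-φ) = starRingEnd ℂ (F φ)) : starRingEnd ℂ (ev n g F) = ev n g F := by
  unfold ev
  rw [map_div₀, integral_obs_conj n g F hF, Z_zero_conj]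

/-- the helicity modulus of the complex bulk is real. [folklore] -/
private theorem Upsilon_conj (n : ℕ) [NeZero n] (g : ℝ) (u : Fin 4 → ℝ) :
    starRingEnd ℂ (Upsilon n g u) = Upsilon n g u := by
  have hY2 := ev_conj n g (fun φ => ((Y u φ ^ 2 : ℝ) : ℂ))
    (fun φ => by simp only [Y_neg, Complex.conj_ofReal])
  have hY1 := ev_conj n g (fun φ => ((Y u φ : ℝ) : ℂ))
    (fun φ => by simp only [Y_neg, Complex.conj_ofReal])
  unfold Upsilon
  simp only [map_add, map_sub, map_mul, map_div₀, map_pow, Complex.conj_ofReal, map_natCast]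
  rw [hY1, hY2]

/-- The helicity modulus is REAL: `Im Υ_n(g)[u] = 0` (conjugation symmetry `Upsilon_conj`).
[cite: FisherBarberJasnow1973, Sec. II, eqs. (2.4)–(2.5)] -/
theorem Upsilon_im (n : ℕ) [NeZero n] (g : ℝ) (u : Fin 4 → ℝ) : (Upsilon n g u).im = 0 :=
  Complex.conj_eq_iff_im.mp (Upsilon_conj n g u)

/-- the nearest-neighbour cosine two-point function of the complex bulk is real (so clause (b)'s
`Re` is the value itself). [folklore] -/
private theorem ev_cos_im (n : ℕ) [NeZero n] (g K : ℝ) (x : Fin 4 → ZMod n) (i : Fin 4) :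
    (ev n g (fun φ => ((Real.cos (D φ i x / Real.sqrt K) : ℝ) : ℂ))).im = 0 := by
  apply Complex.conj_eq_iff_im.mp
  apply ev_conj
  intro φ
  simp only [D_neg, neg_div, Real.cos_neg, Complex.conj_ofReal]


/-! ## Non-degeneracy of the objects
Positivity and coercivity of the Gaussian action `S_0` (the torus graph is connected and the zero mode
carries the rank-one mass), integrability of the weight `w_{g,u}` on `ℝ^Λ` (so `Z` and `ev` are genuine
integrals, never junk values), and `Z_n(0,0) > 0`. -/

/-- `S_0(φ) = ½ Σ_{x,i} (∂_iφ(x))² + (Σ_x φ(x))²/(2|Λ|)`. [folklore] -/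
private theorem S_zero_eq [NeZero n] (φ : (Fin 4 → ZMod n) → ℝ) :
    S 0 φ = (∑ s : Fin 4 → ZMod n, ∑ i : Fin 4, (D φ i s) ^ 2) / 2
      + (∑ s : Fin 4 → ZMod n, φ s) ^ 2 / (2 * (Fintype.card (Fin 4 → ZMod n) : ℝ)) := by
  unfold S
  simp only [Pi.zero_apply, add_zero]

/-- `0 ≤ S_0(φ)`. [folklore] -/
private theorem S_zero_nonneg [NeZero n] (φ : (Fin 4 → ZMod n) → ℝ) : 0 ≤ S 0 φ := by
  rw [S_zero_eq]
  positivity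

/-- homogeneity: `S_0(r•φ) = r²·S_0(φ)`. [folklore] -/
private theorem S_zero_smul [NeZero n] (r : ℝ) (φ : (Fin 4 → ZMod n) → ℝ) :
    S 0 (r • φ) = r ^ 2 * S 0 φ := by
  rw [S_zero_eq, S_zero_eq]
  have hD : ∀ (i : Fin 4) (s : Fin 4 → ZMod n), D (r • φ) i s = r * D φ i s := fun i s => by
    unfold D
    simp only [Pi.smul_apply, smul_eq_mul]
    ring
  simp only [hD, Pi.smul_apply, smul_eq_mul, mul_pow, ← Finset.mul_sum]
  ring

/-- positive definiteness: `S_0(φ) = 0` forces `φ = 0` (all gradients vanish ⇒ `φ` is constant by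
connectedness of the torus `(ℤ/n)^4`; the zero-mode term then kills the constant). [folklore] -/
private theorem S_zero_eq_zero [NeZero n] {φ : (Fin 4 → ZMod n) → ℝ} (h : S 0 φ = 0) : φ = 0 := by
  have hcard : (0:ℝ) < (Fintype.card (Fin 4 → ZMod n) : ℝ) := by exact_mod_cast Fintype.card_pos
  rw [S_zero_eq] at h
  set A : ℝ := ∑ s : Fin 4 → ZMod n, ∑ i : Fin 4, (D φ i s) ^ 2 with hA
  set B : ℝ := ∑ s : Fin 4 → ZMod n, φ s with hB
  have hA0 : 0 ≤ A := by positivity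
  have hB0 : 0 ≤ B ^ 2 / (2 * (Fintype.card (Fin 4 → ZMod n) : ℝ)) := by positivity
  have hA' : A = 0 := by linarith
  have hB2 : B ^ 2 / (2 * (Fintype.card (Fin 4 → ZMod n) : ℝ)) = 0 := by linarith
  have hB' : B = 0 := by
    have h3 : B ^ 2 = 0 := by
      rcases div_eq_zero_iff.mp hB2 with h3 | h3
      · exact h3
      · exfalso; linarith
    exact pow_eq_zero_iff two_ne_zero |>.mp h3
  have hD : ∀ (i : Fin 4) (s : Fin 4 → ZMod n), D φ i s = 0 := by
    intro i s
    have hs : ∑ i' : Fin 4, (D φ i' s) ^ 2 = 0 :=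
      (Finset.sum_eq_zero_iff_of_nonneg (fun s _ =>
        Finset.sum_nonneg (fun i _ => sq_nonneg (D φ i s)))).mp hA' s (Finset.mem_univ s)
    have := (Finset.sum_eq_zero_iff_of_nonneg (fun i _ => sq_nonneg (D φ i s))).mp hs i
      (Finset.mem_univ i)
    exact pow_eq_zero_iff two_ne_zero |>.mp this
  have hstep : ∀ (s : Fin 4 → ZMod n) (i : Fin 4), φ (s + Pi.single i 1) = φ s := fun s i => by
    have := hD i s
    unfold D at this
    linarith
  have hshift : ∀ (i : Fin 4) (k : ℕ) (s : Fin 4 → ZMod n),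
      φ (s + Pi.single i (k : ZMod n)) = φ s := by
    intro i k
    induction k with
    | zero => intro s; simp
    | succ k ih => intro s; rw [Nat.cast_succ, Pi.single_add, ← add_assoc, hstep, ih]
  have hconst : ∀ t : Fin 4 → ZMod n, φ t = φ 0 := by
    intro t
    have key : ∀ T : Finset (Fin 4), φ (∑ i ∈ T, Pi.single i (t i)) = φ 0 := by
      intro T
      refine Finset.induction_on T ?_ ?_
      · simp
      · intro j T hj ih
        rw [Finset.sum_insert hj, add_comm, ← ZMod.natCast_zmod_val (t j), hshift, ih]
    have := key Finset.univ
    rwa [Finset.univ_sum_single] at this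
  have hsum : B = (Fintype.card (Fin 4 → ZMod n) : ℝ) * φ 0 := by
    rw [hB, Finset.sum_congr rfl (fun s _ => hconst s), Finset.sum_const, Finset.card_univ,
      nsmul_eq_mul]
  have h0 : φ 0 = 0 := by
    have : (Fintype.card (Fin 4 → ZMod n) : ℝ) * φ 0 = 0 := by rw [← hsum]; exact hB'
    rcases mul_eq_zero.mp this with h | h
    · exact absurd h (ne_of_gt hcard)
    · exact h
  funext s
  rw [Pi.zero_apply, hconst s, h0]

/-- `S_u` is continuous in the field. [folklore] -/
private theorem continuous_S [NeZero n] (u : Fin 4 → ℝ) :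
    Continuous (fun φ : (Fin 4 → ZMod n) → ℝ => S u φ) := by
  unfold S D
  fun_prop

/-- `X_u` is continuous in the field. [folklore] -/
private theorem continuous_X [NeZero n] (u : Fin 4 → ℝ) :
    Continuous (fun φ : (Fin 4 → ZMod n) → ℝ => X u φ) := by
  unfold X D
  fun_prop

/-- `w_{g,u}` is continuous in the field. [folklore] -/
private theorem continuous_w [NeZero n] (g : ℝ) (u : Fin 4 → ℝ) :
    Continuous (fun φ : (Fin 4 → ZMod n) → ℝ => w g u φ) := by
  have h1 : Continuous (fun φ : (Fin 4 → ZMod n) → ℝ => ((S u φ : ℝ) : ℂ)) :=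
    Complex.continuous_ofReal.comp (continuous_S u)
  have h2 : Continuous (fun φ : (Fin 4 → ZMod n) → ℝ => ((g * X u φ : ℝ) : ℂ)) :=
    Complex.continuous_ofReal.comp (continuous_const.mul (continuous_X u))
  unfold w
  exact Complex.continuous_exp.comp ((h1.neg).sub (continuous_const.mul h2))

/-- `‖w_{g,u}(φ)‖ = exp(−S_u(φ))`: the Berry phase has modulus one. [folklore] -/
private theorem norm_w [NeZero n] (g : ℝ) (u : Fin 4 → ℝ) (φ : (Fin 4 → ZMod n) → ℝ) :
    ‖w g u φ‖ = Real.exp (-(S u φ)) := by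
  unfold w
  rw [Complex.norm_exp]
  congr 1
  simp [Complex.sub_re, Complex.neg_re, Complex.ofReal_re, Complex.mul_re, Complex.I_re,
    Complex.I_im, Complex.ofReal_im]

/-- `Σ_x φ(x)² ≤ |Λ|·‖φ‖²` (sup norm). [folklore] -/
private theorem sum_sq_le_card_mul_norm_sq [NeZero n] (φ : (Fin 4 → ZMod n) → ℝ) :
    ∑ s : Fin 4 → ZMod n, (φ s) ^ 2 ≤ (Fintype.card (Fin 4 → ZMod n) : ℝ) * ‖φ‖ ^ 2 := by
  have h : ∀ s : Fin 4 → ZMod n, (φ s) ^ 2 ≤ ‖φ‖ ^ 2 := fun s => by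
    have h1 : |φ s| ≤ ‖φ‖ := by
      have := norm_le_pi_norm φ s
      rwa [Real.norm_eq_abs] at this
    rw [← sq_abs (φ s)]
    exact pow_le_pow_left₀ (abs_nonneg _) h1 2
  calc ∑ s : Fin 4 → ZMod n, (φ s) ^ 2 ≤ ∑ s : Fin 4 → ZMod n, ‖φ‖ ^ 2 :=
        Finset.sum_le_sum (fun s _ => h s)
    _ = (Fintype.card (Fin 4 → ZMod n) : ℝ) * ‖φ‖ ^ 2 := by
        rw [Finset.sum_const, Finset.card_univ, nsmul_eq_mul]

/-- COERCIVITY of the Gaussian action: `S_0(φ) ≥ c(n)·‖φ‖²` with `c(n) > 0` (minimum of `S_0` on the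
compact unit sphere of the finite-dimensional configuration space, positive by `S_zero_eq_zero`,
then homogeneity). [folklore] -/
private theorem S_zero_coercive (n : ℕ) [NeZero n] :
    ∃ c : ℝ, 0 < c ∧ ∀ φ : (Fin 4 → ZMod n) → ℝ, c * ‖φ‖ ^ 2 ≤ S 0 φ := by
  have hcomp : IsCompact (Metric.sphere (0 : (Fin 4 → ZMod n) → ℝ) 1) := isCompact_sphere _ _
  have hne : (Metric.sphere (0 : (Fin 4 → ZMod n) → ℝ) 1).Nonempty := by
    refine ⟨fun _ => 1, ?_⟩
    rw [mem_sphere_zero_iff_norm]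
    simp
  obtain ⟨ψ₀, hψ₀, hmin⟩ := hcomp.exists_isMinOn hne (continuous_S 0).continuousOn
  have hψ₀ne : ψ₀ ≠ 0 := by
    intro h
    rw [h, mem_sphere_zero_iff_norm, norm_zero] at hψ₀
    exact zero_ne_one hψ₀
  have hc : 0 < S 0 ψ₀ :=
    lt_of_le_of_ne (S_zero_nonneg ψ₀) (fun h => hψ₀ne (S_zero_eq_zero h.symm))
  refine ⟨S 0 ψ₀, hc, fun φ => ?_⟩
  by_cases hφ : φ = 0
  · rw [hφ, norm_zero, zero_pow two_ne_zero, mul_zero]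
    exact S_zero_nonneg 0
  · have hnorm : ‖φ‖ ≠ 0 := norm_ne_zero_iff.mpr hφ
    have hmem : ‖φ‖⁻¹ • φ ∈ Metric.sphere (0 : (Fin 4 → ZMod n) → ℝ) 1 := by
      rw [mem_sphere_zero_iff_norm, norm_smul, norm_inv, norm_norm, inv_mul_cancel₀ hnorm]
    have hle := (isMinOn_iff.mp hmin) _ hmem
    rw [S_zero_smul] at hle
    have hpos : 0 < ‖φ‖ ^ 2 := by positivity
    calc S 0 ψ₀ * ‖φ‖ ^ 2 ≤ (‖φ‖⁻¹) ^ 2 * S 0 φ * ‖φ‖ ^ 2 :=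
          mul_le_mul_of_nonneg_right hle hpos.le
      _ = S 0 φ := by field_simp

/-- the Gaussian reference weight `exp(−S_0)` is integrable on `ℝ^Λ` (dominated by a product of
one-dimensional Gaussians via coercivity). [folklore] -/
private theorem integrable_exp_neg_mul_S_zero (n : ℕ) [NeZero n] (a : ℝ) (ha : 0 < a) :
    Integrable (fun φ : (Fin 4 → ZMod n) → ℝ => Real.exp (-(a * S 0 φ))) := by
  obtain ⟨c₀, hc₀, hcoer₀⟩ := S_zero_coercive n
  have hcoer : ∀ φ : (Fin 4 → ZMod n) → ℝ, (a * c₀) * ‖φ‖ ^ 2 ≤ a * S 0 φ := fun φ => by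
    rw [mul_assoc]
    exact mul_le_mul_of_nonneg_left (hcoer₀ φ) ha.le
  set c : ℝ := a * c₀ with hcdef
  have hc : 0 < c := mul_pos ha hc₀
  have hcard : (0:ℝ) < (Fintype.card (Fin 4 → ZMod n) : ℝ) := by exact_mod_cast Fintype.card_pos
  have hcard' : (Fintype.card (Fin 4 → ZMod n) : ℝ) ≠ 0 := ne_of_gt hcard
  set c' : ℝ := c / (Fintype.card (Fin 4 → ZMod n) : ℝ) with hc'
  have hc'pos : 0 < c' := div_pos hc hcard
  have hdom : Integrable
      (fun φ : (Fin 4 → ZMod n) → ℝ => ∏ s : Fin 4 → ZMod n, Real.exp (-c' * (φ s) ^ 2)) := by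
    have := _root_.MeasureTheory.Integrable.fintype_prod (ι := Fin 4 → ZMod n)
      (μ := fun _ => (volume : Measure ℝ))
      (f := fun _ x => Real.exp (-c' * x ^ 2)) (fun _ => integrable_exp_neg_mul_sq hc'pos)
    simpa [_root_.MeasureTheory.volume_pi] using this
  refine hdom.mono' ((continuous_const.mul (continuous_S 0)).neg.rexp).aestronglyMeasurable
    (Filter.Eventually.of_forall (fun φ => ?_))
  rw [Real.norm_eq_abs, abs_of_pos (Real.exp_pos _), ← Real.exp_sum]
  apply Real.exp_le_exp.mpr
  have h1 := hcoer φ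
  have h2 := sum_sq_le_card_mul_norm_sq φ
  have h3 : ∑ s : Fin 4 → ZMod n, (-c' * (φ s) ^ 2) = -c' * ∑ s : Fin 4 → ZMod n, (φ s) ^ 2 := by
    rw [Finset.mul_sum]
  rw [h3]
  have h4 : c' * ∑ s : Fin 4 → ZMod n, (φ s) ^ 2 ≤ c * ‖φ‖ ^ 2 := by
    calc c' * ∑ s : Fin 4 → ZMod n, (φ s) ^ 2
        ≤ c' * ((Fintype.card (Fin 4 → ZMod n) : ℝ) * ‖φ‖ ^ 2) :=
          mul_le_mul_of_nonneg_left h2 hc'pos.le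
      _ = c * ‖φ‖ ^ 2 := by rw [hc', ← mul_assoc, div_mul_cancel₀ c hcard']
  linarith

/-- `e^{−S_0}` is integrable on `ℝ^Λ`. [folklore] -/
private theorem integrable_exp_neg_S_zero (n : ℕ) [NeZero n] :
    Integrable (fun φ : (Fin 4 → ZMod n) → ℝ => Real.exp (-(S 0 φ))) := by
  simpa using integrable_exp_neg_mul_S_zero n 1 one_pos

/-- the Berry weight is integrable for every `g` and twist `u` (`‖w_{g,u}‖ = e^{−S_u} ≤ e^{−S_0}`).
[folklore] -/
private theorem integrable_w (n : ℕ) [NeZero n] (g : ℝ) (u : Fin 4 → ℝ) :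
    Integrable (fun φ : (Fin 4 → ZMod n) → ℝ => w g u φ) := by
  refine (integrable_exp_neg_S_zero n).mono' (continuous_w g u).aestronglyMeasurable
    (Filter.Eventually.of_forall (fun φ => ?_))
  rw [norm_w, S_tilt]
  apply Real.exp_le_exp.mpr
  have : 0 ≤ (Fintype.card (Fin 4 → ZMod n) : ℝ) * (∑ i : Fin 4, (u i) ^ 2) / 2 := by positivity
  linarith

/-- a bounded continuous observable against the Berry weight is integrable (e.g. the cosine
two-point observable of clause (b)). [folklore] -/
private theorem integrable_bdd_mul_w (n : ℕ) [NeZero n] (g : ℝ) (F : ((Fin 4 → ZMod n) → ℝ) → ℂ)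
    (hF : Continuous F) (M : ℝ) (hM : ∀ φ, ‖F φ‖ ≤ M) :
    Integrable (fun φ : (Fin 4 → ZMod n) → ℝ => F φ * w g 0 φ) := by
  refine ((integrable_exp_neg_S_zero n).const_mul (max M 0)).mono'
    (hF.mul (continuous_w g 0)).aestronglyMeasurable (Filter.Eventually.of_forall (fun φ => ?_))
  rw [norm_mul, norm_w, S_tilt]
  have hw : Real.exp (-(S 0 φ + (Fintype.card (Fin 4 → ZMod n) : ℝ) * (∑ i : Fin 4, ((0 : Fin 4 → ℝ) i) ^ 2) / 2))
      = Real.exp (-(S 0 φ)) := by simp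
  rw [hw]
  exact mul_le_mul_of_nonneg_right (le_trans (hM φ) (le_max_left _ _)) (Real.exp_pos _).le

/-- `cos(∂_iφ(x)/√K)·w_{g,0}` is integrable. [folklore] -/
private theorem integrable_cos_mul_w (n : ℕ) [NeZero n] (g K : ℝ) (x : Fin 4 → ZMod n) (i : Fin 4) :
    Integrable (fun φ : (Fin 4 → ZMod n) → ℝ =>
      ((Real.cos (D φ i x / Real.sqrt K) : ℝ) : ℂ) * w g 0 φ) := by
  refine integrable_bdd_mul_w n g _ ?_ 1 (fun φ => ?_)
  · unfold D
    fun_prop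
  · rw [Complex.norm_real, Real.norm_eq_abs]
    exact Real.abs_cos_le_one _

/-- at `g = 0`, `u = 0` the weight is the real Gaussian weight. [folklore] -/
private theorem w_zero_zero [NeZero n] (φ : (Fin 4 → ZMod n) → ℝ) :
    w 0 0 φ = ((Real.exp (-(S 0 φ)) : ℝ) : ℂ) := by
  unfold w
  rw [Complex.ofReal_exp]
  congr 1
  push_cast
  simp

/-- `Z_n(0,0) = ∫ e^{−S_0}` (a real integral, cast to `ℂ`). [folklore] -/
private theorem Z_zero_zero_eq (n : ℕ) [NeZero n] :
    Z n 0 0 = ((∫ φ : (Fin 4 → ZMod n) → ℝ, Real.exp (-(S 0 φ)) : ℝ) : ℂ) := by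
  unfold Z
  rw [← integral_complex_ofReal]
  congr 1
  ext φ
  exact w_zero_zero φ

/-- `Z_n(0,0) = ∫ e^{−S_0} > 0`: the free partition function is a positive real (as a real integral;
`Z_zero_zero_eq` casts it). [cite: FriedliVelenik2017, Ch. 8] -/
theorem Z_zero_zero_pos (n : ℕ) [NeZero n] :
    0 < ∫ φ : (Fin 4 → ZMod n) → ℝ, Real.exp (-(S 0 φ)) :=
  integral_exp_pos (integrable_exp_neg_S_zero n)

/-- `Z_n(0,0) ≠ 0`. [folklore] -/
private theorem Z_zero_zero_ne (n : ℕ) [NeZero n] : Z n 0 0 ≠ 0 := by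
  rw [Z_zero_zero_eq]
  exact_mod_cast (Z_zero_zero_pos n).ne'


/-! ## The Gaussian side is a theorem: `CosLowerBoundAt (2/3)`
Symmetry (translations of the torus and permutations of the four axes preserve `S_0` and Lebesgue
measure) makes all `4|Λ|` gradient second moments equal; a derivative-free scaling/secant argument
(`∫e^{−t²S_0} = t^{−|Λ|}∫e^{−S_0}` by the change of variables `φ ↦ tφ`, convexity of `exp`,
Bernoulli's inequality at `t = 1 − 1/(2|Λ|)`) bounds `⟨S_0⟩_0 ≤ 4|Λ|/3`; hence `⟨(∂_iφ(x))²⟩_0 ≤ 2/3`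
and `⟨cos(∂_iφ(x)/√K)⟩_0 ≥ 1 − 1/(3K) ≥ 2/3` for `K ≥ 1`. -/

/-- relabelling the sites by a bijection of the torus preserves the Lebesgue integral on `ℝ^Λ`.
[folklore] -/
private theorem integral_comp_equiv [NeZero n] (e : (Fin 4 → ZMod n) ≃ (Fin 4 → ZMod n))
    (G : ((Fin 4 → ZMod n) → ℝ) → ℝ) :
    ∫ φ : (Fin 4 → ZMod n) → ℝ, G (fun s => φ (e s)) = ∫ φ : (Fin 4 → ZMod n) → ℝ, G φ := by
  have h := (_root_.MeasureTheory.volume_measurePreserving_piCongrLeft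
    (fun _ : Fin 4 → ZMod n => ℝ) e).integral_comp' (g := fun φ => G (fun s => φ (e s)))
  simp only [MeasurableEquiv.piCongrLeft_apply_apply] at h
  exact h.symm

/-- translating the sites preserves the Lebesgue integral on `ℝ^Λ`. [folklore] -/
private theorem integral_comp_translate [NeZero n] (a : Fin 4 → ZMod n)
    (G : ((Fin 4 → ZMod n) → ℝ) → ℝ) :
    ∫ φ : (Fin 4 → ZMod n) → ℝ, G (fun s => φ (s + a)) = ∫ φ : (Fin 4 → ZMod n) → ℝ, G φ :=
  integral_comp_equiv (Equiv.addRight a) G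

/-- permuting the four axes preserves the Lebesgue integral on `ℝ^Λ`. [folklore] -/
private theorem integral_comp_perm_axes [NeZero n] (π : Equiv.Perm (Fin 4))
    (G : ((Fin 4 → ZMod n) → ℝ) → ℝ) :
    ∫ φ : (Fin 4 → ZMod n) → ℝ, G (fun s => φ (fun k => s (π k)))
      = ∫ φ : (Fin 4 → ZMod n) → ℝ, G φ :=
  integral_comp_equiv (Equiv.arrowCongr π.symm (Equiv.refl (ZMod n))) G

/-- the gradient commutes with translations. [folklore] -/
private theorem D_translate (φ : (Fin 4 → ZMod n) → ℝ) (a : Fin 4 → ZMod n) (i : Fin 4)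
    (s : Fin 4 → ZMod n) : D (fun t => φ (t + a)) i s = D φ i (s + a) := by
  unfold D
  simp only [add_right_comm s (Pi.single i (1 : ZMod n)) a]

/-- `S_0` is translation invariant. [folklore] -/
private theorem S_zero_translate [NeZero n] (φ : (Fin 4 → ZMod n) → ℝ) (a : Fin 4 → ZMod n) :
    S 0 (fun t => φ (t + a)) = S 0 φ := by
  rw [S_zero_eq, S_zero_eq]
  simp only [D_translate]
  have h1 : ∑ s : Fin 4 → ZMod n, ∑ i : Fin 4, (D φ i (s + a)) ^ 2
      = ∑ s : Fin 4 → ZMod n, ∑ i : Fin 4, (D φ i s) ^ 2 :=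
    Fintype.sum_equiv (Equiv.addRight a) _ _ (fun s => rfl)
  have h2 : ∑ s : Fin 4 → ZMod n, φ (s + a) = ∑ s : Fin 4 → ZMod n, φ s :=
    Fintype.sum_equiv (Equiv.addRight a) _ _ (fun s => rfl)
  rw [h1, h2]

/-- axis permutations act on the unit vectors `e_i`. [folklore] -/
private theorem single_comp_perm (π : Equiv.Perm (Fin 4)) (i : Fin 4) (s : Fin 4 → ZMod n) :
    (fun k => (s + Pi.single i (1 : ZMod n) : Fin 4 → ZMod n) (π k))
      = (fun k => s (π k)) + Pi.single (π.symm i) (1 : ZMod n) := by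
  funext k
  rcases eq_or_ne k (π.symm i) with hk | hk
  · subst hk
    simp
  · have hk' : π k ≠ i := fun h => hk (by rw [← h, Equiv.symm_apply_apply])
    simp [Pi.single_eq_of_ne hk, Pi.single_eq_of_ne hk']

/-- the gradient is covariant under axis permutations. [folklore] -/
private theorem D_permute (φ : (Fin 4 → ZMod n) → ℝ) (π : Equiv.Perm (Fin 4)) (i : Fin 4)
    (s : Fin 4 → ZMod n) :
    D (fun t => φ (fun k => t (π k))) i s = D φ (π.symm i) (fun k => s (π k)) := by
  unfold D
  beta_reduce
  rw [single_comp_perm]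

/-- `S_0` is invariant under axis permutations. [folklore] -/
private theorem S_zero_permute [NeZero n] (φ : (Fin 4 → ZMod n) → ℝ) (π : Equiv.Perm (Fin 4)) :
    S 0 (fun t => φ (fun k => t (π k))) = S 0 φ := by
  rw [S_zero_eq, S_zero_eq]
  simp only [D_permute]
  have h1 : ∑ s : Fin 4 → ZMod n, ∑ i : Fin 4, (D φ (π.symm i) (fun k => s (π k))) ^ 2
      = ∑ s : Fin 4 → ZMod n, ∑ i : Fin 4, (D φ i s) ^ 2 := by
    rw [Fintype.sum_equiv (Equiv.arrowCongr π.symm (Equiv.refl (ZMod n)))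
      (fun s => ∑ i : Fin 4, (D φ (π.symm i) (fun k => s (π k))) ^ 2)
      (fun s => ∑ i : Fin 4, (D φ (π.symm i) s) ^ 2) (fun s => rfl)]
    exact Finset.sum_congr rfl (fun s _ => Fintype.sum_equiv π.symm _ _ (fun i => rfl))
  have h2 : ∑ s : Fin 4 → ZMod n, φ (fun k => s (π k)) = ∑ s : Fin 4 → ZMod n, φ s :=
    Fintype.sum_equiv (Equiv.arrowCongr π.symm (Equiv.refl (ZMod n))) _ _ (fun s => rfl)
  rw [h1, h2]

/-- translation invariance of the gradient second moment. [folklore] -/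
private theorem moment_translate [NeZero n] (i : Fin 4) (x : Fin 4 → ZMod n) :
    ∫ φ : (Fin 4 → ZMod n) → ℝ, (D φ i x) ^ 2 * Real.exp (-(S 0 φ))
      = ∫ φ : (Fin 4 → ZMod n) → ℝ, (D φ i 0) ^ 2 * Real.exp (-(S 0 φ)) := by
  have h := integral_comp_translate (n := n) x
    (fun φ => (D φ i 0) ^ 2 * Real.exp (-(S 0 φ)))
  simp only [D_translate, S_zero_translate, zero_add] at h
  exact h

/-- axis-permutation invariance of the gradient second moment. [folklore] -/
private theorem moment_permute [NeZero n] (i j : Fin 4) :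
    ∫ φ : (Fin 4 → ZMod n) → ℝ, (D φ j 0) ^ 2 * Real.exp (-(S 0 φ))
      = ∫ φ : (Fin 4 → ZMod n) → ℝ, (D φ i 0) ^ 2 * Real.exp (-(S 0 φ)) := by
  have h := integral_comp_perm_axes (n := n) (Equiv.swap i j)
    (fun φ => (D φ i 0) ^ 2 * Real.exp (-(S 0 φ)))
  simp only [D_permute, S_zero_permute, Equiv.symm_swap, Equiv.swap_apply_left,
    Pi.zero_apply] at h
  exact h

/-- `Σ_{x,i} (∂_iφ(x))² ≤ 2 S_0(φ)`. [folklore] -/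
private theorem sum_sq_D_le_two_S [NeZero n] (φ : (Fin 4 → ZMod n) → ℝ) :
    ∑ s : Fin 4 → ZMod n, ∑ i : Fin 4, (D φ i s) ^ 2 ≤ 2 * S 0 φ := by
  rw [S_zero_eq]
  have : 0 ≤ (∑ s : Fin 4 → ZMod n, φ s) ^ 2 / (2 * (Fintype.card (Fin 4 → ZMod n) : ℝ)) := by
    positivity
  linarith

/-- `(∂_iφ(x))² ≤ 2 S_0(φ)`. [folklore] -/
private theorem sq_D_le_two_S [NeZero n] (φ : (Fin 4 → ZMod n) → ℝ) (i : Fin 4) (s : Fin 4 → ZMod n) :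
    (D φ i s) ^ 2 ≤ 2 * S 0 φ := by
  have h1 : (D φ i s) ^ 2 ≤ ∑ i' : Fin 4, (D φ i' s) ^ 2 :=
    Finset.single_le_sum (f := fun i' => (D φ i' s) ^ 2) (fun i' _ => sq_nonneg _)
      (Finset.mem_univ i)
  have h2 : ∑ i' : Fin 4, (D φ i' s) ^ 2 ≤ ∑ s' : Fin 4 → ZMod n, ∑ i' : Fin 4, (D φ i' s') ^ 2 :=
    Finset.single_le_sum (f := fun s' => ∑ i' : Fin 4, (D φ i' s') ^ 2)
      (fun s' _ => Finset.sum_nonneg (fun i' _ => sq_nonneg _)) (Finset.mem_univ s)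
  linarith [sum_sq_D_le_two_S φ]

/-- secant form of the convexity of `exp`: `(b − a)·e^{−b} ≤ e^{−a} − e^{−b}`. [folklore] -/
private theorem sub_mul_exp_neg_le (a b : ℝ) :
    (b - a) * Real.exp (-b) ≤ Real.exp (-a) - Real.exp (-b) := by
  have h := Real.add_one_le_exp (b - a)
  have hb := Real.exp_pos (-b)
  have he : Real.exp (b - a) * Real.exp (-b) = Real.exp (-a) := by
    rw [← Real.exp_add]; ring_nf
  nlinarith [mul_le_mul_of_nonneg_right h hb.le, he]

/-- `S_0·e^{−S_0}` is integrable (`x e^{−x} ≤ 2e^{−x/2}`). [folklore] -/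
private theorem integrable_S_mul_exp_neg_S (n : ℕ) [NeZero n] :
    Integrable (fun φ : (Fin 4 → ZMod n) → ℝ => S 0 φ * Real.exp (-(S 0 φ))) := by
  refine ((integrable_exp_neg_mul_S_zero n (1 / 2) (by norm_num)).const_mul 2).mono'
    ((continuous_S 0).mul (continuous_S 0).neg.rexp).aestronglyMeasurable
    (Filter.Eventually.of_forall (fun φ => ?_))
  have hS := S_zero_nonneg φ
  rw [Real.norm_eq_abs, abs_of_nonneg (mul_nonneg hS (Real.exp_pos _).le)]
  set τ : ℝ := Real.exp (-(1 / 2 * S 0 φ)) with hτ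
  have hτpos : 0 < τ := Real.exp_pos _
  have h1 : S 0 φ ≤ 2 * Real.exp (1 / 2 * S 0 φ) := by
    have := Real.add_one_le_exp (1 / 2 * S 0 φ)
    linarith
  have h2 : Real.exp (-(S 0 φ)) = τ * τ := by
    rw [hτ, ← Real.exp_add]; ring_nf
  have h3 : Real.exp (1 / 2 * S 0 φ) * τ = 1 := by
    rw [hτ, ← Real.exp_add]; simp
  have h4 : S 0 φ * τ ≤ 2 := by nlinarith [h1, h3, Real.exp_pos (1 / 2 * S 0 φ), hτpos]
  rw [h2]
  nlinarith [h4, hτpos]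

/-- `(∂_iφ(x))²·e^{−S_0}` is integrable. [folklore] -/
private theorem integrable_sq_D_mul_exp (n : ℕ) [NeZero n] (i : Fin 4) (x : Fin 4 → ZMod n) :
    Integrable (fun φ : (Fin 4 → ZMod n) → ℝ => (D φ i x) ^ 2 * Real.exp (-(S 0 φ))) := by
  refine ((integrable_S_mul_exp_neg_S n).const_mul 2).mono' ?_
    (Filter.Eventually.of_forall (fun φ => ?_))
  · have hc : Continuous (fun φ : (Fin 4 → ZMod n) → ℝ => (D φ i x) ^ 2) := by
      unfold D; fun_prop
    exact (hc.mul (continuous_S 0).neg.rexp).aestronglyMeasurable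
  · rw [Real.norm_eq_abs, abs_of_nonneg (mul_nonneg (sq_nonneg _) (Real.exp_pos _).le)]
    calc (D φ i x) ^ 2 * Real.exp (-(S 0 φ)) ≤ (2 * S 0 φ) * Real.exp (-(S 0 φ)) :=
          mul_le_mul_of_nonneg_right (sq_D_le_two_S φ i x) (Real.exp_pos _).le
      _ = 2 * (S 0 φ * Real.exp (-(S 0 φ))) := by ring

/-- the change of variables `φ ↦ tφ`: `∫ e^{−t²S_0} = t^{−|Λ|}·∫ e^{−S_0}`. [folklore] -/
private theorem integral_exp_neg_sq_mul_S (n : ℕ) [NeZero n] (t : ℝ) (ht : 0 < t) :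
    ∫ φ : (Fin 4 → ZMod n) → ℝ, Real.exp (-(t ^ 2 * S 0 φ))
      = (t ^ Fintype.card (Fin 4 → ZMod n))⁻¹
        * ∫ φ : (Fin 4 → ZMod n) → ℝ, Real.exp (-(S 0 φ)) := by
  have h := _root_.MeasureTheory.Measure.integral_comp_smul (volume : Measure ((Fin 4 → ZMod n) → ℝ))
    (fun φ : (Fin 4 → ZMod n) → ℝ => Real.exp (-(S 0 φ))) t
  simp only [S_zero_smul, Module.finrank_fintype_fun_eq_card, smul_eq_mul] at h
  rw [abs_of_pos (inv_pos.mpr (pow_pos ht _))] at h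
  exact h

/-- DERIVATIVE-FREE EQUIPARTITION BOUND: `∫ S_0 e^{−S_0} ≤ (4|Λ|/3)·∫ e^{−S_0}` (the sharp value is
`|Λ|/2`; `4/3` is what the secant at `t = 1 − 1/(2|Λ|)` plus Bernoulli give, and all we need).
[folklore] -/
private theorem integral_S_mul_exp_le (n : ℕ) [NeZero n] :
    ∫ φ : (Fin 4 → ZMod n) → ℝ, S 0 φ * Real.exp (-(S 0 φ))
      ≤ (4 * (Fintype.card (Fin 4 → ZMod n) : ℝ) / 3)
        * ∫ φ : (Fin 4 → ZMod n) → ℝ, Real.exp (-(S 0 φ)) := by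
  set m : ℕ := Fintype.card (Fin 4 → ZMod n) with hm
  have hm1 : (1 : ℝ) ≤ (m : ℝ) := by exact_mod_cast Fintype.card_pos
  have hmpos : (0 : ℝ) < (m : ℝ) := by linarith
  set Z₀ : ℝ := ∫ φ : (Fin 4 → ZMod n) → ℝ, Real.exp (-(S 0 φ)) with hZ₀
  set M : ℝ := ∫ φ : (Fin 4 → ZMod n) → ℝ, S 0 φ * Real.exp (-(S 0 φ)) with hM
  have hZpos : 0 < Z₀ := Z_zero_zero_pos n
  have hMnn : 0 ≤ M :=
    integral_nonneg (fun φ => mul_nonneg (S_zero_nonneg φ) (Real.exp_pos _).le)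
  set t : ℝ := 1 - 1 / (2 * m) with htdef
  have h2m : 1 / (2 * (m : ℝ)) ≤ 1 / 2 := by
    rw [div_le_div_iff₀ (by positivity) (by norm_num)]; linarith
  have h2m' : 0 < 1 / (2 * (m : ℝ)) := by positivity
  have ht_half : 1 / 2 ≤ t := by rw [htdef]; linarith
  have ht_pos : 0 < t := by linarith
  -- Bernoulli: t^m ≥ 1 − m/(2m) = 1/2
  have hbern : (1 : ℝ) + (m : ℝ) * (-(1 / (2 * m))) ≤ t ^ m := by
    have hb := one_add_mul_le_pow (a := -(1 / (2 * (m : ℝ)))) (by linarith) m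
    have : (1 : ℝ) + -(1 / (2 * (m : ℝ))) = t := by rw [htdef]; ring
    rw [this] at hb
    exact hb
  have hhalf : (m : ℝ) * (-(1 / (2 * m))) = -(1 / 2) := by field_simp
  have htm : (1 / 2 : ℝ) ≤ t ^ m := by rw [hhalf] at hbern; linarith
  have htm_inv : (t ^ m)⁻¹ ≤ 2 := by
    rw [inv_le_comm₀ (pow_pos ht_pos m) two_pos]
    have : (2 : ℝ)⁻¹ = 1 / 2 := by norm_num
    rw [this]; exact htm
  -- the secant inequality, integrated
  have hpt : ∀ φ : (Fin 4 → ZMod n) → ℝ,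
      (1 - t ^ 2) * (S 0 φ * Real.exp (-(S 0 φ)))
        ≤ Real.exp (-(t ^ 2 * S 0 φ)) - Real.exp (-(S 0 φ)) := by
    intro φ
    have h := sub_mul_exp_neg_le (t ^ 2 * S 0 φ) (S 0 φ)
    have e1 : (S 0 φ - t ^ 2 * S 0 φ) * Real.exp (-(S 0 φ))
        = (1 - t ^ 2) * (S 0 φ * Real.exp (-(S 0 φ))) := by ring
    linarith
  have hint1 : Integrable (fun φ : (Fin 4 → ZMod n) → ℝ =>
      (1 - t ^ 2) * (S 0 φ * Real.exp (-(S 0 φ)))) := (integrable_S_mul_exp_neg_S n).const_mul _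
  have hint2 : Integrable (fun φ : (Fin 4 → ZMod n) → ℝ =>
      Real.exp (-(t ^ 2 * S 0 φ)) - Real.exp (-(S 0 φ))) :=
    (integrable_exp_neg_mul_S_zero n (t ^ 2) (by positivity)).sub (integrable_exp_neg_S_zero n)
  have hmono := integral_mono hint1 hint2 (fun φ => hpt φ)
  rw [integral_const_mul, integral_sub (integrable_exp_neg_mul_S_zero n (t ^ 2) (by positivity))
    (integrable_exp_neg_S_zero n), integral_exp_neg_sq_mul_S n t ht_pos] at hmono
  -- hmono : (1 - t²) * M ≤ (t^m)⁻¹ * Z₀ - Z₀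
  have hZ2 : (t ^ m)⁻¹ * Z₀ ≤ 2 * Z₀ := mul_le_mul_of_nonneg_right htm_inv hZpos.le
  have hsec : (1 - t ^ 2) * M ≤ Z₀ := by linarith
  -- 1 − t² ≥ 3/(4m)
  have h1t : 3 / (4 * (m : ℝ)) ≤ 1 - t ^ 2 := by
    have e : 1 - t ^ 2 - 3 / (4 * (m : ℝ)) = (1 / (4 * m)) * (1 - 1 / m) := by
      rw [htdef]; field_simp; ring
    have : 0 ≤ (1 / (4 * (m : ℝ))) * (1 - 1 / m) := by
      apply mul_nonneg (by positivity)
      rw [sub_nonneg, div_le_one hmpos]; exact hm1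
    linarith
  have key : 3 / (4 * (m : ℝ)) * M ≤ Z₀ :=
    le_trans (mul_le_mul_of_nonneg_right h1t hMnn) hsec
  calc M = (4 * (m : ℝ) / 3) * (3 / (4 * (m : ℝ)) * M) := by field_simp
    _ ≤ (4 * (m : ℝ) / 3) * Z₀ := mul_le_mul_of_nonneg_left key (by positivity)

/-- every gradient second moment is at most `2/3` of the mass: `∫(∂_iφ(x))²e^{−S_0} ≤ (2/3)∫e^{−S_0}`.
[folklore] -/
private theorem moment_le (n : ℕ) [NeZero n] (i : Fin 4) (x : Fin 4 → ZMod n) :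
    ∫ φ : (Fin 4 → ZMod n) → ℝ, (D φ i x) ^ 2 * Real.exp (-(S 0 φ))
      ≤ (2 / 3) * ∫ φ : (Fin 4 → ZMod n) → ℝ, Real.exp (-(S 0 φ)) := by
  set m : ℕ := Fintype.card (Fin 4 → ZMod n) with hm
  have hmpos : (0 : ℝ) < (m : ℝ) := by exact_mod_cast Fintype.card_pos
  set J : ℝ := ∫ φ : (Fin 4 → ZMod n) → ℝ, (D φ 0 0) ^ 2 * Real.exp (-(S 0 φ)) with hJ
  have heq : ∀ (j : Fin 4) (y : Fin 4 → ZMod n),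
      ∫ φ : (Fin 4 → ZMod n) → ℝ, (D φ j y) ^ 2 * Real.exp (-(S 0 φ)) = J := by
    intro j y
    rw [moment_translate j y, moment_permute 0 j]
  -- total gradient energy: ∑_y ∑_j ∫ (∂_jφ(y))² e^{−S_0} = 4 m J
  have htot : ∑ y : Fin 4 → ZMod n, ∑ j : Fin 4,
      ∫ φ : (Fin 4 → ZMod n) → ℝ, (D φ j y) ^ 2 * Real.exp (-(S 0 φ)) = 4 * (m : ℝ) * J := by
    simp only [heq, Finset.sum_const, Finset.card_univ, Fintype.card_fin, nsmul_eq_mul, hm]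
    push_cast
    ring
  -- and it equals ∫ (∑∑ (∂φ)²) e^{−S_0} ≤ ∫ 2 S_0 e^{−S_0}
  have hswap : ∑ y : Fin 4 → ZMod n, ∑ j : Fin 4,
      ∫ φ : (Fin 4 → ZMod n) → ℝ, (D φ j y) ^ 2 * Real.exp (-(S 0 φ))
      = ∫ φ : (Fin 4 → ZMod n) → ℝ, ∑ y : Fin 4 → ZMod n, ∑ j : Fin 4,
          (D φ j y) ^ 2 * Real.exp (-(S 0 φ)) := by
    rw [integral_finsetSum _ (fun y _ =>
      integrable_finsetSum _ (fun j _ => integrable_sq_D_mul_exp n j y))]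
    refine Finset.sum_congr rfl (fun y _ => ?_)
    rw [integral_finsetSum _ (fun j _ => integrable_sq_D_mul_exp n j y)]
  have hle : ∫ φ : (Fin 4 → ZMod n) → ℝ, ∑ y : Fin 4 → ZMod n, ∑ j : Fin 4,
      (D φ j y) ^ 2 * Real.exp (-(S 0 φ))
      ≤ ∫ φ : (Fin 4 → ZMod n) → ℝ, 2 * (S 0 φ * Real.exp (-(S 0 φ))) := by
    refine integral_mono (integrable_finsetSum _ (fun y _ =>
      integrable_finsetSum _ (fun j _ => integrable_sq_D_mul_exp n j y)))
      ((integrable_S_mul_exp_neg_S n).const_mul 2) (fun φ => ?_)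
    have h1 : ∑ y : Fin 4 → ZMod n, ∑ j : Fin 4, (D φ j y) ^ 2 * Real.exp (-(S 0 φ))
        = (∑ y : Fin 4 → ZMod n, ∑ j : Fin 4, (D φ j y) ^ 2) * Real.exp (-(S 0 φ)) := by
      rw [Finset.sum_mul]
      refine Finset.sum_congr rfl (fun y _ => ?_)
      rw [Finset.sum_mul]
    show ∑ y : Fin 4 → ZMod n, ∑ j : Fin 4, (D φ j y) ^ 2 * Real.exp (-(S 0 φ))
        ≤ 2 * (S 0 φ * Real.exp (-(S 0 φ)))
    rw [h1]
    calc (∑ y : Fin 4 → ZMod n, ∑ j : Fin 4, (D φ j y) ^ 2) * Real.exp (-(S 0 φ))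
        ≤ (2 * S 0 φ) * Real.exp (-(S 0 φ)) :=
          mul_le_mul_of_nonneg_right (sum_sq_D_le_two_S φ) (Real.exp_pos _).le
      _ = 2 * (S 0 φ * Real.exp (-(S 0 φ))) := by ring
  rw [integral_const_mul] at hle
  have hM := integral_S_mul_exp_le n
  have hx : ∫ φ : (Fin 4 → ZMod n) → ℝ, (D φ i x) ^ 2 * Real.exp (-(S 0 φ)) = J := heq i x
  rw [hx]
  -- 4 m J ≤ 2 · (4m/3) Z₀
  have h4 : 4 * (m : ℝ) * J ≤ 2 * ((4 * (m : ℝ) / 3)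
      * ∫ φ : (Fin 4 → ZMod n) → ℝ, Real.exp (-(S 0 φ))) := by
    rw [← htot, hswap]
    exact le_trans hle (by linarith)
  have h4' : 4 * (m : ℝ) * J ≤ 4 * (m : ℝ) * ((2 / 3)
      * ∫ φ : (Fin 4 → ZMod n) → ℝ, Real.exp (-(S 0 φ))) := by linarith [h4]
  exact le_of_mul_le_mul_left h4' (by positivity)

/-- the cosine two-point function at `g = 0` against the moment bound:
`(2/3)·∫e^{−S_0} ≤ ∫ cos(∂_iφ(x)/√K) e^{−S_0}` for `K ≥ 1`. [folklore] -/
private theorem cos_moment_lower (n : ℕ) [NeZero n] (K : ℝ) (hK : 1 ≤ K) (x : Fin 4 → ZMod n)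
    (i : Fin 4) :
    (2 / 3) * ∫ φ : (Fin 4 → ZMod n) → ℝ, Real.exp (-(S 0 φ))
      ≤ ∫ φ : (Fin 4 → ZMod n) → ℝ, Real.cos (D φ i x / Real.sqrt K) * Real.exp (-(S 0 φ)) := by
  have hKpos : 0 < K := by linarith
  have hpt : ∀ φ : (Fin 4 → ZMod n) → ℝ,
      Real.exp (-(S 0 φ)) - 1 / (2 * K) * ((D φ i x) ^ 2 * Real.exp (-(S 0 φ)))
        ≤ Real.cos (D φ i x / Real.sqrt K) * Real.exp (-(S 0 φ)) := by
    intro φ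
    have hc := Real.one_sub_sq_div_two_le_cos (x := D φ i x / Real.sqrt K)
    have hsq : (D φ i x / Real.sqrt K) ^ 2 = (D φ i x) ^ 2 / K := by
      rw [div_pow, Real.sq_sqrt hKpos.le]
    rw [hsq] at hc
    have he := Real.exp_pos (-(S 0 φ))
    have h1 := mul_le_mul_of_nonneg_right hc he.le
    have e1 : (1 - (D φ i x) ^ 2 / K / 2) * Real.exp (-(S 0 φ))
        = Real.exp (-(S 0 φ)) - 1 / (2 * K) * ((D φ i x) ^ 2 * Real.exp (-(S 0 φ))) := by
      field_simp
    linarith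
  have hint_l : Integrable (fun φ : (Fin 4 → ZMod n) → ℝ =>
      Real.exp (-(S 0 φ)) - 1 / (2 * K) * ((D φ i x) ^ 2 * Real.exp (-(S 0 φ)))) :=
    (integrable_exp_neg_S_zero n).sub ((integrable_sq_D_mul_exp n i x).const_mul _)
  have hint_r : Integrable (fun φ : (Fin 4 → ZMod n) → ℝ =>
      Real.cos (D φ i x / Real.sqrt K) * Real.exp (-(S 0 φ))) := by
    refine (integrable_exp_neg_S_zero n).mono' ?_ (Filter.Eventually.of_forall (fun φ => ?_))
    · have hc : Continuous (fun φ : (Fin 4 → ZMod n) → ℝ =>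
          Real.cos (D φ i x / Real.sqrt K)) := by
        unfold D; fun_prop
      exact (hc.mul (continuous_S 0).neg.rexp).aestronglyMeasurable
    · rw [Real.norm_eq_abs, abs_mul, abs_of_pos (Real.exp_pos _)]
      exact mul_le_of_le_one_left (Real.exp_pos _).le (Real.abs_cos_le_one _)
  have hmono := integral_mono hint_l hint_r (fun φ => hpt φ)
  rw [integral_sub (integrable_exp_neg_S_zero n) ((integrable_sq_D_mul_exp n i x).const_mul _),
    integral_const_mul] at hmono
  have hmom := moment_le n i x
  have hZ := (Z_zero_zero_pos n).le
  have hJ : 0 ≤ ∫ φ : (Fin 4 → ZMod n) → ℝ, (D φ i x) ^ 2 * Real.exp (-(S 0 φ)) :=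
    integral_nonneg (fun φ => mul_nonneg (sq_nonneg _) (Real.exp_pos _).le)
  have hK2 : 1 / (2 * K) ≤ 1 / 2 := by
    rw [div_le_div_iff₀ (by positivity) (by norm_num)]; linarith
  have h1 : 1 / (2 * K) * ∫ φ : (Fin 4 → ZMod n) → ℝ, (D φ i x) ^ 2 * Real.exp (-(S 0 φ))
      ≤ (1 / 2) * ((2 / 3) * ∫ φ : (Fin 4 → ZMod n) → ℝ, Real.exp (-(S 0 φ))) :=
    mul_le_mul hK2 hmom hJ (by norm_num)
  linarith

/-- the Gaussian cosine expectation is the real ratio of the two Lebesgue integrals. [folklore] -/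
private theorem ev_zero_cos_re (n : ℕ) [NeZero n] (K : ℝ) (x : Fin 4 → ZMod n) (i : Fin 4) :
    (ev n 0 (fun φ => ((Real.cos (D φ i x / Real.sqrt K) : ℝ) : ℂ))).re
      = (∫ φ : (Fin 4 → ZMod n) → ℝ, Real.cos (D φ i x / Real.sqrt K) * Real.exp (-(S 0 φ)))
        / ∫ φ : (Fin 4 → ZMod n) → ℝ, Real.exp (-(S 0 φ)) := by
  unfold ev
  rw [Z_zero_zero_eq]
  have h : (fun φ : (Fin 4 → ZMod n) → ℝ =>
      ((Real.cos (D φ i x / Real.sqrt K) : ℝ) : ℂ) * w 0 0 φ)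
      = fun φ => (((Real.cos (D φ i x / Real.sqrt K) * Real.exp (-(S 0 φ)) : ℝ)) : ℂ) := by
    funext φ
    rw [w_zero_zero, ← Complex.ofReal_mul]
  rw [h, integral_complex_ofReal, ← Complex.ofReal_div, Complex.ofReal_re]

/-- **The Gaussian side, proved:** `Re⟨cos(∂_iφ(x)/√K)⟩_0 ≥ 2/3` on every torus `(ℤ/n)^4`, for every
`K ≥ 1`, site and axis (free lattice field with rank-one zero-mode mass; via `cos t ≥ 1 − t²/2`, the
symmetries `moment_translate`/`moment_permute` and the scaling bound `moment_le : ∫(∂_iφ(x))²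
e^{−S_0} ≤ (2/3)∫e^{−S_0}`). [cite: FriedliVelenik2017, Ch. 8] -/
theorem cosLowerBoundAt_two_thirds : CosLowerBoundAt (2 / 3) := by
  intro n _ K hK x i
  rw [ev_zero_cos_re, le_div_iff₀ (Z_zero_zero_pos n)]
  exact cos_moment_lower n K hK x i

/-- **Main conditional theorem (per base `L`).** The two forms of hypothesis (A) ALONE — the
cumulant bound `CumulantBoundAt L g₁ C₁` and the local two-point bound `LocalTwoPointAt L g₂ C₂` —
give, for some explicit `g₀ > 0`, volume-uniform stiffness `StiffnessAt L g₀` (clauses (a)–(c) for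
all `0 ≤ g ≤ g₀`, `N ≥ 1`, `n = L^N`) together with the sharp form `SharpStiffnessAt L g₀ C₁`; the
Gaussian side is the theorem `cosLowerBoundAt_two_thirds`, so no further hypothesis enters.  When
applied, the trust base is exactly the two hypotheses (the reference's Theorem 2.2 transcribed to the
complex `ι`-symmetric weight, which is not in print). [cite: AdamsBuchholzKoteckyMuller2019, Thm 2.2] -/
theorem stiffnessAt_of_hypA {L : ℕ} {g₁ C₁ g₂ C₂ : ℝ} (hg₁ : 0 < g₁) (hg₂ : 0 < g₂)
    (h₁ : CumulantBoundAt L g₁ C₁) (h₂ : LocalTwoPointAt L g₂ C₂) :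
    ∃ g₀ : ℝ, 0 < g₀ ∧ StiffnessAt L g₀ ∧ SharpStiffnessAt L g₀ C₁ := by
  obtain ⟨g₀, hg₀, hle, hS⟩ :=
    stiffnessAt_of_bounds (θ := 2 / 3) (by norm_num) cosLowerBoundAt_two_thirds hg₁ hg₂ h₁ h₂
  exact ⟨g₀, hg₀, hS, sharpStiffnessAt_mono hle (sharpStiffnessAt_of_cumulantBoundAt h₁)⟩

/-- **Main conditional theorem, tower form** (the quantifier shape of the reference's Theorem 2.2:
`∃ L₀, ∀ L` odd `≥ L₀, ∃ g₀(L) > 0`, uniformly in `N ≥ 1`): if both forms of hypothesis (A) hold for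
all large odd bases, then so do volume-uniform stiffness and its sharp form.  Hypotheses and
conclusion are spelled out; no closed statement is named or asserted here. [cite: AdamsBuchholzKoteckyMuller2019, Thm 2.2] -/
theorem stiffness_tower_of_hypA
    (h₁ : ∃ L₀ : ℕ, ∀ L : ℕ, Odd L → L₀ ≤ L → ∃ g₀ C : ℝ, 0 < g₀ ∧ CumulantBoundAt L g₀ C)
    (h₂ : ∃ L₀ : ℕ, ∀ L : ℕ, Odd L → L₀ ≤ L → ∃ g₀ C : ℝ, 0 < g₀ ∧ LocalTwoPointAt L g₀ C) :
    ∃ L₀ : ℕ, ∀ L : ℕ, Odd L → L₀ ≤ L →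
      ∃ g₀ : ℝ, 0 < g₀ ∧ StiffnessAt L g₀ ∧ ∃ C : ℝ, SharpStiffnessAt L g₀ C := by
  obtain ⟨L₁, hL₁⟩ := h₁
  obtain ⟨L₂, hL₂⟩ := h₂
  refine ⟨max L₁ L₂, fun L hodd hle => ?_⟩
  obtain ⟨g₁, C₁, hg₁, hA⟩ := hL₁ L hodd (le_trans (le_max_left _ _) hle)
  obtain ⟨g₂, C₂, hg₂, hB⟩ := hL₂ L hodd (le_trans (le_max_right _ _) hle)
  obtain ⟨g₀, hg₀, hS, hSh⟩ := stiffnessAt_of_hypA hg₁ hg₂ hA hB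
  exact ⟨g₀, hg₀, hS, C₁, hSh⟩

/-! ## The clauses at zero coupling; the rate-free form of the local hypothesis -/

/-- Orientation / non-vacuity check: at `g = 0` the three clauses of `StiffnessAt` hold on EVERY
torus — `Z_n(0,0) ≠ 0`, `Re⟨cos(∂_iφ(x)/√K)⟩_0 ≥ 2/3 ≥ 1/2`, and `Υ_n(0)[u] = |u|²` exactly (the free
lattice field has unit stiffness). [cite: FriedliVelenik2017, Ch. 8] -/
theorem stiffness_clauses_at_zero_coupling (n : ℕ) [NeZero n] :
    Z n 0 0 ≠ 0 ∧
    (∀ K : ℝ, 1 ≤ K → ∀ (x : Fin 4 → ZMod n) (i : Fin 4),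
      (1 / 2 : ℝ) ≤ (ev n 0 (fun φ => ((Real.cos (D φ i x / Real.sqrt K) : ℝ) : ℂ))).re) ∧
    (∀ u : Fin 4 → ℝ, ‖Upsilon n 0 u - ((∑ i : Fin 4, (u i) ^ 2 : ℝ) : ℂ)‖
      ≤ (∑ i : Fin 4, (u i) ^ 2) / 2) := by
  refine ⟨Z_zero_zero_ne n, fun K hK x i => ?_, fun u => ?_⟩
  · have h := cosLowerBoundAt_two_thirds n K hK x i
    linarith
  · unfold Upsilon
    simp only [Complex.ofReal_zero, ne_eq, OfNat.ofNat_ne_zero, not_false_eq_true, zero_pow,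
      zero_mul, zero_div, add_zero, sub_self, norm_zero]
    positivity

/-- **Hypothesis (A), rate-free local form** (DEFINITION, a property of `(L, g₀, ε)`): for
`0 ≤ g ≤ g₀`, `N ≥ 1`, `n = L^N`: `Z_n(g,0) ≠ 0` and `⟨cos(∂_iφ(x)/√K)⟩_g` lies within `ε` of its
Gaussian value, uniformly in `K ≥ 1`.  No rate in `g` is needed for clauses (a)–(b): `ε = 1/6`
suffices (`stiffnessAt_of_within_sixth`), and `LocalTwoPointAt` gives every `ε > 0` after shrinking
the threshold (`localTwoPointWithinAt_of_localTwoPointAt`). [cite: AdamsBuchholzKoteckyMuller2019, Thm 2.2] -/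
def LocalTwoPointWithinAt (L : ℕ) (g₀ ε : ℝ) : Prop :=
  ∀ g : ℝ, 0 ≤ g → g ≤ g₀ → ∀ N : ℕ, 1 ≤ N → ∀ (n : ℕ) [NeZero n], n = L ^ N →
    Z n g 0 ≠ 0 ∧ ∀ K : ℝ, 1 ≤ K → ∀ (x : Fin 4 → ZMod n) (i : Fin 4),
      ‖ev n g (fun φ => ((Real.cos (D φ i x / Real.sqrt K) : ℝ) : ℂ))
          - ev n 0 (fun φ => ((Real.cos (D φ i x / Real.sqrt K) : ℝ) : ℂ))‖ ≤ ε

/-- `LocalTwoPointAt L g₀ C` gives the rate-free form with tolerance `ε` at the threshold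
`min g₀ (ε/(|C|+1))`. [cite: AdamsBuchholzKoteckyMuller2019, Thm 2.2] -/
theorem localTwoPointWithinAt_of_localTwoPointAt {L : ℕ} {g₀ C ε : ℝ} (hε : 0 < ε)
    (h : LocalTwoPointAt L g₀ C) : LocalTwoPointWithinAt L (min g₀ (ε / (|C| + 1))) ε := by
  have hden : 0 < |C| + 1 := by positivity
  intro g hg0 hg N hN n _ hn
  have hg_1 : g ≤ g₀ := le_trans hg (min_le_left _ _)
  have hg_2 : g ≤ ε / (|C| + 1) := le_trans hg (min_le_right _ _)
  obtain ⟨hZ, hloc⟩ := h g hg0 hg_1 N hN n hn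
  refine ⟨hZ, fun K hK x i => le_trans (hloc K hK x i) ?_⟩
  have h1 : C * g ≤ |C| * g := mul_le_mul_of_nonneg_right (le_abs_self C) hg0
  have h2 : |C| * g ≤ |C| * (ε / (|C| + 1)) := mul_le_mul_of_nonneg_left hg_2 (abs_nonneg C)
  have h3 : |C| * (ε / (|C| + 1)) ≤ ε := by
    rw [mul_div_assoc', div_le_iff₀ hden]
    nlinarith [abs_nonneg C]
  linarith

/-- The reduction from the rate-free door: `1/2 + ε ≤ θ`, the cumulant bound, the rate-free local
form with tolerance `ε`, and a Gaussian lower bound `CosLowerBoundAt θ` give `StiffnessAt L g₀` for an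
explicit `0 < g₀ ≤ g₁`. [cite: AdamsBuchholzKoteckyMuller2019, Thm 2.2] -/
theorem stiffnessAt_of_within {θ ε : ℝ} (hθε : 1 / 2 + ε ≤ θ) (hG : CosLowerBoundAt θ) {L : ℕ}
    {g₁ C₁ g₂ : ℝ} (hg₁ : 0 < g₁) (hg₂ : 0 < g₂) (h₁ : CumulantBoundAt L g₁ C₁)
    (h₂ : LocalTwoPointWithinAt L g₂ ε) :
    ∃ g₀ : ℝ, 0 < g₀ ∧ g₀ ≤ g₁ ∧ StiffnessAt L g₀ := by
  have hC := clauseC_of_sharpStiffnessAt (sharpStiffnessAt_of_cumulantBoundAt h₁)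
  have hd1 : 0 < 2 * (|C₁| + 1) := by positivity
  refine ⟨min (min g₁ (1 / (2 * (|C₁| + 1)))) g₂,
    lt_min (lt_min hg₁ (by positivity)) hg₂, le_trans (min_le_left _ _) (min_le_left _ _), ?_⟩
  intro g hg0 hg N hN n _ hn
  have hg_1 : g ≤ min g₁ (1 / (2 * (|C₁| + 1))) := le_trans hg (min_le_left _ _)
  have hg_2 : g ≤ g₂ := le_trans hg (min_le_right _ _)
  obtain ⟨hZ, hloc⟩ := h₂ g hg0 hg_2 N hN n hn
  refine ⟨hZ, ?_, fun u => hC g hg0 hg_1 N hN n hn u⟩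
  intro K hK x i
  have hdiff := hloc K hK x i
  have hlow := hG n K hK x i
  set a : ℂ := ev n g (fun φ => ((Real.cos (D φ i x / Real.sqrt K) : ℝ) : ℂ)) with ha
  set b : ℂ := ev n 0 (fun φ => ((Real.cos (D φ i x / Real.sqrt K) : ℝ) : ℂ)) with hb
  have hre : |(a - b).re| ≤ ‖a - b‖ := Complex.abs_re_le_norm _
  have h4 : |(a - b).re| ≤ ε := le_trans hre hdiff
  rw [Complex.sub_re] at h4
  have h5 := (abs_le.mp h4).1
  linarith

/-- Stiffness from the WEAKEST local input: the cumulant bound and the rate-free local form with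
tolerance `1/6` (the proved Gaussian value is `≥ 2/3 = 1/2 + 1/6`). [cite: AdamsBuchholzKoteckyMuller2019, Thm 2.2] -/
theorem stiffnessAt_of_within_sixth {L : ℕ} {g₁ C₁ g₂ : ℝ} (hg₁ : 0 < g₁) (hg₂ : 0 < g₂)
    (h₁ : CumulantBoundAt L g₁ C₁) (h₂ : LocalTwoPointWithinAt L g₂ (1 / 6)) :
    ∃ g₀ : ℝ, 0 < g₀ ∧ StiffnessAt L g₀ ∧ SharpStiffnessAt L g₀ C₁ := by
  obtain ⟨g₀, hg₀, hle, hS⟩ := stiffnessAt_of_within (θ := 2 / 3) (ε := 1 / 6) (by norm_num)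
    cosLowerBoundAt_two_thirds hg₁ hg₂ h₁ h₂
  exact ⟨g₀, hg₀, hS, sharpStiffnessAt_mono hle (sharpStiffnessAt_of_cumulantBoundAt h₁)⟩

/-! ## `Upsilon` is the zero-twist Hessian of `−log Z_n(g,·u)/|Λ|`
Branch-free form.  With `F(t) := ∫ w_{g,0}(φ)·exp(−i g t Y_u(φ)) dφ` one has the EXACT factorisation
`Z_n(g, t·u) = exp(−|Λ|t²|u|²/2 − i g|Λ|t³u_τ|u_sp|²)·F(t)` (`Z_smul_factor`), `F` is twice
differentiable under the integral sign (`hasDerivAt_twistIntegral`, `hasDerivAt_twistIntegral_deriv`;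
domination from `|Y_u| ≤ 6‖u‖S_0`), and `Υ_n(g)[u] = |u|² − (F″(0)/F(0) − (F′(0)/F(0))²)/|Λ|`
(`upsilon_eq_twistHessian`), which is `∂²_t [−log Z_n(g,t·u)/|Λ|]_{t=0}` for ANY local branch of the
logarithm (the explicit prefactor contributes `|u|²`, the cubic phase nothing at `t = 0`);
`upsilon_eq_logZ_hessian` states it for `Z` itself.  This is the finite-volume form of
Fisher–Barber–Jasnow's definition of the helicity modulus as the second-order response of the free
energy to an imposed twist. -/

/-- `Y_u` is continuous in the field. [folklore] -/
private theorem continuous_Y [NeZero n] (u : Fin 4 → ℝ) :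
    Continuous (fun φ : (Fin 4 → ZMod n) → ℝ => Y u φ) := by
  unfold Y D
  fun_prop

/-- `|Y_u(φ)| ≤ 6‖u‖·S_0(φ)` (`‖u‖` = sup norm). [folklore] -/
private theorem abs_Y_le [NeZero n] (u : Fin 4 → ℝ) (φ : (Fin 4 → ZMod n) → ℝ) :
    |Y u φ| ≤ 6 * ‖u‖ * S 0 φ := by
  have hu : ∀ i, |u i| ≤ ‖u‖ := fun i => by
    have h := norm_le_pi_norm u i
    rwa [Real.norm_eq_abs] at h
  have hu0 : 0 ≤ ‖u‖ := norm_nonneg u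
  have hterm : ∀ s : Fin 4 → ZMod n,
      |u 0 * ∑ j : Fin 3, (D φ j.succ s) ^ 2
        + 2 * D φ 0 s * ∑ j : Fin 3, u j.succ * D φ j.succ s|
      ≤ 3 * ‖u‖ * ∑ i : Fin 4, (D φ i s) ^ 2 := by
    intro s
    have hA : 0 ≤ ∑ j : Fin 3, (D φ j.succ s) ^ 2 := Finset.sum_nonneg (fun j _ => sq_nonneg _)
    have hB : |∑ j : Fin 3, u j.succ * D φ j.succ s| ≤ ‖u‖ * ∑ j : Fin 3, |D φ j.succ s| := by
      refine le_trans (Finset.abs_sum_le_sum_abs _ _) ?_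
      rw [Finset.mul_sum]
      refine Finset.sum_le_sum (fun j _ => ?_)
      rw [abs_mul]
      exact mul_le_mul_of_nonneg_right (hu j.succ) (abs_nonneg _)
    have hC : 2 * |D φ 0 s| * ∑ j : Fin 3, |D φ j.succ s|
        ≤ 3 * (D φ 0 s) ^ 2 + ∑ j : Fin 3, (D φ j.succ s) ^ 2 := by
      rw [Finset.mul_sum]
      have h1 : ∀ j : Fin 3, 2 * |D φ 0 s| * |D φ j.succ s| ≤ (D φ 0 s) ^ 2 + (D φ j.succ s) ^ 2 := by
        intro j
        have h := two_mul_le_add_sq |D φ 0 s| |D φ j.succ s|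
        rw [sq_abs, sq_abs] at h
        exact h
      calc ∑ j : Fin 3, 2 * |D φ 0 s| * |D φ j.succ s|
          ≤ ∑ j : Fin 3, ((D φ 0 s) ^ 2 + (D φ j.succ s) ^ 2) := Finset.sum_le_sum (fun j _ => h1 j)
        _ = 3 * (D φ 0 s) ^ 2 + ∑ j : Fin 3, (D φ j.succ s) ^ 2 := by
          rw [Finset.sum_add_distrib, Finset.sum_const, Finset.card_univ, Fintype.card_fin]
          simp only [nsmul_eq_mul, Nat.cast_ofNat]
    calc |u 0 * ∑ j : Fin 3, (D φ j.succ s) ^ 2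
            + 2 * D φ 0 s * ∑ j : Fin 3, u j.succ * D φ j.succ s|
        ≤ |u 0 * ∑ j : Fin 3, (D φ j.succ s) ^ 2|
            + |2 * D φ 0 s * ∑ j : Fin 3, u j.succ * D φ j.succ s| := abs_add_le _ _
      _ = |u 0| * ∑ j : Fin 3, (D φ j.succ s) ^ 2
            + 2 * |D φ 0 s| * |∑ j : Fin 3, u j.succ * D φ j.succ s| := by
          rw [abs_mul, abs_of_nonneg hA, abs_mul, abs_mul, abs_two]
      _ ≤ ‖u‖ * ∑ j : Fin 3, (D φ j.succ s) ^ 2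
            + 2 * |D φ 0 s| * (‖u‖ * ∑ j : Fin 3, |D φ j.succ s|) :=
          add_le_add (mul_le_mul_of_nonneg_right (hu 0) hA)
            (mul_le_mul_of_nonneg_left hB (by positivity))
      _ = ‖u‖ * ∑ j : Fin 3, (D φ j.succ s) ^ 2
            + ‖u‖ * (2 * |D φ 0 s| * ∑ j : Fin 3, |D φ j.succ s|) := by ring
      _ ≤ ‖u‖ * ∑ j : Fin 3, (D φ j.succ s) ^ 2
            + ‖u‖ * (3 * (D φ 0 s) ^ 2 + ∑ j : Fin 3, (D φ j.succ s) ^ 2) := by gcongr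
      _ ≤ 3 * ‖u‖ * ((D φ 0 s) ^ 2 + ∑ j : Fin 3, (D φ j.succ s) ^ 2) := by
          nlinarith [mul_nonneg hu0 hA]
      _ = 3 * ‖u‖ * ∑ i : Fin 4, (D φ i s) ^ 2 := by
          rw [Fin.sum_univ_succ (f := fun i : Fin 4 => (D φ i s) ^ 2)]
  unfold Y
  calc |∑ s : Fin 4 → ZMod n, (u 0 * ∑ j : Fin 3, (D φ j.succ s) ^ 2
          + 2 * D φ 0 s * ∑ j : Fin 3, u j.succ * D φ j.succ s)|
      ≤ ∑ s : Fin 4 → ZMod n, |u 0 * ∑ j : Fin 3, (D φ j.succ s) ^ 2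
          + 2 * D φ 0 s * ∑ j : Fin 3, u j.succ * D φ j.succ s| := Finset.abs_sum_le_sum_abs _ _
    _ ≤ ∑ s : Fin 4 → ZMod n, 3 * ‖u‖ * ∑ i : Fin 4, (D φ i s) ^ 2 :=
        Finset.sum_le_sum (fun s _ => hterm s)
    _ = 3 * ‖u‖ * ∑ s : Fin 4 → ZMod n, ∑ i : Fin 4, (D φ i s) ^ 2 := by rw [Finset.mul_sum]
    _ ≤ 3 * ‖u‖ * (2 * S 0 φ) := by
        have h := sum_sq_D_le_two_S φ
        gcongr
    _ = 6 * ‖u‖ * S 0 φ := by ring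

/-- `S_0² e^{−S_0}` is integrable (`x² ≤ 16 e^{x/2}`). [folklore] -/
private theorem integrable_S_sq_mul_exp_neg_S (n : ℕ) [NeZero n] :
    Integrable (fun φ : (Fin 4 → ZMod n) → ℝ => (S 0 φ) ^ 2 * Real.exp (-(S 0 φ))) := by
  refine ((integrable_exp_neg_mul_S_zero n (1 / 2) (by norm_num)).const_mul 16).mono'
    (((continuous_S 0).pow 2).mul (continuous_S 0).neg.rexp).aestronglyMeasurable
    (Filter.Eventually.of_forall (fun φ => ?_))
  have hS := S_zero_nonneg φ
  rw [Real.norm_eq_abs, abs_of_nonneg (mul_nonneg (sq_nonneg _) (Real.exp_pos _).le)]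
  have h1 : S 0 φ / 4 ≤ Real.exp (S 0 φ / 4) := by
    have := Real.add_one_le_exp (S 0 φ / 4)
    linarith
  have h2 : (S 0 φ / 4) ^ 2 ≤ Real.exp (S 0 φ / 4) ^ 2 :=
    pow_le_pow_left₀ (by positivity) h1 2
  have h3 : Real.exp (S 0 φ / 4) ^ 2 = Real.exp (S 0 φ / 2) := by
    rw [sq, ← Real.exp_add]
    congr 1
    ring
  have h4 : (S 0 φ) ^ 2 ≤ 16 * Real.exp (S 0 φ / 2) := by
    rw [h3] at h2
    nlinarith [h2]
  calc (S 0 φ) ^ 2 * Real.exp (-(S 0 φ))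
      ≤ 16 * Real.exp (S 0 φ / 2) * Real.exp (-(S 0 φ)) := by gcongr
    _ = 16 * Real.exp (-(1 / 2 * S 0 φ)) := by
        rw [mul_assoc, ← Real.exp_add]
        congr 2
        ring

/-- domination helper: `w_{g,0}·G` is integrable when `‖G‖ ≤ b` with `b·e^{−S_0}` integrable.
[folklore] -/
private theorem integrable_w_mul_of_le (n : ℕ) [NeZero n] (g : ℝ) (G : ((Fin 4 → ZMod n) → ℝ) → ℂ)
    (hG : Continuous G) (b : ((Fin 4 → ZMod n) → ℝ) → ℝ)
    (hb : Integrable (fun φ : (Fin 4 → ZMod n) → ℝ => b φ * Real.exp (-(S 0 φ))))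
    (hGb : ∀ φ, ‖G φ‖ ≤ b φ) :
    Integrable (fun φ : (Fin 4 → ZMod n) → ℝ => w g 0 φ * G φ) := by
  refine hb.mono' ((continuous_w g 0).mul hG).aestronglyMeasurable
    (Filter.Eventually.of_forall (fun φ => ?_))
  rw [norm_mul, norm_w, mul_comm]
  exact mul_le_mul_of_nonneg_right (hGb φ) (Real.exp_pos _).le

/-- the twist phase `exp(t·c)`, `c = −i·r`, is unimodular for real `t`. [folklore] -/
private theorem norm_exp_phase (t r : ℝ) :
    ‖Complex.exp ((t : ℂ) * -(Complex.I * (r : ℂ)))‖ = 1 := by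
  rw [Complex.norm_exp]
  simp

/-- `‖−(i·r)‖ = |r|` for real `r`. [folklore] -/
private theorem norm_phase_coeff (r : ℝ) : ‖-(Complex.I * (r : ℂ))‖ = |r| := by
  rw [norm_neg, norm_mul, Complex.norm_I, one_mul, Complex.norm_real, Real.norm_eq_abs]

/-- derivative of `s ↦ exp(s·c)` along the reals. [folklore] -/
private theorem hasDerivAt_exp_phase (c : ℂ) (t : ℝ) :
    HasDerivAt (fun s : ℝ => Complex.exp ((s : ℂ) * c)) (Complex.exp ((t : ℂ) * c) * c) t := by
  have h1 : HasDerivAt (fun s : ℝ => (s : ℂ) * c) c t := by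
    have h := (hasDerivAt_id t).ofReal_comp.mul_const c
    simpa using h
  exact h1.cexp

/-- Twist integral, first derivative: `F(t) = ∫ w_{g,0}·exp(−i g t Y_u)` is differentiable on `ℝ`, with the
derivative obtained under the integral sign (domination `t`-free: the phase is unimodular and
`|Y_u| ≤ 6‖u‖S_0`). [folklore] -/
private theorem hasDerivAt_twistIntegral (n : ℕ) [NeZero n] (g : ℝ) (u : Fin 4 → ℝ) (t₀ : ℝ) :
    HasDerivAt
      (fun t : ℝ => ∫ φ : (Fin 4 → ZMod n) → ℝ,
        w g 0 φ * Complex.exp ((t : ℂ) * -(Complex.I * ((g * Y u φ : ℝ) : ℂ))))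
      (∫ φ : (Fin 4 → ZMod n) → ℝ,
        w g 0 φ * (Complex.exp ((t₀ : ℂ) * -(Complex.I * ((g * Y u φ : ℝ) : ℂ)))
          * -(Complex.I * ((g * Y u φ : ℝ) : ℂ)))) t₀ := by
  have hY : Continuous (fun φ : (Fin 4 → ZMod n) → ℝ => -(Complex.I * ((g * Y u φ : ℝ) : ℂ))) :=
    (continuous_const.mul (Complex.continuous_ofReal.comp
      (continuous_const.mul (continuous_Y u)))).neg
  have hph : ∀ t : ℝ, Continuous (fun φ : (Fin 4 → ZMod n) → ℝ =>
      Complex.exp ((t : ℂ) * -(Complex.I * ((g * Y u φ : ℝ) : ℂ)))) := fun t =>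
    Complex.continuous_exp.comp (continuous_const.mul hY)
  have hF_meas : ∀ t : ℝ, AEStronglyMeasurable (fun φ : (Fin 4 → ZMod n) → ℝ =>
      w g 0 φ * Complex.exp ((t : ℂ) * -(Complex.I * ((g * Y u φ : ℝ) : ℂ)))) volume := fun t =>
    ((continuous_w g 0).mul (hph t)).aestronglyMeasurable
  have hF_int : Integrable (fun φ : (Fin 4 → ZMod n) → ℝ =>
      w g 0 φ * Complex.exp ((t₀ : ℂ) * -(Complex.I * ((g * Y u φ : ℝ) : ℂ)))) := by
    refine integrable_w_mul_of_le n g _ (hph t₀) (fun _ => 1)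
      (by simpa using integrable_exp_neg_S_zero n) (fun φ => ?_)
    rw [norm_exp_phase]
  have hF'_meas : AEStronglyMeasurable (fun φ : (Fin 4 → ZMod n) → ℝ =>
      w g 0 φ * (Complex.exp ((t₀ : ℂ) * -(Complex.I * ((g * Y u φ : ℝ) : ℂ)))
        * -(Complex.I * ((g * Y u φ : ℝ) : ℂ)))) volume :=
    ((continuous_w g 0).mul ((hph t₀).mul hY)).aestronglyMeasurable
  have hb_int : Integrable (fun φ : (Fin 4 → ZMod n) → ℝ =>
      |g| * (6 * ‖u‖) * S 0 φ * Real.exp (-(S 0 φ))) :=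
    ((integrable_S_mul_exp_neg_S n).const_mul (|g| * (6 * ‖u‖))).congr
      (Filter.Eventually.of_forall (fun φ => by simp only [mul_assoc]))
  have h_bound : ∀ᵐ φ : (Fin 4 → ZMod n) → ℝ ∂volume, ∀ t ∈ (Set.univ : Set ℝ),
      ‖w g 0 φ * (Complex.exp ((t : ℂ) * -(Complex.I * ((g * Y u φ : ℝ) : ℂ)))
        * -(Complex.I * ((g * Y u φ : ℝ) : ℂ)))‖
        ≤ |g| * (6 * ‖u‖) * S 0 φ * Real.exp (-(S 0 φ)) :=
    Filter.Eventually.of_forall (fun φ t _ => by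
      rw [norm_mul, norm_mul, norm_w, norm_exp_phase, one_mul, norm_phase_coeff, abs_mul]
      have h1 := abs_Y_le u φ
      have h2 : 0 ≤ Real.exp (-(S 0 φ)) := (Real.exp_pos _).le
      have h3 : 0 ≤ |g| := abs_nonneg g
      calc Real.exp (-(S 0 φ)) * (|g| * |Y u φ|)
          ≤ Real.exp (-(S 0 φ)) * (|g| * (6 * ‖u‖ * S 0 φ)) := by gcongr
        _ = |g| * (6 * ‖u‖) * S 0 φ * Real.exp (-(S 0 φ)) := by ring)
  have h_diff : ∀ᵐ φ : (Fin 4 → ZMod n) → ℝ ∂volume, ∀ t ∈ (Set.univ : Set ℝ),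
      HasDerivAt (fun s : ℝ => w g 0 φ * Complex.exp ((s : ℂ) * -(Complex.I * ((g * Y u φ : ℝ) : ℂ))))
        (w g 0 φ * (Complex.exp ((t : ℂ) * -(Complex.I * ((g * Y u φ : ℝ) : ℂ)))
          * -(Complex.I * ((g * Y u φ : ℝ) : ℂ)))) t :=
    Filter.Eventually.of_forall (fun φ t _ => (hasDerivAt_exp_phase _ t).const_mul _)
  exact (hasDerivAt_integral_of_dominated_loc_of_deriv_le Filter.univ_mem
    (Filter.Eventually.of_forall hF_meas) hF_int hF'_meas h_bound hb_int h_diff).2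

/-- Twist integral, second derivative: the first derivative of `F` is again differentiable on `ℝ` under the
integral sign (domination by `36 g²‖u‖² S_0² e^{−S_0}`). [folklore] -/
private theorem hasDerivAt_twistIntegral_deriv (n : ℕ) [NeZero n] (g : ℝ) (u : Fin 4 → ℝ) (t₀ : ℝ) :
    HasDerivAt
      (fun t : ℝ => ∫ φ : (Fin 4 → ZMod n) → ℝ,
        w g 0 φ * (Complex.exp ((t : ℂ) * -(Complex.I * ((g * Y u φ : ℝ) : ℂ)))
          * -(Complex.I * ((g * Y u φ : ℝ) : ℂ))))
      (∫ φ : (Fin 4 → ZMod n) → ℝ,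
        w g 0 φ * (Complex.exp ((t₀ : ℂ) * -(Complex.I * ((g * Y u φ : ℝ) : ℂ)))
          * -(Complex.I * ((g * Y u φ : ℝ) : ℂ)) * -(Complex.I * ((g * Y u φ : ℝ) : ℂ)))) t₀ := by
  have hY : Continuous (fun φ : (Fin 4 → ZMod n) → ℝ => -(Complex.I * ((g * Y u φ : ℝ) : ℂ))) :=
    (continuous_const.mul (Complex.continuous_ofReal.comp
      (continuous_const.mul (continuous_Y u)))).neg
  have hph : ∀ t : ℝ, Continuous (fun φ : (Fin 4 → ZMod n) → ℝ =>
      Complex.exp ((t : ℂ) * -(Complex.I * ((g * Y u φ : ℝ) : ℂ)))) := fun t =>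
    Complex.continuous_exp.comp (continuous_const.mul hY)
  have hF_meas : ∀ t : ℝ, AEStronglyMeasurable (fun φ : (Fin 4 → ZMod n) → ℝ =>
      w g 0 φ * (Complex.exp ((t : ℂ) * -(Complex.I * ((g * Y u φ : ℝ) : ℂ)))
        * -(Complex.I * ((g * Y u φ : ℝ) : ℂ)))) volume := fun t =>
    ((continuous_w g 0).mul ((hph t).mul hY)).aestronglyMeasurable
  have hF_int : Integrable (fun φ : (Fin 4 → ZMod n) → ℝ =>
      w g 0 φ * (Complex.exp ((t₀ : ℂ) * -(Complex.I * ((g * Y u φ : ℝ) : ℂ)))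
        * -(Complex.I * ((g * Y u φ : ℝ) : ℂ)))) :=
    (hasDerivAt_integral_of_dominated_loc_of_deriv_le
      (bound := fun φ : (Fin 4 → ZMod n) → ℝ => |g| * (6 * ‖u‖) * S 0 φ * Real.exp (-(S 0 φ)))
      Filter.univ_mem
      (Filter.Eventually.of_forall (fun t => ((continuous_w g 0).mul (hph t)).aestronglyMeasurable))
      (integrable_w_mul_of_le n g _ (hph t₀) (fun _ => 1)
        (by simpa using integrable_exp_neg_S_zero n) (fun φ => by rw [norm_exp_phase]))
      (hF_meas t₀)
      (Filter.Eventually.of_forall (fun φ t (_ : t ∈ (Set.univ : Set ℝ)) => by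
        rw [norm_mul, norm_mul, norm_w, norm_exp_phase, one_mul, norm_phase_coeff, abs_mul]
        have h1 := abs_Y_le u φ
        have h2 : 0 ≤ Real.exp (-(S 0 φ)) := (Real.exp_pos _).le
        have h3 : 0 ≤ |g| := abs_nonneg g
        calc Real.exp (-(S 0 φ)) * (|g| * |Y u φ|)
            ≤ Real.exp (-(S 0 φ)) * (|g| * (6 * ‖u‖ * S 0 φ)) := by gcongr
          _ = |g| * (6 * ‖u‖) * S 0 φ * Real.exp (-(S 0 φ)) := by ring))
      (((integrable_S_mul_exp_neg_S n).const_mul (|g| * (6 * ‖u‖))).congr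
        (Filter.Eventually.of_forall (fun φ => by simp only [mul_assoc])))
      (Filter.Eventually.of_forall (fun φ t _ => (hasDerivAt_exp_phase _ t).const_mul _))).1
  have hF'_meas : AEStronglyMeasurable (fun φ : (Fin 4 → ZMod n) → ℝ =>
      w g 0 φ * (Complex.exp ((t₀ : ℂ) * -(Complex.I * ((g * Y u φ : ℝ) : ℂ)))
        * -(Complex.I * ((g * Y u φ : ℝ) : ℂ)) * -(Complex.I * ((g * Y u φ : ℝ) : ℂ)))) volume :=
    ((continuous_w g 0).mul (((hph t₀).mul hY).mul hY)).aestronglyMeasurable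
  have hb_int : Integrable (fun φ : (Fin 4 → ZMod n) → ℝ =>
      g ^ 2 * (6 * ‖u‖) ^ 2 * (S 0 φ) ^ 2 * Real.exp (-(S 0 φ))) :=
    ((integrable_S_sq_mul_exp_neg_S n).const_mul (g ^ 2 * (6 * ‖u‖) ^ 2)).congr
      (Filter.Eventually.of_forall (fun φ => by simp only [mul_assoc]))
  have h_bound : ∀ᵐ φ : (Fin 4 → ZMod n) → ℝ ∂volume, ∀ t ∈ (Set.univ : Set ℝ),
      ‖w g 0 φ * (Complex.exp ((t : ℂ) * -(Complex.I * ((g * Y u φ : ℝ) : ℂ)))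
        * -(Complex.I * ((g * Y u φ : ℝ) : ℂ)) * -(Complex.I * ((g * Y u φ : ℝ) : ℂ)))‖
        ≤ g ^ 2 * (6 * ‖u‖) ^ 2 * (S 0 φ) ^ 2 * Real.exp (-(S 0 φ)) :=
    Filter.Eventually.of_forall (fun φ t _ => by
      rw [norm_mul, norm_mul, norm_mul, norm_w, norm_exp_phase, one_mul, norm_phase_coeff, abs_mul]
      have h1 := abs_Y_le u φ
      have h0 : 0 ≤ |Y u φ| := abs_nonneg _
      have h2 : 0 ≤ Real.exp (-(S 0 φ)) := (Real.exp_pos _).le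
      have h4 : (|g| * |Y u φ|) * (|g| * |Y u φ|) ≤ g ^ 2 * (6 * ‖u‖) ^ 2 * (S 0 φ) ^ 2 := by
        have h5 : |Y u φ| * |Y u φ| ≤ (6 * ‖u‖ * S 0 φ) * (6 * ‖u‖ * S 0 φ) :=
          mul_le_mul h1 h1 h0 (le_trans h0 h1)
        have h6 : |g| * |g| = g ^ 2 := by rw [← sq, sq_abs]
        nlinarith [h5, h6, sq_nonneg g]
      calc Real.exp (-(S 0 φ)) * (|g| * |Y u φ| * (|g| * |Y u φ|))
          ≤ Real.exp (-(S 0 φ)) * (g ^ 2 * (6 * ‖u‖) ^ 2 * (S 0 φ) ^ 2) := by gcongr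
        _ = g ^ 2 * (6 * ‖u‖) ^ 2 * (S 0 φ) ^ 2 * Real.exp (-(S 0 φ)) := by ring)
  have h_diff : ∀ᵐ φ : (Fin 4 → ZMod n) → ℝ ∂volume, ∀ t ∈ (Set.univ : Set ℝ),
      HasDerivAt (fun s : ℝ => w g 0 φ * (Complex.exp ((s : ℂ) * -(Complex.I * ((g * Y u φ : ℝ) : ℂ)))
          * -(Complex.I * ((g * Y u φ : ℝ) : ℂ))))
        (w g 0 φ * (Complex.exp ((t : ℂ) * -(Complex.I * ((g * Y u φ : ℝ) : ℂ)))
          * -(Complex.I * ((g * Y u φ : ℝ) : ℂ)) * -(Complex.I * ((g * Y u φ : ℝ) : ℂ)))) t :=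
    Filter.Eventually.of_forall (fun φ t _ => ((hasDerivAt_exp_phase _ t).mul_const _).const_mul _)
  exact (hasDerivAt_integral_of_dominated_loc_of_deriv_le Filter.univ_mem
    (Filter.Eventually.of_forall hF_meas) hF_int hF'_meas h_bound hb_int h_diff).2

/-- The exact factorisation `Z_N(g,t·u) = exp(−|Λ|t²|u|²/2 − i g|Λ|t³u_τ|u_sp|²)·F(t)`.
[folklore] -/
private theorem Z_smul_factor (n : ℕ) [NeZero n] (g : ℝ) (u : Fin 4 → ℝ) (t : ℝ) :
    Z n g (t • u) =
      Complex.exp (-((((Fintype.card (Fin 4 → ZMod n) : ℝ)) * (t ^ 2 * ∑ i : Fin 4, (u i) ^ 2) / 2 : ℝ) : ℂ)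
          - Complex.I * ((g * ((Fintype.card (Fin 4 → ZMod n) : ℝ)
              * (t ^ 3 * (u 0 * ∑ j : Fin 3, (u j.succ) ^ 2))) : ℝ) : ℂ))
        * ∫ φ : (Fin 4 → ZMod n) → ℝ,
            w g 0 φ * Complex.exp ((t : ℂ) * -(Complex.I * ((g * Y u φ : ℝ) : ℂ))) := by
  have h1 : (∑ i : Fin 4, ((t • u) i) ^ 2) = t ^ 2 * ∑ i : Fin 4, (u i) ^ 2 := by
    simp only [Pi.smul_apply, smul_eq_mul, mul_pow, Finset.mul_sum]
  have h2 : (t • u) 0 * ∑ j : Fin 3, ((t • u) j.succ) ^ 2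
      = t ^ 3 * (u 0 * ∑ j : Fin 3, (u j.succ) ^ 2) := by
    simp only [Pi.smul_apply, smul_eq_mul, mul_pow, Finset.mul_sum]
    exact Finset.sum_congr rfl (fun j _ => by ring)
  unfold Z
  rw [← integral_const_mul]
  refine integral_congr_ae (Filter.Eventually.of_forall (fun φ => ?_))
  beta_reduce
  rw [w_tilt g (t • u) φ, h1, h2, Y_smul]
  unfold w
  rw [← Complex.exp_add, ← Complex.exp_add, ← Complex.exp_add]
  congr 1
  push_cast
  ring

/-- THE HESSIAN IDENTITY (branch-free): with `F` as above,
`Υ_N(g)[u,u] = |u|² − (F″(0)/F(0) − (F′(0)/F(0))²)/|Λ|` and `F(0) = Z_N(g,0)`. [folklore] -/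
private theorem upsilon_eq_twistHessian (n : ℕ) [NeZero n] (g : ℝ) (u : Fin 4 → ℝ) :
    (∫ φ : (Fin 4 → ZMod n) → ℝ,
        w g 0 φ * Complex.exp (((0 : ℝ) : ℂ) * -(Complex.I * ((g * Y u φ : ℝ) : ℂ)))) = Z n g 0 ∧
    Upsilon n g u =
      ((∑ i : Fin 4, (u i) ^ 2 : ℝ) : ℂ)
        - ((∫ φ : (Fin 4 → ZMod n) → ℝ,
              w g 0 φ * (Complex.exp (((0 : ℝ) : ℂ) * -(Complex.I * ((g * Y u φ : ℝ) : ℂ)))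
                * -(Complex.I * ((g * Y u φ : ℝ) : ℂ)) * -(Complex.I * ((g * Y u φ : ℝ) : ℂ))))
              / Z n g 0
            - ((∫ φ : (Fin 4 → ZMod n) → ℝ,
                w g 0 φ * (Complex.exp (((0 : ℝ) : ℂ) * -(Complex.I * ((g * Y u φ : ℝ) : ℂ)))
                  * -(Complex.I * ((g * Y u φ : ℝ) : ℂ)))) / Z n g 0) ^ 2)
          / (Fintype.card (Fin 4 → ZMod n) : ℂ) := by
  have e0 : (∫ φ : (Fin 4 → ZMod n) → ℝ,
      w g 0 φ * Complex.exp (((0 : ℝ) : ℂ) * -(Complex.I * ((g * Y u φ : ℝ) : ℂ)))) = Z n g 0 := by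
    unfold Z
    refine integral_congr_ae (Filter.Eventually.of_forall (fun φ => ?_))
    simp
  have e1 : (∫ φ : (Fin 4 → ZMod n) → ℝ,
      w g 0 φ * (Complex.exp (((0 : ℝ) : ℂ) * -(Complex.I * ((g * Y u φ : ℝ) : ℂ)))
        * -(Complex.I * ((g * Y u φ : ℝ) : ℂ))))
      = -(Complex.I * (g : ℂ)) * ∫ φ : (Fin 4 → ZMod n) → ℝ, ((Y u φ : ℝ) : ℂ) * w g 0 φ := by
    rw [← integral_const_mul]
    refine integral_congr_ae (Filter.Eventually.of_forall (fun φ => ?_))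
    simp only [Complex.ofReal_zero, zero_mul, Complex.exp_zero, one_mul]
    push_cast
    ring
  have e2 : (∫ φ : (Fin 4 → ZMod n) → ℝ,
      w g 0 φ * (Complex.exp (((0 : ℝ) : ℂ) * -(Complex.I * ((g * Y u φ : ℝ) : ℂ)))
        * -(Complex.I * ((g * Y u φ : ℝ) : ℂ)) * -(Complex.I * ((g * Y u φ : ℝ) : ℂ))))
      = (-(Complex.I * (g : ℂ))) ^ 2
          * ∫ φ : (Fin 4 → ZMod n) → ℝ, ((Y u φ ^ 2 : ℝ) : ℂ) * w g 0 φ := by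
    rw [← integral_const_mul]
    refine integral_congr_ae (Filter.Eventually.of_forall (fun φ => ?_))
    simp only [Complex.ofReal_zero, zero_mul, Complex.exp_zero, one_mul]
    push_cast
    ring
  refine ⟨e0, ?_⟩
  rw [e1, e2]
  unfold Upsilon ev
  set A := ∫ φ : (Fin 4 → ZMod n) → ℝ, ((Y u φ : ℝ) : ℂ) * w g 0 φ with hA
  set B := ∫ φ : (Fin 4 → ZMod n) → ℝ, ((Y u φ ^ 2 : ℝ) : ℂ) * w g 0 φ with hB
  set Zg := Z n g 0 with hZg
  set m := (Fintype.card (Fin 4 → ZMod n) : ℂ) with hm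
  linear_combination ((g : ℂ) ^ 2 * (B / Zg - A ^ 2 / Zg ^ 2) / m) * Complex.I_sq

/-- derivative of the explicit prefactor `E(t) = exp(a(t))`,
`a(t) = −m t² su/2 − i g m t³ sp` (`m = |Λ|`, `su = |u|²`, `sp = u_τ|u_sp|²`). [folklore] -/
private theorem hasDerivAt_prefactor (m su sp g t : ℝ) :
    HasDerivAt
      (fun s : ℝ => Complex.exp (-(((m * (s ^ 2 * su) / 2 : ℝ)) : ℂ)
        - Complex.I * ((g * (m * (s ^ 3 * sp)) : ℝ) : ℂ)))
      (Complex.exp (-(((m * (t ^ 2 * su) / 2 : ℝ)) : ℂ) - Complex.I * ((g * (m * (t ^ 3 * sp)) : ℝ) : ℂ))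
        * (-(((m * t * su : ℝ)) : ℂ) - Complex.I * ((g * (m * (3 * t ^ 2 * sp)) : ℝ) : ℂ))) t := by
  have hp : HasDerivAt (fun s : ℝ => m * (s ^ 2 * su) / 2) (m * t * su) t := by
    have h := (((hasDerivAt_pow 2 t).mul_const su).const_mul m).div_const 2
    simp only [Nat.cast_ofNat, Nat.reduceSub, pow_one] at h
    exact h.congr_deriv (by ring)
  have hq : HasDerivAt (fun s : ℝ => g * (m * (s ^ 3 * sp))) (g * (m * (3 * t ^ 2 * sp))) t := by
    have h := (((hasDerivAt_pow 3 t).mul_const sp).const_mul m).const_mul g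
    simp only [Nat.cast_ofNat, Nat.reduceSub] at h
    exact h.congr_deriv (by ring)
  exact (hp.ofReal_comp.neg.sub (hq.ofReal_comp.const_mul Complex.I)).cexp

/-- derivative of `a′(t) = −m t su − i g m 3t² sp`. [folklore] -/
private theorem hasDerivAt_prefactorDeriv (m su sp g t : ℝ) :
    HasDerivAt
      (fun s : ℝ => -(((m * s * su : ℝ)) : ℂ) - Complex.I * ((g * (m * (3 * s ^ 2 * sp)) : ℝ) : ℂ))
      (-(((m * su : ℝ)) : ℂ) - Complex.I * ((g * (m * (6 * t * sp)) : ℝ) : ℂ)) t := by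
  have hp : HasDerivAt (fun s : ℝ => m * s * su) (m * su) t := by
    have h := ((hasDerivAt_id t).const_mul m).mul_const su
    simpa using h
  have hq : HasDerivAt (fun s : ℝ => g * (m * (3 * s ^ 2 * sp))) (g * (m * (6 * t * sp))) t := by
    have h := ((((hasDerivAt_pow 2 t).const_mul 3).mul_const sp).const_mul m).const_mul g
    simp only [Nat.cast_ofNat, Nat.reduceSub, pow_one] at h
    exact h.congr_deriv (by ring)
  exact hp.ofReal_comp.neg.sub (hq.ofReal_comp.const_mul Complex.I)

/-- For `Z` itself, first derivative: `t ↦ Z_N(g,t·u)` is differentiable on `ℝ`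
(product rule on the factorisation `Z_smul_factor`). [folklore] -/
private theorem hasDerivAt_Z_smul (n : ℕ) [NeZero n] (g : ℝ) (u : Fin 4 → ℝ) (t : ℝ) :
    HasDerivAt (fun s : ℝ => Z n g (s • u))
      (Complex.exp (-((((Fintype.card (Fin 4 → ZMod n) : ℝ)) * (t ^ 2 * ∑ i : Fin 4, (u i) ^ 2) / 2 : ℝ) : ℂ)
          - Complex.I * ((g * ((Fintype.card (Fin 4 → ZMod n) : ℝ)
              * (t ^ 3 * (u 0 * ∑ j : Fin 3, (u j.succ) ^ 2))) : ℝ) : ℂ))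
        * (-((((Fintype.card (Fin 4 → ZMod n) : ℝ)) * t * ∑ i : Fin 4, (u i) ^ 2 : ℝ) : ℂ)
            - Complex.I * ((g * ((Fintype.card (Fin 4 → ZMod n) : ℝ)
                * (3 * t ^ 2 * (u 0 * ∑ j : Fin 3, (u j.succ) ^ 2))) : ℝ) : ℂ))
        * (∫ φ : (Fin 4 → ZMod n) → ℝ,
            w g 0 φ * Complex.exp ((t : ℂ) * -(Complex.I * ((g * Y u φ : ℝ) : ℂ))))
        + Complex.exp (-((((Fintype.card (Fin 4 → ZMod n) : ℝ)) * (t ^ 2 * ∑ i : Fin 4, (u i) ^ 2) / 2 : ℝ) : ℂ)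
            - Complex.I * ((g * ((Fintype.card (Fin 4 → ZMod n) : ℝ)
                * (t ^ 3 * (u 0 * ∑ j : Fin 3, (u j.succ) ^ 2))) : ℝ) : ℂ))
          * (∫ φ : (Fin 4 → ZMod n) → ℝ,
              w g 0 φ * (Complex.exp ((t : ℂ) * -(Complex.I * ((g * Y u φ : ℝ) : ℂ)))
                * -(Complex.I * ((g * Y u φ : ℝ) : ℂ))))) t := by
  have hfun : (fun s : ℝ => Z n g (s • u)) = fun s : ℝ =>
      Complex.exp (-((((Fintype.card (Fin 4 → ZMod n) : ℝ)) * (s ^ 2 * ∑ i : Fin 4, (u i) ^ 2) / 2 : ℝ) : ℂ)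
          - Complex.I * ((g * ((Fintype.card (Fin 4 → ZMod n) : ℝ)
              * (s ^ 3 * (u 0 * ∑ j : Fin 3, (u j.succ) ^ 2))) : ℝ) : ℂ))
        * ∫ φ : (Fin 4 → ZMod n) → ℝ,
            w g 0 φ * Complex.exp ((s : ℂ) * -(Complex.I * ((g * Y u φ : ℝ) : ℂ))) :=
    funext (fun s => Z_smul_factor n g u s)
  rw [hfun]
  exact (hasDerivAt_prefactor _ _ _ g t).mul (hasDerivAt_twistIntegral n g u t)

/-- **`Upsilon` is the Hessian of `−log Z` in the twist** (Fisher–Barber–Jasnow's definition, finite volume, branch-free): there are `Z′ : ℝ → ℂ` and `Z″(0)` with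
`t ↦ Z_N(g,t·u)` differentiable on `ℝ` with derivative `Z′`, `Z′` differentiable at `0` with
derivative `Z″(0)`, and `Υ_N(g)[u,u] = −(Z″(0)/Z − (Z′(0)/Z)²)/|Λ|`, i.e. `Υ = ∂²_t[−log Z_N(g,t·u)]₀/|Λ|`
for any local branch of `log` (requires only `Z_N(g,0) ≠ 0`, clause (a)).
[cite: FisherBarberJasnow1973, Sec. II, eqs. (2.4)–(2.5)] -/
theorem upsilon_eq_logZ_hessian (n : ℕ) [NeZero n] (g : ℝ) (u : Fin 4 → ℝ) (hZ : Z n g 0 ≠ 0) :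
    ∃ Zd : ℝ → ℂ, ∃ Z₂ : ℂ,
      (∀ t : ℝ, HasDerivAt (fun s : ℝ => Z n g (s • u)) (Zd t) t) ∧ HasDerivAt Zd Z₂ 0 ∧
      Upsilon n g u =
        -((Z₂ / Z n g 0 - (Zd 0 / Z n g 0) ^ 2) / (Fintype.card (Fin 4 → ZMod n) : ℂ)) := by
  obtain ⟨e0, hU⟩ := upsilon_eq_twistHessian n g u
  have hm : (Fintype.card (Fin 4 → ZMod n) : ℂ) ≠ 0 := Nat.cast_ne_zero.mpr Fintype.card_ne_zero
  have h2 := ((((hasDerivAt_prefactor (Fintype.card (Fin 4 → ZMod n) : ℝ) (∑ i : Fin 4, (u i) ^ 2)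
      (u 0 * ∑ j : Fin 3, (u j.succ) ^ 2) g 0).mul
      (hasDerivAt_prefactorDeriv (Fintype.card (Fin 4 → ZMod n) : ℝ) (∑ i : Fin 4, (u i) ^ 2)
      (u 0 * ∑ j : Fin 3, (u j.succ) ^ 2) g 0)).mul
      (hasDerivAt_twistIntegral n g u 0)).add
      ((hasDerivAt_prefactor (Fintype.card (Fin 4 → ZMod n) : ℝ) (∑ i : Fin 4, (u i) ^ 2)
      (u 0 * ∑ j : Fin 3, (u j.succ) ^ 2) g 0).mul (hasDerivAt_twistIntegral_deriv n g u 0)))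
  refine ⟨_, _, fun t => hasDerivAt_Z_smul n g u t, h2, ?_⟩
  rw [hU]
  simp only [Pi.mul_apply]
  set F1 := (∫ φ : (Fin 4 → ZMod n) → ℝ,
    w g 0 φ * (Complex.exp (((0 : ℝ) : ℂ) * -(Complex.I * ((g * Y u φ : ℝ) : ℂ)))
      * -(Complex.I * ((g * Y u φ : ℝ) : ℂ)))) with hF1
  set F2 := (∫ φ : (Fin 4 → ZMod n) → ℝ,
    w g 0 φ * (Complex.exp (((0 : ℝ) : ℂ) * -(Complex.I * ((g * Y u φ : ℝ) : ℂ)))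
      * -(Complex.I * ((g * Y u φ : ℝ) : ℂ)) * -(Complex.I * ((g * Y u φ : ℝ) : ℂ)))) with hF2
  rw [e0]
  simp only [Complex.ofReal_zero, zero_mul, Complex.exp_zero, one_mul, mul_zero, zero_pow,
    ne_eq, OfNat.ofNat_ne_zero, not_false_eq_true, zero_div, neg_zero, sub_zero, sub_self,
    zero_add]
  push_cast
  field_simp
  ring

/-! ## The variance in `Upsilon` is the `ε`-Hessian of the real exponential tilt
With `M(ε) := ∫ w_{g,0}(φ)·e^{εY_u(φ)} dφ`: `M` is twice differentiable near `ε = 0` under the integral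
sign (domination on `|ε| < 1/(12(‖u‖+1))` by `e^{−S_0/2}`, from `abs_Y_le`), `M(0) = Z_n(g,0)`, and
`⟨Y_u²⟩_g − ⟨Y_u⟩_g² = M″(0)/M(0) − (M′(0)/M(0))²` (branch-free); hence
`Υ_n(g)[u] = |u|² + g²·∂²_ε log M|₀/|Λ|` (`upsilon_eq_mgfHessian`).  The quantity bounded in
`CumulantBoundAt` is thus a second derivative of a perturbed free energy along a one-parameter family
of perturbations that stays inside the `ι`-symmetric class (`Y_u` is real and reflection-even) — the
form in which an `N`-uniform bound on `D²𝒲_N` (the reference's Theorem 2.2, `ℓ = 2`) delivers it. -/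

/-- `S_0·e^{−aS_0}` is integrable for `a > 0` (`x ≤ (2/a)e^{ax/2}`). [folklore] -/
private theorem integrable_S_mul_exp_neg_mul_S (n : ℕ) [NeZero n] (a : ℝ) (ha : 0 < a) :
    Integrable (fun φ : (Fin 4 → ZMod n) → ℝ => S 0 φ * Real.exp (-(a * S 0 φ))) := by
  refine ((integrable_exp_neg_mul_S_zero n (a / 2) (by positivity)).const_mul (2 / a)).mono'
    ((continuous_S 0).mul (continuous_const.mul (continuous_S 0)).neg.rexp).aestronglyMeasurable
    (Filter.Eventually.of_forall (fun φ => ?_))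
  have hS := S_zero_nonneg φ
  rw [Real.norm_eq_abs, abs_of_nonneg (mul_nonneg hS (Real.exp_pos _).le)]
  have h1 : a / 2 * S 0 φ ≤ Real.exp (a / 2 * S 0 φ) := by
    have := Real.add_one_le_exp (a / 2 * S 0 φ)
    linarith
  have h2 : S 0 φ ≤ 2 / a * Real.exp (a / 2 * S 0 φ) := by
    rw [div_mul_eq_mul_div, le_div_iff₀ ha]
    linarith
  calc S 0 φ * Real.exp (-(a * S 0 φ))
      ≤ 2 / a * Real.exp (a / 2 * S 0 φ) * Real.exp (-(a * S 0 φ)) := by gcongr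
    _ = 2 / a * Real.exp (-(a / 2 * S 0 φ)) := by
        rw [mul_assoc, ← Real.exp_add]
        congr 2
        ring

/-- `S_0²·e^{−aS_0}` is integrable for `a > 0` (`x² ≤ (16/a²)e^{ax/2}`). [folklore] -/
private theorem integrable_S_sq_mul_exp_neg_mul_S (n : ℕ) [NeZero n] (a : ℝ) (ha : 0 < a) :
    Integrable (fun φ : (Fin 4 → ZMod n) → ℝ => (S 0 φ) ^ 2 * Real.exp (-(a * S 0 φ))) := by
  refine ((integrable_exp_neg_mul_S_zero n (a / 2) (by positivity)).const_mul (16 / a ^ 2)).mono'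
    (((continuous_S 0).pow 2).mul (continuous_const.mul (continuous_S 0)).neg.rexp).aestronglyMeasurable
    (Filter.Eventually.of_forall (fun φ => ?_))
  have hS := S_zero_nonneg φ
  rw [Real.norm_eq_abs, abs_of_nonneg (mul_nonneg (sq_nonneg _) (Real.exp_pos _).le)]
  have h1 : a / 4 * S 0 φ ≤ Real.exp (a / 4 * S 0 φ) := by
    have := Real.add_one_le_exp (a / 4 * S 0 φ)
    linarith
  have h2 : (a / 4 * S 0 φ) ^ 2 ≤ Real.exp (a / 4 * S 0 φ) ^ 2 :=
    pow_le_pow_left₀ (by positivity) h1 2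
  have h3 : Real.exp (a / 4 * S 0 φ) ^ 2 = Real.exp (a / 2 * S 0 φ) := by
    rw [sq, ← Real.exp_add]
    congr 1
    ring
  have h4 : (S 0 φ) ^ 2 ≤ 16 / a ^ 2 * Real.exp (a / 2 * S 0 φ) := by
    rw [h3] at h2
    rw [div_mul_eq_mul_div, le_div_iff₀ (by positivity)]
    nlinarith [h2]
  calc (S 0 φ) ^ 2 * Real.exp (-(a * S 0 φ))
      ≤ 16 / a ^ 2 * Real.exp (a / 2 * S 0 φ) * Real.exp (-(a * S 0 φ)) := by gcongr
    _ = 16 / a ^ 2 * Real.exp (-(a / 2 * S 0 φ)) := by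
        rw [mul_assoc, ← Real.exp_add]
        congr 2
        ring

/-- norm of the real tilt: `‖exp(ε·Y)‖ = e^{εY}`. [folklore] -/
private theorem norm_exp_real_tilt (ε r : ℝ) :
    ‖Complex.exp ((ε : ℂ) * (r : ℂ))‖ = Real.exp (ε * r) := by
  rw [Complex.norm_exp]
  simp

/-- on `|ε| ≤ ε₀ = 1/(12(‖u‖+1))` the real tilt is dominated: `e^{εY_u} ≤ e^{S_0/2}`. [folklore] -/
private theorem exp_tilt_le [NeZero n] (u : Fin 4 → ℝ) (φ : (Fin 4 → ZMod n) → ℝ) (ε : ℝ)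
    (hε : |ε| ≤ 1 / (12 * (‖u‖ + 1))) :
    Real.exp (ε * Y u φ) ≤ Real.exp (1 / 2 * S 0 φ) := by
  apply Real.exp_le_exp.mpr
  have hS := S_zero_nonneg φ
  have hu0 : 0 ≤ ‖u‖ := norm_nonneg u
  have hY := abs_Y_le u φ
  have h1 : ε * Y u φ ≤ |ε| * |Y u φ| := by
    rw [← abs_mul]
    exact le_abs_self _
  have h2 : |ε| * |Y u φ| ≤ 1 / (12 * (‖u‖ + 1)) * (6 * ‖u‖ * S 0 φ) :=
    mul_le_mul hε hY (abs_nonneg _) (by positivity)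
  have h3 : 1 / (12 * (‖u‖ + 1)) * (6 * ‖u‖ * S 0 φ) ≤ 1 / 2 * S 0 φ := by
    rw [div_mul_eq_mul_div, one_mul, div_le_iff₀ (by positivity)]
    nlinarith [mul_nonneg hu0 hS]
  linarith

/-- Real tilt, first derivative: `M(ε) = ∫ w_{g,0}·e^{εY_u}` is differentiable on `|ε| < ε₀` under the
integral sign. [folklore] -/
private theorem hasDerivAt_mgfIntegral (n : ℕ) [NeZero n] (g : ℝ) (u : Fin 4 → ℝ) (ε : ℝ)
    (hε : |ε| < 1 / (12 * (‖u‖ + 1))) :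
    HasDerivAt
      (fun s : ℝ => ∫ φ : (Fin 4 → ZMod n) → ℝ,
        w g 0 φ * Complex.exp ((s : ℂ) * ((Y u φ : ℝ) : ℂ)))
      (∫ φ : (Fin 4 → ZMod n) → ℝ,
        w g 0 φ * (Complex.exp ((ε : ℂ) * ((Y u φ : ℝ) : ℂ)) * ((Y u φ : ℝ) : ℂ))) ε := by
  set ε₀ : ℝ := 1 / (12 * (‖u‖ + 1)) with hε₀
  have hε₀pos : 0 < ε₀ := by positivity
  have hball : Metric.ball (0 : ℝ) ε₀ ∈ nhds ε :=
    Metric.isOpen_ball.mem_nhds (by simpa [Metric.mem_ball, dist_zero_right] using hε)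
  have hmem : ∀ x ∈ Metric.ball (0 : ℝ) ε₀, |x| ≤ ε₀ := fun x hx => by
    have := Metric.mem_ball.mp hx
    rw [dist_zero_right, Real.norm_eq_abs] at this
    exact this.le
  have hY : Continuous (fun φ : (Fin 4 → ZMod n) → ℝ => ((Y u φ : ℝ) : ℂ)) :=
    Complex.continuous_ofReal.comp (continuous_Y u)
  have hph : ∀ t : ℝ, Continuous (fun φ : (Fin 4 → ZMod n) → ℝ =>
      Complex.exp ((t : ℂ) * ((Y u φ : ℝ) : ℂ))) := fun t =>
    Complex.continuous_exp.comp (continuous_const.mul hY)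
  have hF_meas : ∀ t : ℝ, AEStronglyMeasurable (fun φ : (Fin 4 → ZMod n) → ℝ =>
      w g 0 φ * Complex.exp ((t : ℂ) * ((Y u φ : ℝ) : ℂ))) volume := fun t =>
    ((continuous_w g 0).mul (hph t)).aestronglyMeasurable
  -- integrability of the tilted weight at ε
  have hdom0 : Integrable (fun φ : (Fin 4 → ZMod n) → ℝ =>
      Real.exp (1 / 2 * S 0 φ) * Real.exp (-(S 0 φ))) :=
    (integrable_exp_neg_mul_S_zero n (1 / 2) (by norm_num)).congr
      (Filter.Eventually.of_forall (fun φ => by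
        show Real.exp (-(1 / 2 * S 0 φ)) = Real.exp (1 / 2 * S 0 φ) * Real.exp (-(S 0 φ))
        rw [← Real.exp_add]; congr 1; ring))
  have hF_int : Integrable (fun φ : (Fin 4 → ZMod n) → ℝ =>
      w g 0 φ * Complex.exp ((ε : ℂ) * ((Y u φ : ℝ) : ℂ))) := by
    refine integrable_w_mul_of_le n g _ (hph ε) _ hdom0 (fun φ => ?_)
    rw [norm_exp_real_tilt]
    exact exp_tilt_le u φ ε hε.le
  have hF'_meas : AEStronglyMeasurable (fun φ : (Fin 4 → ZMod n) → ℝ =>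
      w g 0 φ * (Complex.exp ((ε : ℂ) * ((Y u φ : ℝ) : ℂ)) * ((Y u φ : ℝ) : ℂ))) volume :=
    ((continuous_w g 0).mul ((hph ε).mul hY)).aestronglyMeasurable
  have hb_int : Integrable (fun φ : (Fin 4 → ZMod n) → ℝ =>
      (6 * ‖u‖ * S 0 φ * Real.exp (1 / 2 * S 0 φ)) * Real.exp (-(S 0 φ))) :=
    ((integrable_S_mul_exp_neg_mul_S n (1 / 2) (by norm_num)).const_mul (6 * ‖u‖)).congr
      (Filter.Eventually.of_forall (fun φ => by
        show 6 * ‖u‖ * (S 0 φ * Real.exp (-(1 / 2 * S 0 φ)))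
          = 6 * ‖u‖ * S 0 φ * Real.exp (1 / 2 * S 0 φ) * Real.exp (-(S 0 φ))
        have hexp : Real.exp (-(1 / 2 * S 0 φ)) = Real.exp (1 / 2 * S 0 φ) * Real.exp (-(S 0 φ)) := by
          rw [← Real.exp_add]; congr 1; ring
        rw [hexp]; ring))
  have h_bound : ∀ᵐ φ : (Fin 4 → ZMod n) → ℝ ∂volume, ∀ x ∈ Metric.ball (0 : ℝ) ε₀,
      ‖w g 0 φ * (Complex.exp ((x : ℂ) * ((Y u φ : ℝ) : ℂ)) * ((Y u φ : ℝ) : ℂ))‖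
        ≤ (6 * ‖u‖ * S 0 φ * Real.exp (1 / 2 * S 0 φ)) * Real.exp (-(S 0 φ)) :=
    Filter.Eventually.of_forall (fun φ x hx => by
      rw [norm_mul, norm_mul, norm_w, norm_exp_real_tilt, Complex.norm_real, Real.norm_eq_abs]
      have h1 := abs_Y_le u φ
      have h2 := exp_tilt_le u φ x (hmem x hx)
      have h3 : 0 ≤ Real.exp (-(S 0 φ)) := (Real.exp_pos _).le
      have h4 : 0 ≤ Real.exp (x * Y u φ) := (Real.exp_pos _).le
      calc Real.exp (-(S 0 φ)) * (Real.exp (x * Y u φ) * |Y u φ|)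
          ≤ Real.exp (-(S 0 φ)) * (Real.exp (1 / 2 * S 0 φ) * (6 * ‖u‖ * S 0 φ)) := by gcongr
        _ = (6 * ‖u‖ * S 0 φ * Real.exp (1 / 2 * S 0 φ)) * Real.exp (-(S 0 φ)) := by ring)
  have h_diff : ∀ᵐ φ : (Fin 4 → ZMod n) → ℝ ∂volume, ∀ x ∈ Metric.ball (0 : ℝ) ε₀,
      HasDerivAt (fun s : ℝ => w g 0 φ * Complex.exp ((s : ℂ) * ((Y u φ : ℝ) : ℂ)))
        (w g 0 φ * (Complex.exp ((x : ℂ) * ((Y u φ : ℝ) : ℂ)) * ((Y u φ : ℝ) : ℂ))) x :=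
    Filter.Eventually.of_forall (fun φ x _ => (hasDerivAt_exp_phase _ x).const_mul _)
  exact (hasDerivAt_integral_of_dominated_loc_of_deriv_le hball
    (Filter.Eventually.of_forall hF_meas) hF_int hF'_meas h_bound hb_int h_diff).2

/-- Real tilt, second derivative: `M′` is differentiable on `|ε| < ε₀` under the integral sign.
[folklore] -/
private theorem hasDerivAt_mgfIntegral_deriv (n : ℕ) [NeZero n] (g : ℝ) (u : Fin 4 → ℝ) (ε : ℝ)
    (hε : |ε| < 1 / (12 * (‖u‖ + 1))) :
    HasDerivAt
      (fun s : ℝ => ∫ φ : (Fin 4 → ZMod n) → ℝ,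
        w g 0 φ * (Complex.exp ((s : ℂ) * ((Y u φ : ℝ) : ℂ)) * ((Y u φ : ℝ) : ℂ)))
      (∫ φ : (Fin 4 → ZMod n) → ℝ,
        w g 0 φ * (Complex.exp ((ε : ℂ) * ((Y u φ : ℝ) : ℂ)) * ((Y u φ : ℝ) : ℂ)
          * ((Y u φ : ℝ) : ℂ))) ε := by
  set ε₀ : ℝ := 1 / (12 * (‖u‖ + 1)) with hε₀
  have hε₀pos : 0 < ε₀ := by positivity
  have hball : Metric.ball (0 : ℝ) ε₀ ∈ nhds ε :=
    Metric.isOpen_ball.mem_nhds (by simpa [Metric.mem_ball, dist_zero_right] using hε)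
  have hmem : ∀ x ∈ Metric.ball (0 : ℝ) ε₀, |x| ≤ ε₀ := fun x hx => by
    have := Metric.mem_ball.mp hx
    rw [dist_zero_right, Real.norm_eq_abs] at this
    exact this.le
  have hY : Continuous (fun φ : (Fin 4 → ZMod n) → ℝ => ((Y u φ : ℝ) : ℂ)) :=
    Complex.continuous_ofReal.comp (continuous_Y u)
  have hph : ∀ t : ℝ, Continuous (fun φ : (Fin 4 → ZMod n) → ℝ =>
      Complex.exp ((t : ℂ) * ((Y u φ : ℝ) : ℂ))) := fun t =>
    Complex.continuous_exp.comp (continuous_const.mul hY)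
  have hF_meas : ∀ t : ℝ, AEStronglyMeasurable (fun φ : (Fin 4 → ZMod n) → ℝ =>
      w g 0 φ * (Complex.exp ((t : ℂ) * ((Y u φ : ℝ) : ℂ)) * ((Y u φ : ℝ) : ℂ))) volume := fun t =>
    ((continuous_w g 0).mul ((hph t).mul hY)).aestronglyMeasurable
  have hb1 : Integrable (fun φ : (Fin 4 → ZMod n) → ℝ =>
      (6 * ‖u‖ * S 0 φ * Real.exp (1 / 2 * S 0 φ)) * Real.exp (-(S 0 φ))) :=
    ((integrable_S_mul_exp_neg_mul_S n (1 / 2) (by norm_num)).const_mul (6 * ‖u‖)).congr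
      (Filter.Eventually.of_forall (fun φ => by
        show 6 * ‖u‖ * (S 0 φ * Real.exp (-(1 / 2 * S 0 φ)))
          = 6 * ‖u‖ * S 0 φ * Real.exp (1 / 2 * S 0 φ) * Real.exp (-(S 0 φ))
        have hexp : Real.exp (-(1 / 2 * S 0 φ)) = Real.exp (1 / 2 * S 0 φ) * Real.exp (-(S 0 φ)) := by
          rw [← Real.exp_add]; congr 1; ring
        rw [hexp]; ring))
  have hF_int : Integrable (fun φ : (Fin 4 → ZMod n) → ℝ =>
      w g 0 φ * (Complex.exp ((ε : ℂ) * ((Y u φ : ℝ) : ℂ)) * ((Y u φ : ℝ) : ℂ))) := by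
    refine integrable_w_mul_of_le n g _ ((hph ε).mul hY) _ hb1 (fun φ => ?_)
    rw [norm_mul, norm_exp_real_tilt, Complex.norm_real, Real.norm_eq_abs]
    have h1 := abs_Y_le u φ
    have h2 := exp_tilt_le u φ ε hε.le
    have h4 : 0 ≤ Real.exp (ε * Y u φ) := (Real.exp_pos _).le
    calc Real.exp (ε * Y u φ) * |Y u φ|
        ≤ Real.exp (1 / 2 * S 0 φ) * (6 * ‖u‖ * S 0 φ) := by gcongr
      _ = 6 * ‖u‖ * S 0 φ * Real.exp (1 / 2 * S 0 φ) := by ring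
  have hF'_meas : AEStronglyMeasurable (fun φ : (Fin 4 → ZMod n) → ℝ =>
      w g 0 φ * (Complex.exp ((ε : ℂ) * ((Y u φ : ℝ) : ℂ)) * ((Y u φ : ℝ) : ℂ)
        * ((Y u φ : ℝ) : ℂ))) volume :=
    ((continuous_w g 0).mul (((hph ε).mul hY).mul hY)).aestronglyMeasurable
  have hb_int : Integrable (fun φ : (Fin 4 → ZMod n) → ℝ =>
      ((6 * ‖u‖) ^ 2 * (S 0 φ) ^ 2 * Real.exp (1 / 2 * S 0 φ)) * Real.exp (-(S 0 φ))) :=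
    ((integrable_S_sq_mul_exp_neg_mul_S n (1 / 2) (by norm_num)).const_mul ((6 * ‖u‖) ^ 2)).congr
      (Filter.Eventually.of_forall (fun φ => by
        show (6 * ‖u‖) ^ 2 * ((S 0 φ) ^ 2 * Real.exp (-(1 / 2 * S 0 φ)))
          = (6 * ‖u‖) ^ 2 * (S 0 φ) ^ 2 * Real.exp (1 / 2 * S 0 φ) * Real.exp (-(S 0 φ))
        have hexp : Real.exp (-(1 / 2 * S 0 φ)) = Real.exp (1 / 2 * S 0 φ) * Real.exp (-(S 0 φ)) := by
          rw [← Real.exp_add]; congr 1; ring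
        rw [hexp]; ring))
  have h_bound : ∀ᵐ φ : (Fin 4 → ZMod n) → ℝ ∂volume, ∀ x ∈ Metric.ball (0 : ℝ) ε₀,
      ‖w g 0 φ * (Complex.exp ((x : ℂ) * ((Y u φ : ℝ) : ℂ)) * ((Y u φ : ℝ) : ℂ)
        * ((Y u φ : ℝ) : ℂ))‖
        ≤ ((6 * ‖u‖) ^ 2 * (S 0 φ) ^ 2 * Real.exp (1 / 2 * S 0 φ)) * Real.exp (-(S 0 φ)) :=
    Filter.Eventually.of_forall (fun φ x hx => by
      rw [norm_mul, norm_mul, norm_mul, norm_w, norm_exp_real_tilt, Complex.norm_real,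
        Real.norm_eq_abs]
      have h1 := abs_Y_le u φ
      have h0 : 0 ≤ |Y u φ| := abs_nonneg _
      have h2 := exp_tilt_le u φ x (hmem x hx)
      have h3 : 0 ≤ Real.exp (-(S 0 φ)) := (Real.exp_pos _).le
      have h4 : 0 ≤ Real.exp (x * Y u φ) := (Real.exp_pos _).le
      have h5 : |Y u φ| * |Y u φ| ≤ (6 * ‖u‖ * S 0 φ) * (6 * ‖u‖ * S 0 φ) :=
        mul_le_mul h1 h1 h0 (le_trans h0 h1)
      calc Real.exp (-(S 0 φ)) * (Real.exp (x * Y u φ) * |Y u φ| * |Y u φ|)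
          = Real.exp (-(S 0 φ)) * (Real.exp (x * Y u φ) * (|Y u φ| * |Y u φ|)) := by ring
        _ ≤ Real.exp (-(S 0 φ)) * (Real.exp (1 / 2 * S 0 φ) * ((6 * ‖u‖ * S 0 φ) * (6 * ‖u‖ * S 0 φ))) := by
            gcongr
        _ = ((6 * ‖u‖) ^ 2 * (S 0 φ) ^ 2 * Real.exp (1 / 2 * S 0 φ)) * Real.exp (-(S 0 φ)) := by
            ring)
  have h_diff : ∀ᵐ φ : (Fin 4 → ZMod n) → ℝ ∂volume, ∀ x ∈ Metric.ball (0 : ℝ) ε₀,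
      HasDerivAt (fun s : ℝ => w g 0 φ * (Complex.exp ((s : ℂ) * ((Y u φ : ℝ) : ℂ)) * ((Y u φ : ℝ) : ℂ)))
        (w g 0 φ * (Complex.exp ((x : ℂ) * ((Y u φ : ℝ) : ℂ)) * ((Y u φ : ℝ) : ℂ)
          * ((Y u φ : ℝ) : ℂ))) x :=
    Filter.Eventually.of_forall (fun φ x _ => ((hasDerivAt_exp_phase _ x).mul_const _).const_mul _)
  exact (hasDerivAt_integral_of_dominated_loc_of_deriv_le hball
    (Filter.Eventually.of_forall hF_meas) hF_int hF'_meas h_bound hb_int h_diff).2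

/-- **The cumulant identity** (branch-free): `M(0) = Z_N(g,0)` and
`⟨Y_u²⟩_g − ⟨Y_u⟩_g² = M″(0)/M(0) − (M′(0)/M(0))²`, hence
`Υ_N(g)[u,u] = |u|² + g²·(M″(0)/M(0) − (M′(0)/M(0))²)/|Λ|`.
[cite: AdamsBuchholzKoteckyMuller2019, Thm 2.2] -/
theorem upsilon_eq_mgfHessian (n : ℕ) [NeZero n] (g : ℝ) (u : Fin 4 → ℝ) :
    (∫ φ : (Fin 4 → ZMod n) → ℝ,
        w g 0 φ * Complex.exp (((0 : ℝ) : ℂ) * ((Y u φ : ℝ) : ℂ))) = Z n g 0 ∧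
    ev n g (fun φ => ((Y u φ ^ 2 : ℝ) : ℂ)) - (ev n g (fun φ => ((Y u φ : ℝ) : ℂ))) ^ 2
      = (∫ φ : (Fin 4 → ZMod n) → ℝ,
            w g 0 φ * (Complex.exp (((0 : ℝ) : ℂ) * ((Y u φ : ℝ) : ℂ)) * ((Y u φ : ℝ) : ℂ)
              * ((Y u φ : ℝ) : ℂ))) / Z n g 0
        - ((∫ φ : (Fin 4 → ZMod n) → ℝ,
            w g 0 φ * (Complex.exp (((0 : ℝ) : ℂ) * ((Y u φ : ℝ) : ℂ)) * ((Y u φ : ℝ) : ℂ)))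
              / Z n g 0) ^ 2 ∧
    Upsilon n g u =
      ((∑ i : Fin 4, (u i) ^ 2 : ℝ) : ℂ)
        + (g : ℂ) ^ 2 * ((∫ φ : (Fin 4 → ZMod n) → ℝ,
            w g 0 φ * (Complex.exp (((0 : ℝ) : ℂ) * ((Y u φ : ℝ) : ℂ)) * ((Y u φ : ℝ) : ℂ)
              * ((Y u φ : ℝ) : ℂ))) / Z n g 0
          - ((∫ φ : (Fin 4 → ZMod n) → ℝ,
            w g 0 φ * (Complex.exp (((0 : ℝ) : ℂ) * ((Y u φ : ℝ) : ℂ)) * ((Y u φ : ℝ) : ℂ)))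
              / Z n g 0) ^ 2) / (Fintype.card (Fin 4 → ZMod n) : ℂ) := by
  have e0 : (∫ φ : (Fin 4 → ZMod n) → ℝ,
      w g 0 φ * Complex.exp (((0 : ℝ) : ℂ) * ((Y u φ : ℝ) : ℂ))) = Z n g 0 := by
    unfold Z
    refine integral_congr_ae (Filter.Eventually.of_forall (fun φ => ?_))
    simp
  have e1 : (∫ φ : (Fin 4 → ZMod n) → ℝ,
      w g 0 φ * (Complex.exp (((0 : ℝ) : ℂ) * ((Y u φ : ℝ) : ℂ)) * ((Y u φ : ℝ) : ℂ)))
      = ∫ φ : (Fin 4 → ZMod n) → ℝ, ((Y u φ : ℝ) : ℂ) * w g 0 φ := by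
    refine integral_congr_ae (Filter.Eventually.of_forall (fun φ => ?_))
    simp only [Complex.ofReal_zero, zero_mul, Complex.exp_zero, one_mul]
    ring
  have e2 : (∫ φ : (Fin 4 → ZMod n) → ℝ,
      w g 0 φ * (Complex.exp (((0 : ℝ) : ℂ) * ((Y u φ : ℝ) : ℂ)) * ((Y u φ : ℝ) : ℂ)
        * ((Y u φ : ℝ) : ℂ)))
      = ∫ φ : (Fin 4 → ZMod n) → ℝ, ((Y u φ ^ 2 : ℝ) : ℂ) * w g 0 φ := by
    refine integral_congr_ae (Filter.Eventually.of_forall (fun φ => ?_))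
    simp only [Complex.ofReal_zero, zero_mul, Complex.exp_zero, one_mul]
    push_cast
    ring
  refine ⟨e0, ?_, ?_⟩
  · rw [e1, e2]
    unfold ev
    rfl
  · rw [e1, e2]
    unfold Upsilon ev
    rfl


/-- the `CumulantBoundAt` integrands are genuinely integrable (no `integral_undef` junk):
`Y_u·w_{g,0}` … [folklore] -/
private theorem integrable_Y_mul_w (n : ℕ) [NeZero n] (g : ℝ) (u : Fin 4 → ℝ) :
    Integrable (fun φ : (Fin 4 → ZMod n) → ℝ => ((Y u φ : ℝ) : ℂ) * w g 0 φ) := by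
  have h := integrable_w_mul_of_le n g (fun φ => ((Y u φ : ℝ) : ℂ))
    (Complex.continuous_ofReal.comp (continuous_Y u)) (fun φ => 6 * ‖u‖ * S 0 φ)
    (((integrable_S_mul_exp_neg_S n).const_mul (6 * ‖u‖)).congr
      (Filter.Eventually.of_forall (fun φ => by
        show 6 * ‖u‖ * (S 0 φ * Real.exp (-(S 0 φ))) = 6 * ‖u‖ * S 0 φ * Real.exp (-(S 0 φ))
        ring)))
    (fun φ => by rw [Complex.norm_real, Real.norm_eq_abs]; exact abs_Y_le u φ)
  exact h.congr (Filter.Eventually.of_forall (fun φ => mul_comm _ _))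

/-- … and `Y_u²·w_{g,0}`. [folklore] -/
private theorem integrable_Y_sq_mul_w (n : ℕ) [NeZero n] (g : ℝ) (u : Fin 4 → ℝ) :
    Integrable (fun φ : (Fin 4 → ZMod n) → ℝ => ((Y u φ ^ 2 : ℝ) : ℂ) * w g 0 φ) := by
  have h := integrable_w_mul_of_le n g (fun φ => ((Y u φ ^ 2 : ℝ) : ℂ))
    (Complex.continuous_ofReal.comp ((continuous_Y u).pow 2)) (fun φ => (6 * ‖u‖) ^ 2 * (S 0 φ) ^ 2)
    (((integrable_S_sq_mul_exp_neg_S n).const_mul ((6 * ‖u‖) ^ 2)).congr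
      (Filter.Eventually.of_forall (fun φ => by
        show (6 * ‖u‖) ^ 2 * ((S 0 φ) ^ 2 * Real.exp (-(S 0 φ)))
          = (6 * ‖u‖) ^ 2 * (S 0 φ) ^ 2 * Real.exp (-(S 0 φ))
        ring)))
    (fun φ => by
      rw [Complex.norm_real, Real.norm_eq_abs, abs_of_nonneg (sq_nonneg _), ← mul_pow, ← sq_abs]
      exact pow_le_pow_left₀ (abs_nonneg _) (abs_Y_le u φ) 2)
  exact h.congr (Filter.Eventually.of_forall (fun φ => mul_comm _ _))

/-! ## Fixed volume: hypotheses (A) and the stiffness clauses hold torus by torus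
With `∃ g₀ C` placed AFTER `∀ n` (constants depending on the torus) both hypotheses are theorems, from
the explicit Lipschitz bound `‖w_{g,0} − w_{0,0}‖ ≤ |g|·|X_0|·e^{−S_0}`, `|X_0| ≤ S_0 + 2S_0²`, and
`|Z_n(g,0)| ≥ Z_n(0,0)/2` for `g·∫|X_0|e^{−S_0} ≤ Z_n(0,0)/2`; so are clauses (a)–(c)
(`stiffness_fixedVolume`).  The entire content of `CumulantBoundAt` / `LocalTwoPointAt` beyond this
file is therefore the UNIFORMITY of `(g₀, C)` along the tower `n = L^N` — a renormalisation-group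
statement. -/

/-- `|X_0| ≤ S_0 + 2S_0²`. [folklore] -/
private theorem abs_X_zero_le [NeZero n] (φ : (Fin 4 → ZMod n) → ℝ) :
    |X 0 φ| ≤ S 0 φ + 2 * (S 0 φ) ^ 2 := by
  have hX : X 0 φ = ∑ s : Fin 4 → ZMod n, D φ 0 s * ∑ j : Fin 3, (D φ j.succ s) ^ 2 := by
    simp only [X, Pi.zero_apply, add_zero]
  have hA0 : ∀ s : Fin 4 → ZMod n, 0 ≤ ∑ j : Fin 3, (D φ j.succ s) ^ 2 :=
    fun s => Finset.sum_nonneg (fun j _ => sq_nonneg _)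
  have hsplit : ∀ s : Fin 4 → ZMod n,
      (D φ 0 s) ^ 2 + ∑ j : Fin 3, (D φ j.succ s) ^ 2 = ∑ i : Fin 4, (D φ i s) ^ 2 := fun s => by
    rw [Fin.sum_univ_succ (f := fun i : Fin 4 => (D φ i s) ^ 2)]
  have htot := sum_sq_D_le_two_S φ
  have hAsum : ∑ s : Fin 4 → ZMod n, ∑ j : Fin 3, (D φ j.succ s) ^ 2 ≤ 2 * S 0 φ :=
    le_trans (Finset.sum_le_sum (fun s _ => by
      rw [← hsplit s]; nlinarith [sq_nonneg (D φ 0 s)])) htot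
  have hdsum : ∑ s : Fin 4 → ZMod n, (D φ 0 s) ^ 2 ≤ 2 * S 0 φ :=
    le_trans (Finset.sum_le_sum (fun s _ => by rw [← hsplit s]; linarith [hA0 s])) htot
  have h1 : ∀ s : Fin 4 → ZMod n, |D φ 0 s * ∑ j : Fin 3, (D φ j.succ s) ^ 2|
      ≤ (∑ j : Fin 3, (D φ j.succ s) ^ 2 + (D φ 0 s) ^ 2 * ∑ j : Fin 3, (D φ j.succ s) ^ 2) / 2 :=
    fun s => by
      rw [abs_mul, abs_of_nonneg (hA0 s)]
      have hA := hA0 s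
      nlinarith [mul_nonneg hA (sq_nonneg (|D φ 0 s| - 1)), sq_abs (D φ 0 s), abs_nonneg (D φ 0 s)]
  have h2 : ∑ s : Fin 4 → ZMod n, (D φ 0 s) ^ 2 * ∑ j : Fin 3, (D φ j.succ s) ^ 2
      ≤ (∑ s : Fin 4 → ZMod n, (D φ 0 s) ^ 2)
          * ∑ s : Fin 4 → ZMod n, ∑ j : Fin 3, (D φ j.succ s) ^ 2 := by
    rw [Finset.sum_mul]
    exact Finset.sum_le_sum (fun s _ => mul_le_mul_of_nonneg_left
      (Finset.single_le_sum (f := fun t : Fin 4 → ZMod n => ∑ j : Fin 3, (D φ j.succ t) ^ 2)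
        (fun t _ => hA0 t) (Finset.mem_univ s)) (sq_nonneg _))
  have hS := S_zero_nonneg φ
  have hprod : ∑ s : Fin 4 → ZMod n, (D φ 0 s) ^ 2 * ∑ j : Fin 3, (D φ j.succ s) ^ 2
      ≤ (2 * S 0 φ) * (2 * S 0 φ) :=
    le_trans h2 (mul_le_mul hdsum hAsum (Finset.sum_nonneg (fun s _ => hA0 s)) (by positivity))
  calc |X 0 φ| = |∑ s : Fin 4 → ZMod n, D φ 0 s * ∑ j : Fin 3, (D φ j.succ s) ^ 2| := by rw [hX]
    _ ≤ ∑ s : Fin 4 → ZMod n, |D φ 0 s * ∑ j : Fin 3, (D φ j.succ s) ^ 2| :=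
        Finset.abs_sum_le_sum_abs _ _
    _ ≤ ∑ s : Fin 4 → ZMod n,
          (∑ j : Fin 3, (D φ j.succ s) ^ 2 + (D φ 0 s) ^ 2 * ∑ j : Fin 3, (D φ j.succ s) ^ 2) / 2 :=
        Finset.sum_le_sum (fun s _ => h1 s)
    _ = (∑ s : Fin 4 → ZMod n, ∑ j : Fin 3, (D φ j.succ s) ^ 2) / 2
          + (∑ s : Fin 4 → ZMod n, (D φ 0 s) ^ 2 * ∑ j : Fin 3, (D φ j.succ s) ^ 2) / 2 := by
        rw [← Finset.sum_div, Finset.sum_add_distrib, add_div]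
    _ ≤ (2 * S 0 φ) / 2 + ((2 * S 0 φ) * (2 * S 0 φ)) / 2 := by linarith [hAsum, hprod]
    _ = S 0 φ + 2 * (S 0 φ) ^ 2 := by ring

/-- `|X_0|·e^{−S_0}` is integrable. [folklore] -/
private theorem integrable_abs_X_mul_exp_neg_S (n : ℕ) [NeZero n] :
    Integrable (fun φ : (Fin 4 → ZMod n) → ℝ => |X 0 φ| * Real.exp (-(S 0 φ))) := by
  refine ((integrable_S_mul_exp_neg_S n).add ((integrable_S_sq_mul_exp_neg_S n).const_mul 2)).mono'
    (((continuous_X 0).abs).mul (continuous_S 0).neg.rexp).aestronglyMeasurable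
    (Filter.Eventually.of_forall (fun φ => ?_))
  rw [Real.norm_eq_abs, abs_of_nonneg (mul_nonneg (abs_nonneg _) (Real.exp_pos _).le)]
  have h := abs_X_zero_le φ
  have he : 0 ≤ Real.exp (-(S 0 φ)) := (Real.exp_pos _).le
  show |X 0 φ| * Real.exp (-(S 0 φ))
    ≤ S 0 φ * Real.exp (-(S 0 φ)) + 2 * ((S 0 φ) ^ 2 * Real.exp (-(S 0 φ)))
  calc |X 0 φ| * Real.exp (-(S 0 φ)) ≤ (S 0 φ + 2 * (S 0 φ) ^ 2) * Real.exp (-(S 0 φ)) := by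
        gcongr
    _ = S 0 φ * Real.exp (-(S 0 φ)) + 2 * ((S 0 φ) ^ 2 * Real.exp (-(S 0 φ))) := by ring

/-- the fixed-volume Lipschitz bound `‖w_{g,0}(φ) − w_{0,0}(φ)‖ ≤ |g|·|X_0(φ)|·e^{−S_0(φ)}`
(`|e^{−iθ} − 1| ≤ |θ|`). [folklore] -/
private theorem norm_w_sub_w_zero_le [NeZero n] (g : ℝ) (φ : (Fin 4 → ZMod n) → ℝ) :
    ‖w g 0 φ - w 0 0 φ‖ ≤ |g| * |X 0 φ| * Real.exp (-(S 0 φ)) := by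
  have h : w g 0 φ - w 0 0 φ = Complex.exp (-((S 0 φ : ℝ) : ℂ)) *
      (Complex.exp (Complex.I * ((-(g * X 0 φ) : ℝ) : ℂ)) - 1) := by
    unfold w
    rw [mul_sub, mul_one, ← Complex.exp_add]
    congr 1
    · congr 1
      push_cast
      ring
    · congr 1
      push_cast
      ring
  have e1 : ‖Complex.exp (-((S 0 φ : ℝ) : ℂ))‖ = Real.exp (-(S 0 φ)) := by
    rw [Complex.norm_exp]
    simp
  have hb := Real.norm_exp_I_mul_ofReal_sub_one_le (x := -(g * X 0 φ))
  rw [Real.norm_eq_abs, abs_neg, abs_mul] at hb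
  rw [h, norm_mul, e1]
  calc Real.exp (-(S 0 φ)) * ‖Complex.exp (Complex.I * ((-(g * X 0 φ) : ℝ) : ℂ)) - 1‖
      ≤ Real.exp (-(S 0 φ)) * (|g| * |X 0 φ|) := mul_le_mul_of_nonneg_left hb (Real.exp_pos _).le
    _ = |g| * |X 0 φ| * Real.exp (-(S 0 φ)) := by ring

/-- generic numerator bound: `‖∫ F·w_{g,0}‖ ≤ ∫ b·e^{−S_0}` whenever `‖F‖ ≤ b` pointwise.
[folklore] -/
private theorem norm_integral_mul_w_le (n : ℕ) [NeZero n] (g : ℝ) (F : ((Fin 4 → ZMod n) → ℝ) → ℂ)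
    (b : ((Fin 4 → ZMod n) → ℝ) → ℝ)
    (hb : Integrable (fun φ : (Fin 4 → ZMod n) → ℝ => b φ * Real.exp (-(S 0 φ))))
    (hFb : ∀ φ, ‖F φ‖ ≤ b φ) :
    ‖∫ φ : (Fin 4 → ZMod n) → ℝ, F φ * w g 0 φ‖
      ≤ ∫ φ : (Fin 4 → ZMod n) → ℝ, b φ * Real.exp (-(S 0 φ)) :=
  norm_integral_le_of_norm_le hb (Filter.Eventually.of_forall (fun φ => by
    rw [norm_mul, norm_w]
    exact mul_le_mul_of_nonneg_right (hFb φ) (Real.exp_pos _).le))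

/-- fixed-volume continuity of numerators in `g`:
`‖∫ F·w_{g,0} − ∫ F·w_{0,0}‖ ≤ M·|g|·∫|X_0|e^{−S_0}` for continuous `‖F‖ ≤ M`. [folklore] -/
private theorem norm_integral_mul_w_sub_le (n : ℕ) [NeZero n] (g : ℝ) (F : ((Fin 4 → ZMod n) → ℝ) → ℂ)
    (hF : Continuous F) (M : ℝ) (hM0 : 0 ≤ M) (hM : ∀ φ, ‖F φ‖ ≤ M) :
    ‖(∫ φ : (Fin 4 → ZMod n) → ℝ, F φ * w g 0 φ) - ∫ φ : (Fin 4 → ZMod n) → ℝ, F φ * w 0 0 φ‖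
      ≤ M * |g| * ∫ φ : (Fin 4 → ZMod n) → ℝ, |X 0 φ| * Real.exp (-(S 0 φ)) := by
  rw [← integral_sub (integrable_bdd_mul_w n g F hF M hM) (integrable_bdd_mul_w n 0 F hF M hM),
    ← integral_const_mul]
  refine norm_integral_le_of_norm_le ((integrable_abs_X_mul_exp_neg_S n).const_mul (M * |g|))
    (Filter.Eventually.of_forall (fun φ => ?_))
  rw [← mul_sub, norm_mul]
  calc ‖F φ‖ * ‖w g 0 φ - w 0 0 φ‖ ≤ M * (|g| * |X 0 φ| * Real.exp (-(S 0 φ))) :=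
        mul_le_mul (hM φ) (norm_w_sub_w_zero_le g φ) (norm_nonneg _) hM0
    _ = M * |g| * (|X 0 φ| * Real.exp (-(S 0 φ))) := by ring

/-- fixed-volume continuity of the partition function in `g`:
`‖Z_N(g,0) − Z_N(0,0)‖ ≤ |g|·∫|X_0|e^{−S_0}`. [folklore] -/
private theorem norm_Z_sub_Z_zero_le (n : ℕ) [NeZero n] (g : ℝ) :
    ‖Z n g 0 - Z n 0 0‖ ≤ |g| * ∫ φ : (Fin 4 → ZMod n) → ℝ, |X 0 φ| * Real.exp (-(S 0 φ)) := by
  unfold Z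
  rw [← integral_sub (integrable_w n g 0) (integrable_w n 0 0), ← integral_const_mul]
  refine norm_integral_le_of_norm_le ((integrable_abs_X_mul_exp_neg_S n).const_mul |g|)
    (Filter.Eventually.of_forall (fun φ => ?_))
  calc ‖w g 0 φ - w 0 0 φ‖ ≤ |g| * |X 0 φ| * Real.exp (-(S 0 φ)) := norm_w_sub_w_zero_le g φ
    _ = |g| * (|X 0 φ| * Real.exp (-(S 0 φ))) := by ring

/-- hence `|Z_N(g,0)| ≥ Z_N(0,0)/2` as soon as `g·∫|X_0|e^{−S_0} ≤ Z_N(0,0)/2`. [folklore] -/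
private theorem half_Z_zero_le_norm_Z (n : ℕ) [NeZero n] (g : ℝ) (hg0 : 0 ≤ g)
    (hg : g * ∫ φ : (Fin 4 → ZMod n) → ℝ, |X 0 φ| * Real.exp (-(S 0 φ))
        ≤ (∫ φ : (Fin 4 → ZMod n) → ℝ, Real.exp (-(S 0 φ))) / 2) :
    (∫ φ : (Fin 4 → ZMod n) → ℝ, Real.exp (-(S 0 φ))) / 2 ≤ ‖Z n g 0‖ := by
  have hZ0 : ‖Z n 0 0‖ = ∫ φ : (Fin 4 → ZMod n) → ℝ, Real.exp (-(S 0 φ)) := by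
    rw [Z_zero_zero_eq, Complex.norm_real, Real.norm_eq_abs, abs_of_pos (Z_zero_zero_pos n)]
  have h1 := norm_Z_sub_Z_zero_le n g
  rw [abs_of_nonneg hg0] at h1
  have h2 := norm_sub_norm_le (Z n 0 0) (Z n g 0)
  rw [norm_sub_rev] at h2
  linarith

/-- `‖u‖_∞² ≤ Σ u_i²`. [folklore] -/
private theorem norm_sq_le_sum_sq (u : Fin 4 → ℝ) : ‖u‖ ^ 2 ≤ ∑ i : Fin 4, (u i) ^ 2 := by
  have h0 : 0 ≤ ∑ i : Fin 4, (u i) ^ 2 := Finset.sum_nonneg (fun i _ => sq_nonneg _)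
  have h1 : ‖u‖ ≤ Real.sqrt (∑ i : Fin 4, (u i) ^ 2) := by
    refine (pi_norm_le_iff_of_nonneg (Real.sqrt_nonneg _)).mpr (fun i => ?_)
    rw [Real.norm_eq_abs, ← Real.sqrt_sq_eq_abs]
    exact Real.sqrt_le_sqrt
      (Finset.single_le_sum (f := fun j : Fin 4 => (u j) ^ 2) (fun j _ => sq_nonneg _)
        (Finset.mem_univ i))
  calc ‖u‖ ^ 2 ≤ (Real.sqrt (∑ i : Fin 4, (u i) ^ 2)) ^ 2 := pow_le_pow_left₀ (norm_nonneg _) h1 2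
    _ = ∑ i : Fin 4, (u i) ^ 2 := Real.sq_sqrt h0

/-- **Fixed volume, cumulant form:** on every torus there are `g₀ > 0` and `C` (depending on the
torus) with `Z_n(g,0) ≠ 0` and `‖⟨Y_u²⟩_g − ⟨Y_u⟩_g²‖ ≤ C·|Λ|·|u|²` for all `0 ≤ g ≤ g₀` and all twists
`u`. [cite: AdamsBuchholzKoteckyMuller2019, Thm 2.2] -/
theorem cumulantBound_fixedVolume (n : ℕ) [NeZero n] :
    ∃ g₀ C : ℝ, 0 < g₀ ∧ ∀ g : ℝ, 0 ≤ g → g ≤ g₀ →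
      Z n g 0 ≠ 0 ∧ ∀ u : Fin 4 → ℝ,
        ‖ev n g (fun φ => ((Y u φ ^ 2 : ℝ) : ℂ)) - (ev n g (fun φ => ((Y u φ : ℝ) : ℂ))) ^ 2‖
          ≤ C * (Fintype.card (Fin 4 → ZMod n) : ℝ) * ∑ i : Fin 4, (u i) ^ 2 := by
  set Z₀ : ℝ := ∫ φ : (Fin 4 → ZMod n) → ℝ, Real.exp (-(S 0 φ)) with hZ₀def
  set IX : ℝ := ∫ φ : (Fin 4 → ZMod n) → ℝ, |X 0 φ| * Real.exp (-(S 0 φ)) with hIXdef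
  set J1 : ℝ := ∫ φ : (Fin 4 → ZMod n) → ℝ, S 0 φ * Real.exp (-(S 0 φ)) with hJ1def
  set J2 : ℝ := ∫ φ : (Fin 4 → ZMod n) → ℝ, (S 0 φ) ^ 2 * Real.exp (-(S 0 φ)) with hJ2def
  have hZ₀ : 0 < Z₀ := Z_zero_zero_pos n
  have hIX : 0 ≤ IX := integral_nonneg (fun φ => mul_nonneg (abs_nonneg _) (Real.exp_pos _).le)
  have hJ1 : 0 ≤ J1 :=
    integral_nonneg (fun φ => mul_nonneg (S_zero_nonneg φ) (Real.exp_pos _).le)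
  have hJ2 : 0 ≤ J2 := integral_nonneg (fun φ => mul_nonneg (sq_nonneg _) (Real.exp_pos _).le)
  have hcard : (1 : ℝ) ≤ (Fintype.card (Fin 4 → ZMod n) : ℝ) := by
    exact_mod_cast Fintype.card_pos
  refine ⟨Z₀ / (2 * (IX + 1)), 36 * J2 / (Z₀ / 2) + (6 * J1 / (Z₀ / 2)) ^ 2, by positivity, ?_⟩
  intro g hg0 hg1
  have hgI : g * IX ≤ Z₀ / 2 := by
    calc g * IX ≤ Z₀ / (2 * (IX + 1)) * IX := mul_le_mul_of_nonneg_right hg1 hIX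
      _ ≤ Z₀ / 2 := by
          rw [div_mul_eq_mul_div, div_le_div_iff₀ (by positivity) (by positivity)]
          nlinarith
  have hZg : Z₀ / 2 ≤ ‖Z n g 0‖ := half_Z_zero_le_norm_Z n g hg0 hgI
  have hZgpos : 0 < ‖Z n g 0‖ := lt_of_lt_of_le (by positivity) hZg
  have hZne : Z n g 0 ≠ 0 := norm_pos_iff.mp hZgpos
  refine ⟨hZne, fun u => ?_⟩
  have hu0 : 0 ≤ ‖u‖ := norm_nonneg u
  have hN2 : ‖∫ φ : (Fin 4 → ZMod n) → ℝ, ((Y u φ ^ 2 : ℝ) : ℂ) * w g 0 φ‖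
      ≤ 36 * ‖u‖ ^ 2 * J2 := by
    have h := norm_integral_mul_w_le n g (fun φ => ((Y u φ ^ 2 : ℝ) : ℂ))
      (fun φ => (6 * ‖u‖) ^ 2 * (S 0 φ) ^ 2)
      (((integrable_S_sq_mul_exp_neg_S n).const_mul ((6 * ‖u‖) ^ 2)).congr
        (Filter.Eventually.of_forall (fun φ => by
          show (6 * ‖u‖) ^ 2 * ((S 0 φ) ^ 2 * Real.exp (-(S 0 φ)))
            = (6 * ‖u‖) ^ 2 * (S 0 φ) ^ 2 * Real.exp (-(S 0 φ))
          ring)))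
      (fun φ => by
        rw [Complex.norm_real, Real.norm_eq_abs, abs_of_nonneg (sq_nonneg _), ← mul_pow, ← sq_abs]
        exact pow_le_pow_left₀ (abs_nonneg _) (abs_Y_le u φ) 2)
    refine le_trans h (le_of_eq ?_)
    rw [hJ2def, ← integral_const_mul]
    refine integral_congr_ae (Filter.Eventually.of_forall (fun φ => ?_))
    show (6 * ‖u‖) ^ 2 * (S 0 φ) ^ 2 * Real.exp (-(S 0 φ))
      = 36 * ‖u‖ ^ 2 * ((S 0 φ) ^ 2 * Real.exp (-(S 0 φ)))
    ring
  have hN1 : ‖∫ φ : (Fin 4 → ZMod n) → ℝ, ((Y u φ : ℝ) : ℂ) * w g 0 φ‖ ≤ 6 * ‖u‖ * J1 := by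
    have h := norm_integral_mul_w_le n g (fun φ => ((Y u φ : ℝ) : ℂ))
      (fun φ => 6 * ‖u‖ * S 0 φ)
      (((integrable_S_mul_exp_neg_S n).const_mul (6 * ‖u‖)).congr
        (Filter.Eventually.of_forall (fun φ => by
          show 6 * ‖u‖ * (S 0 φ * Real.exp (-(S 0 φ))) = 6 * ‖u‖ * S 0 φ * Real.exp (-(S 0 φ))
          ring)))
      (fun φ => by rw [Complex.norm_real, Real.norm_eq_abs]; exact abs_Y_le u φ)
    refine le_trans h (le_of_eq ?_)
    rw [hJ1def, ← integral_const_mul]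
    refine integral_congr_ae (Filter.Eventually.of_forall (fun φ => ?_))
    show 6 * ‖u‖ * S 0 φ * Real.exp (-(S 0 φ)) = 6 * ‖u‖ * (S 0 φ * Real.exp (-(S 0 φ)))
    ring
  have hE2 : ‖ev n g (fun φ => ((Y u φ ^ 2 : ℝ) : ℂ))‖ ≤ 36 * ‖u‖ ^ 2 * J2 / (Z₀ / 2) := by
    unfold ev
    rw [norm_div]
    exact div_le_div₀ (by positivity) hN2 (by positivity) hZg
  have hE1 : ‖ev n g (fun φ => ((Y u φ : ℝ) : ℂ))‖ ≤ 6 * ‖u‖ * J1 / (Z₀ / 2) := by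
    unfold ev
    rw [norm_div]
    exact div_le_div₀ (by positivity) hN1 (by positivity) hZg
  have hE1sq : ‖ev n g (fun φ => ((Y u φ : ℝ) : ℂ))‖ ^ 2 ≤ (6 * ‖u‖ * J1 / (Z₀ / 2)) ^ 2 :=
    pow_le_pow_left₀ (norm_nonneg _) hE1 2
  have husq := norm_sq_le_sum_sq u
  have hsum0 : 0 ≤ ∑ i : Fin 4, (u i) ^ 2 := Finset.sum_nonneg (fun i _ => sq_nonneg _)
  have hC : 0 ≤ 36 * J2 / (Z₀ / 2) + (6 * J1 / (Z₀ / 2)) ^ 2 := by positivity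
  calc ‖ev n g (fun φ => ((Y u φ ^ 2 : ℝ) : ℂ)) - (ev n g (fun φ => ((Y u φ : ℝ) : ℂ))) ^ 2‖
      ≤ ‖ev n g (fun φ => ((Y u φ ^ 2 : ℝ) : ℂ))‖ + ‖(ev n g (fun φ => ((Y u φ : ℝ) : ℂ))) ^ 2‖ :=
        norm_sub_le _ _
    _ = ‖ev n g (fun φ => ((Y u φ ^ 2 : ℝ) : ℂ))‖ + ‖ev n g (fun φ => ((Y u φ : ℝ) : ℂ))‖ ^ 2 := by
        rw [norm_pow]
    _ ≤ 36 * ‖u‖ ^ 2 * J2 / (Z₀ / 2) + (6 * ‖u‖ * J1 / (Z₀ / 2)) ^ 2 := add_le_add hE2 hE1sq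
    _ = (36 * J2 / (Z₀ / 2) + (6 * J1 / (Z₀ / 2)) ^ 2) * ‖u‖ ^ 2 := by ring
    _ ≤ (36 * J2 / (Z₀ / 2) + (6 * J1 / (Z₀ / 2)) ^ 2) * ∑ i : Fin 4, (u i) ^ 2 := by gcongr
    _ ≤ (36 * J2 / (Z₀ / 2) + (6 * J1 / (Z₀ / 2)) ^ 2) * (Fintype.card (Fin 4 → ZMod n) : ℝ)
          * ∑ i : Fin 4, (u i) ^ 2 := by nlinarith [mul_nonneg hC hsum0]

/-- **Fixed volume, local two-point form:** on every torus there are `g₀ > 0` and `C` with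
`Z_n(g,0) ≠ 0` and `‖⟨cos(∂_iφ(x)/√K)⟩_g − ⟨cos(∂_iφ(x)/√K)⟩_0‖ ≤ C·g` for all `0 ≤ g ≤ g₀`, `K ≥ 1`,
sites and axes. [cite: AdamsBuchholzKoteckyMuller2019, Thm 2.2] -/
theorem localTwoPoint_fixedVolume (n : ℕ) [NeZero n] :
    ∃ g₀ C : ℝ, 0 < g₀ ∧ ∀ g : ℝ, 0 ≤ g → g ≤ g₀ →
      Z n g 0 ≠ 0 ∧ ∀ K : ℝ, 1 ≤ K → ∀ (x : Fin 4 → ZMod n) (i : Fin 4),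
        ‖ev n g (fun φ => ((Real.cos (D φ i x / Real.sqrt K) : ℝ) : ℂ))
            - ev n 0 (fun φ => ((Real.cos (D φ i x / Real.sqrt K) : ℝ) : ℂ))‖ ≤ C * g := by
  set Z₀ : ℝ := ∫ φ : (Fin 4 → ZMod n) → ℝ, Real.exp (-(S 0 φ)) with hZ₀def
  set IX : ℝ := ∫ φ : (Fin 4 → ZMod n) → ℝ, |X 0 φ| * Real.exp (-(S 0 φ)) with hIXdef
  have hZ₀ : 0 < Z₀ := Z_zero_zero_pos n
  have hIX : 0 ≤ IX := integral_nonneg (fun φ => mul_nonneg (abs_nonneg _) (Real.exp_pos _).le)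
  refine ⟨Z₀ / (2 * (IX + 1)), 4 * IX / Z₀, by positivity, ?_⟩
  intro g hg0 hg1
  have hgI : g * IX ≤ Z₀ / 2 := by
    calc g * IX ≤ Z₀ / (2 * (IX + 1)) * IX := mul_le_mul_of_nonneg_right hg1 hIX
      _ ≤ Z₀ / 2 := by
          rw [div_mul_eq_mul_div, div_le_div_iff₀ (by positivity) (by positivity)]
          nlinarith
  have hZg : Z₀ / 2 ≤ ‖Z n g 0‖ := half_Z_zero_le_norm_Z n g hg0 hgI
  have hZgpos : 0 < ‖Z n g 0‖ := lt_of_lt_of_le (by positivity) hZg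
  have hZne : Z n g 0 ≠ 0 := norm_pos_iff.mp hZgpos
  have hZ0ne : Z n 0 0 ≠ 0 := Z_zero_zero_ne n
  have hZ0norm : ‖Z n 0 0‖ = Z₀ := by
    rw [Z_zero_zero_eq, Complex.norm_real, Real.norm_eq_abs, abs_of_pos (Z_zero_zero_pos n)]
  refine ⟨hZne, fun K hK x i => ?_⟩
  set c : ((Fin 4 → ZMod n) → ℝ) → ℂ := fun φ => ((Real.cos (D φ i x / Real.sqrt K) : ℝ) : ℂ)
    with hcdef
  have hc_cont : Continuous c := by
    have hD : Continuous (fun φ : (Fin 4 → ZMod n) → ℝ => D φ i x) := by unfold D; fun_prop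
    exact Complex.continuous_ofReal.comp (Real.continuous_cos.comp (hD.div_const _))
  have hc_le : ∀ φ, ‖c φ‖ ≤ 1 := fun φ => by
    rw [hcdef, Complex.norm_real, Real.norm_eq_abs]
    exact Real.abs_cos_le_one _
  set Ag : ℂ := ∫ φ : (Fin 4 → ZMod n) → ℝ, c φ * w g 0 φ with hAgdef
  set A0 : ℂ := ∫ φ : (Fin 4 → ZMod n) → ℝ, c φ * w 0 0 φ with hA0def
  have hA : ‖Ag - A0‖ ≤ 1 * |g| * IX := norm_integral_mul_w_sub_le n g c hc_cont 1 zero_le_one hc_le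
  rw [one_mul, abs_of_nonneg hg0] at hA
  have hA0 : ‖A0‖ ≤ Z₀ := by
    have h := norm_integral_mul_w_le n 0 c (fun _ => 1)
      ((integrable_exp_neg_S_zero n).congr (Filter.Eventually.of_forall (fun φ => by
        show Real.exp (-(S 0 φ)) = 1 * Real.exp (-(S 0 φ)); ring))) hc_le
    refine le_trans h (le_of_eq ?_)
    rw [hZ₀def]
    exact integral_congr_ae (Filter.Eventually.of_forall (fun φ => one_mul _))
  have hZdiff : ‖Z n 0 0 - Z n g 0‖ ≤ g * IX := by
    rw [norm_sub_rev]
    have h := norm_Z_sub_Z_zero_le n g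
    rwa [abs_of_nonneg hg0] at h
  have key : ev n g c - ev n 0 c
      = ((Ag - A0) * Z n 0 0 + A0 * (Z n 0 0 - Z n g 0)) / (Z n g 0 * Z n 0 0) := by
    unfold ev
    rw [← hAgdef, ← hA0def]
    field_simp
    ring
  have hnum : ‖(Ag - A0) * Z n 0 0 + A0 * (Z n 0 0 - Z n g 0)‖ ≤ 2 * g * IX * Z₀ := by
    calc ‖(Ag - A0) * Z n 0 0 + A0 * (Z n 0 0 - Z n g 0)‖
        ≤ ‖(Ag - A0) * Z n 0 0‖ + ‖A0 * (Z n 0 0 - Z n g 0)‖ := norm_add_le _ _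
      _ = ‖Ag - A0‖ * Z₀ + ‖A0‖ * ‖Z n 0 0 - Z n g 0‖ := by rw [norm_mul, norm_mul, hZ0norm]
      _ ≤ (g * IX) * Z₀ + Z₀ * (g * IX) := by
          gcongr
      _ = 2 * g * IX * Z₀ := by ring
  have hden : Z₀ / 2 * Z₀ ≤ ‖Z n g 0 * Z n 0 0‖ := by
    rw [norm_mul, hZ0norm]
    exact mul_le_mul_of_nonneg_right hZg hZ₀.le
  show ‖ev n g c - ev n 0 c‖ ≤ 4 * IX / Z₀ * g
  rw [key, norm_div]
  calc ‖(Ag - A0) * Z n 0 0 + A0 * (Z n 0 0 - Z n g 0)‖ / ‖Z n g 0 * Z n 0 0‖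
      ≤ (2 * g * IX * Z₀) / (Z₀ / 2 * Z₀) := div_le_div₀ (by positivity) hnum (by positivity) hden
    _ = 4 * IX / Z₀ * g := by
        field_simp
        ring

/-- **Fixed volume, the three stiffness clauses:** on every torus `(ℤ/n)^4` there is `g₀ > 0`
(depending on the torus) such that clauses (a)–(c) of `StiffnessAt` hold for all `0 ≤ g ≤ g₀` —
unconditionally.  What the volume-uniform statement adds is exactly `∃ g₀` BEFORE `∀ N`. [cite: AdamsBuchholzKoteckyMuller2019, Thm 2.2] -/
theorem stiffness_fixedVolume (n : ℕ) [NeZero n] :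
    ∃ g₀ : ℝ, 0 < g₀ ∧ ∀ g : ℝ, 0 ≤ g → g ≤ g₀ →
    Z n g 0 ≠ 0 ∧
    (∀ K : ℝ, 1 ≤ K → ∀ (x : Fin 4 → ZMod n) (i : Fin 4),
      (1/2 : ℝ) ≤ (ev n g (fun φ => ((Real.cos (D φ i x / Real.sqrt K) : ℝ) : ℂ))).re) ∧
    (∀ u : Fin 4 → ℝ,
      ‖Upsilon n g u - ((∑ i : Fin 4, (u i) ^ 2 : ℝ) : ℂ)‖ ≤ (∑ i : Fin 4, (u i) ^ 2) / 2) := by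
  obtain ⟨g₁, C₁, hg₁, h1⟩ := cumulantBound_fixedVolume n
  obtain ⟨g₂, C₂, hg₂, h2⟩ := localTwoPoint_fixedVolume n
  have hd1 : 0 < 2 * (|C₁| + 1) := by positivity
  have hd2 : 0 < |C₂| + 1 := by positivity
  refine ⟨min g₁ (min g₂ (min (1 / (2 * (|C₁| + 1))) (1 / 6 / (|C₂| + 1)))),
    lt_min hg₁ (lt_min hg₂ (lt_min (by positivity) (by positivity))), ?_⟩
  intro g hg0 hg
  have hg_1 : g ≤ g₁ := le_trans hg (min_le_left _ _)
  have hg_2 : g ≤ g₂ := le_trans (le_trans hg (min_le_right _ _)) (min_le_left _ _)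
  have hg_3 : g ≤ 1 / (2 * (|C₁| + 1)) :=
    le_trans (le_trans (le_trans hg (min_le_right _ _)) (min_le_right _ _)) (min_le_left _ _)
  have hg_4 : g ≤ 1 / 6 / (|C₂| + 1) :=
    le_trans (le_trans (le_trans hg (min_le_right _ _)) (min_le_right _ _)) (min_le_right _ _)
  obtain ⟨hZ, hV⟩ := h1 g hg0 hg_1
  obtain ⟨_, hloc⟩ := h2 g hg0 hg_2
  refine ⟨hZ, ?_, ?_⟩
  · intro K hK x i
    have hdiff := hloc K hK x i
    have hlow := cosLowerBoundAt_two_thirds n K hK x i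
    set a : ℂ := ev n g (fun φ => ((Real.cos (D φ i x / Real.sqrt K) : ℝ) : ℂ)) with ha
    set b : ℂ := ev n 0 (fun φ => ((Real.cos (D φ i x / Real.sqrt K) : ℝ) : ℂ)) with hb
    have hCg : C₂ * g ≤ 1 / 6 := by
      have e1 : C₂ * g ≤ |C₂| * g := mul_le_mul_of_nonneg_right (le_abs_self _) hg0
      have e2 : |C₂| * g ≤ |C₂| * (1 / 6 / (|C₂| + 1)) :=
        mul_le_mul_of_nonneg_left hg_4 (abs_nonneg _)
      have e3 : |C₂| * (1 / 6 / (|C₂| + 1)) ≤ 1 / 6 := by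
        rw [mul_div_assoc', div_le_iff₀ hd2]
        nlinarith [abs_nonneg C₂]
      linarith
    have hre : |(a - b).re| ≤ ‖a - b‖ := Complex.abs_re_le_norm _
    have h4 : |(a - b).re| ≤ 1 / 6 := le_trans hre (le_trans hdiff hCg)
    rw [Complex.sub_re] at h4
    have h5 := (abs_le.mp h4).1
    linarith
  · intro u
    have hcard : (0 : ℝ) < (Fintype.card (Fin 4 → ZMod n) : ℝ) := by
      exact_mod_cast Fintype.card_pos
    have hsum0 : 0 ≤ ∑ i : Fin 4, (u i) ^ 2 := Finset.sum_nonneg (fun i _ => sq_nonneg _)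
    set V : ℂ := ev n g (fun φ => ((Y u φ ^ 2 : ℝ) : ℂ)) - (ev n g (fun φ => ((Y u φ : ℝ) : ℂ))) ^ 2
      with hVdef
    have hU : Upsilon n g u - ((∑ i : Fin 4, (u i) ^ 2 : ℝ) : ℂ)
        = (g : ℂ) ^ 2 * V / (Fintype.card (Fin 4 → ZMod n) : ℂ) := by
      unfold Upsilon
      rw [hVdef]
      ring
    have hCg : C₁ * g ^ 2 ≤ 1 / 2 := by
      have hg1' : g ≤ 1 := by
        have : 1 / (2 * (|C₁| + 1)) ≤ 1 := by
          rw [div_le_iff₀ hd1]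
          nlinarith [abs_nonneg C₁]
        linarith
      have e0 : g ^ 2 ≤ g := by nlinarith
      have e1 : C₁ * g ^ 2 ≤ |C₁| * g :=
        calc C₁ * g ^ 2 ≤ |C₁| * g ^ 2 := mul_le_mul_of_nonneg_right (le_abs_self _) (sq_nonneg _)
          _ ≤ |C₁| * g := mul_le_mul_of_nonneg_left e0 (abs_nonneg _)
      have e2 : |C₁| * g ≤ |C₁| * (1 / (2 * (|C₁| + 1))) :=
        mul_le_mul_of_nonneg_left hg_3 (abs_nonneg _)
      have e3 : |C₁| * (1 / (2 * (|C₁| + 1))) ≤ 1 / 2 := by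
        rw [mul_div_assoc', div_le_iff₀ hd1]
        nlinarith [abs_nonneg C₁]
      linarith
    rw [hU, norm_div, norm_mul, norm_pow, Complex.norm_real, Complex.norm_natCast, Real.norm_eq_abs,
      abs_of_nonneg hg0, div_le_iff₀ hcard]
    calc g ^ 2 * ‖V‖
        ≤ g ^ 2 * (C₁ * (Fintype.card (Fin 4 → ZMod n) : ℝ) * ∑ i : Fin 4, (u i) ^ 2) :=
          mul_le_mul_of_nonneg_left (hV u) (sq_nonneg g)
      _ = (C₁ * g ^ 2) * ((∑ i : Fin 4, (u i) ^ 2) * (Fintype.card (Fin 4 → ZMod n) : ℝ)) := by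
          ring
      _ ≤ (1 / 2) * ((∑ i : Fin 4, (u i) ^ 2) * (Fintype.card (Fin 4 → ZMod n) : ℝ)) :=
          mul_le_mul_of_nonneg_right hCg (by positivity)
      _ = (∑ i : Fin 4, (u i) ^ 2) / 2 * (Fintype.card (Fin 4 → ZMod n) : ℝ) := by ring

end Literature.MathematicalPhysics.StatisticalMechanics.ComplexGradientGFF4

end
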